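import Literature.Barriers.CriticalPhenomena.LaceExpansionGaussianDeconvolutionProp24Analysis
import HarnessLib

/-!
# Liu–Slade 2024, Proposition 2.4: `f̂ = ĈÊĜ` is `n_d` times weakly differentiable
# (`LiuSlade2024_prop24_holds`)

Barrier catalogue `Literature/Barriers/CriticalPhenomena/` (D-0021), companion of
`LaceExpansionGaussianDeconvolution.lean`, which decomposes Liu–Slade 2024, Theorem 1.2
(`LiuSlade2024_thm12_critical`, an input of Liu–Slade 2026, Thm. 1.7 and of Sakai's Theorem 1.3
for the spread-out Ising model, `LaceExpansionIsingAboveFour`) into named inputs. This file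
DISCHARGES the named fact `LiuSlade2024_prop24`:

* `LiuSlade2024_prop24_holds` — **Proposition 2.4** ("Let `F` obey Assumption 1.1. Then the
  function `f̂ = ĈÊĜ` is `n_d` times weakly differentiable") together with the `L¹` bounds of its
  proof, uniformly in `F` (the uniformity clause of Theorem 1.2): for `d > 2`, `K₁, K₂ > 0` and
  `ρ > (d-8)/2 ∨ 0` there is `C = C(d, K₁, K₂, ρ)` such that for every `F` obeying Assumption 1.1
  (`LS24Assumption d K₁ K₂ ρ F`) the function `f̂ = 1/F̂ - λ/Â_μ` (`ls24fHat F`, (1.30)) is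
  integrable on `𝕋^d` with `‖f̂‖₁ ≤ C` and has, for every word `α` of directions with
  `|α| ≤ n_d` (`lsND d ρ`, first display of §2.2), a weak derivative `f̂_α` in the sense of
  Definition A.1 (`HasTorusWeakDeriv`) with `‖f̂_α‖₁ ≤ C`.

All auxiliary material is proved in this file (sub-namespace `LiuSlade2024Prop24`); there are no
new definitions of tree-level interest and no new named facts (D-0026: net debt −1).

## The printed proof, and how it is formalized

The source (§2.2.1) computes `f̂_α` from `f̂ = Ê/(ÂF̂)` (`Â = 1 - μD̂`, `E = A_μ - λF`, (1.28))
by the product and quotient rules as an integer combination of the monomials (2.9)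
`(∏ₙ Â_{δₙ}/Â) · (Ê_{β}/(ÂF̂)) · (∏ₘ F̂_{γₘ}/F̂)`; bounds each factor in a Lebesgue class by
**Lemma 2.5** (`Â_γ/Â, F̂_γ/F̂ ∈ L^q` for `q⁻¹ > |γ|/d` and `Ê_γ/(ÂF̂) ∈ L^q` for
`q⁻¹ > (2 - σ + |γ|)/d`, `σ ∈ (0, ρ)`, `σ ≤ 2`, `|γ| < (d - 2 + ρ∧2) ∧ (d/2 + 2 + ρ)`), itself
proved in §2.2.2 from **Lemma 2.2** (`|Ê_γ(k)| ≲ K|k|^{2+σ-|γ|}` for `|γ| < 2 + σ`, from the two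
vanishing moments of `E`), the infrared bounds `Â ≳ |k|²` (1.26), `F̂ - F̂(0) ≥ K₂|k|²` (1.10) and
**Lemma 2.6** (`‖ĥ‖_q ≤ c K` for `|h| ≤ K⟦x⟧^{-b}`, `d/2 < b ≤ d`, `q < d/(d-b)`, by
Hausdorff–Young); and adds the exponents by Hölder's inequality ((2.10)–(2.12):
`r⁻¹ = Σ rₙ⁻¹ + q⁻¹ + Σ qₘ⁻¹ > (|α| + 2 - σ)/d`, and `r = 1` is allowed because
`|α| ≤ n_d < d - 2 + ρ ∧ 2`, (2.7)). The calculus rules for WEAK derivatives are Appendix A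
(Lemmas A.2–A.3, by mollification and the ACL characterisation), and derivatives of Fourier
series are computed termwise by Lemma A.4.

The formalization keeps this architecture — the same three factor families, the same Lebesgue
classes with the same exponents `|γ|/d` and `(2 - σ + |γ|)/d` (plus a margin `τ`), Lemma 2.2 with
its four cases `|γ| = 0, 1, 2, 3`, the infrared bounds, the Hölder bookkeeping (2.11) monomial by
monomial, `σ := (s₀ + ρ∧2)/2` with `n_d = d - 2 + s₀` — with two deviations imposed by the library
(Mathlib has neither the Hausdorff–Young inequality on `ℤ^d` nor the ACL theory of Appendix A):

1. *Classical calculus at level `N`, then ONE weak limit* (in place of Lemmas A.2–A.3). `F` is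
   truncated to `F_N = F·1{‖x‖_∞ ≤ 2^N}` (`truncF`); the constants `λ_N, μ_N` ((1.12)) and
   `E_N = A_{μ_N} - λ_N F_N` are re-derived from `F_N`, so that `Σ_x E_N = Σ_x |x|²E_N = 0` hold
   exactly (as Lemma 2.2 requires) and `λ_N → λ`, `μ_N → μ` (`tendsto_ls24Lambda_truncF`,
   `tendsto_ls24Mu_truncF`); all level-`N` transforms are trigonometric polynomials, and the two
   denominators are shifted by `ε_N = 2(tail_N + |μ_N - μ|) + 1/(N+1) → 0`, chosen so that
   `Re(Â_{μ_N} + ε_N) ≥ Re Â_μ` and `Re(F̂_N + ε_N) ≥ Re F̂` pointwise (`re_AhatN_add_epsN_pos`,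
   `re_FhatN_add_epsN_ge`): the level-`N` factors are smooth, obey the SAME majorants as the limit
   factors, and their classical `∂ⱼ` obeys the three formal rules
   `∂ⱼ(Â_w g_A) = Â_{jw} g_A - (Â_j g_A)(Â_w g_A)` etc. (`factor_rules`), so that `∂ⱼ` of an
   evaluated formal sum of monomials is the evaluation of its formal derivative
   (`partialDeriv_evalF`; the formal sum of `∇^α f̂` is `fDeriv α`, its monomials are well formed
   of order `|α|` with coefficient mass `≤ (4n_d+3)^{|α|}`, `Mono.WF_fDeriv`, `mass_fDeriv_le`).
   Each factor converges in its Lebesgue class as `N → ∞` (`packP`, `packR`, `packQ`: a generic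
   "numerator in `L^{1/s₁}` times dominated weight `≲ |k|^{-a}` in `L^{1/s₂}`" lemma
   `factor_package`, Hölder plus dominated convergence), hence so does each monomial in `L¹`
   (`mono_facts`, finite Hölder `eLpNorm_finset_prod_le`) and each formal sum (`fsum_facts`), and
   weak derivatives pass to `L¹` limits word by word (`hasWeakPartialDeriv_of_tendsto`,
   `weakDeriv_facts`). At `N = ∞` the starting formal sum is `Ê/(ÂF̂) = 1/F̂ - λ/Â = f̂` a.e.
   (`evalF_fDeriv_nil_ae`).
2. *Lemma 2.6 (ii) / Lemma A.4 without Hausdorff–Young.* For `|c(x)| ≤ K⟦x⟧^{-b}` with `b > d/2`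
   the transform `ĉ` is defined as the a.e. limit of the DYADIC box partial sums (`dFT`,
   `ae_tendsto_dyadicSum`), and `‖ĉ‖_q ≤ c_{d,b,q} K` for `2 ≤ q < d/(d-b)` together with
   `L^q` convergence of the dyadic sums (`eLpNorm_dFT_le`, `tendsto_eLpNorm_dFT_sub_dyadicSum`) is
   proved by interpolating, on each dyadic shell, the trivial sup bound with Parseval
   (`eLpNorm_trigPoly_shell_le`: `‖P_shell‖_q ≤ 8^d K 2^{-nθ}`, `θ = d/q - (d - b) > 0`) and
   summing the geometric series; `∂ⱼ ĉ = (2πi xⱼ c)^` weakly (`hasWeakPartialDeriv_dFT`) then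
   follows from the classical derivative of the partial sums. This is the only place where the
   constants differ from the source's (unspecified) `c_{d,b,q}`.

Smaller points: multi-indices are words (`List (Fin d)`), `x^α ↦ (2πi x)^w` (`coefW`), and the
torus is Mathlib's `UnitAddTorus (Fin d) = (ℝ/ℤ)^d` with Haar probability measure, coordinate
`t = k/2π`, modulus `ϱ(t) = (Σ‖tᵢ‖²)^{1/2} = |k|/2π` (`tnorm`); the infrared bounds read
`Re F̂ ≥ K₂ϱ²` and `Re Â_μ ≥ (8μ/d)ϱ²` (`re_latticeFourier_ge`, `re_latticeFourier_lsA_ge`), and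
(1.10) forces `F'' ≥ dK₂/(2π²)` (`ls24Fpp_ge_of_assumption`), whence `0 < λ ≤ 2π²/(dK₂)` and
`μ₀(d,K₁,K₂,ρ) ≤ μ ≤ 1` (`params_of_assumption`) — the source of the uniformity in `F`.

## References

* Y. Liu, G. Slade, *Gaussian deconvolution and the lace expansion*, Probab. Theory Related
  Fields 195 (2024), arXiv:2310.07635: §1.1 (Assumption 1.1, (1.10), (1.12)), §1.4.2
  ((1.26)–(1.30)), §2.1 (Lemma 2.2 and its proof), §2.2 ((2.7), Proposition 2.4 and its proof
  (2.9)–(2.12), Lemma 2.5, Lemma 2.6 and §2.2.2), Appendix A (Definition A.1, Lemmas A.2–A.4)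
  [LiuSlade2024].
-/

noncomputable section

namespace Literature.Barriers.CriticalPhenomena.SpreadOutIsing

open Filter UnitAddTorus Literature.Probability.LatticeModels Real
open Literature.Analysis.FunctionSpaces Literature.Analysis.FunctionSpaces.Torus
open _root_.MeasureTheory _root_.Topology
open scoped ENNReal

variable {d : ℕ}

local notation "𝕋" d => UnitAddTorus (Fin d)

namespace LiuSlade2024Prop24

/-! ### The monomial calculus: `Â_δ/Â`, `Ê_β/(ÂF̂)`, `F̂_γ/F̂` factors and the formal `∂ⱼ`

Abstract over three families `P Q R : List (Fin d) → 𝕋^d → ℂ` (word ↦ factor) obeying the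
derivative rules of the three factor types (display (2.9) of the source and its derivation by the
product and quotient rules): `∂ⱼ P_w = P_{jw} - P_j P_w`, `∂ⱼ R_w = R_{jw} - R_j R_w`,
`∂ⱼ Q_w = Q_{jw} - P_j Q_w - R_j Q_w`. -/

section MonomialCalculus

/-- Replace the `i`-th entry `a` of a list by `f a` (no-op past the end). [folklore] -/
def modifyAt {α : Type*} (f : α → α) : ℕ → List α → List α
  | _, [] => []
  | 0, a :: l => f a :: l
  | i + 1, a :: l => a :: modifyAt f i l

/-- `modifyAt` on the empty list. [folklore] -/
@[simp] theorem modifyAt_nil {α : Type*} (f : α → α) (i : ℕ) : modifyAt f i ([] : List α) = [] := by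
  cases i <;> rfl

/-- `modifyAt` at the head. [folklore] -/
@[simp] theorem modifyAt_zero_cons {α : Type*} (f : α → α) (a : α) (l : List α) :
    modifyAt f 0 (a :: l) = f a :: l := rfl

/-- `modifyAt` past the head. [folklore] -/
@[simp] theorem modifyAt_succ_cons {α : Type*} (f : α → α) (i : ℕ) (a : α) (l : List α) :
    modifyAt f (i + 1) (a :: l) = a :: modifyAt f i l := rfl

/-- `modifyAt` preserves the length. [folklore] -/
@[simp] theorem length_modifyAt {α : Type*} (f : α → α) : ∀ (i : ℕ) (l : List α),
    (modifyAt f i l).length = l.length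
  | _, [] => by simp
  | 0, a :: l => by simp
  | i + 1, a :: l => by simp [length_modifyAt f i l]

/-- An entry of `modifyAt f i l` is an entry of `l` or the image of one under `f`. [folklore] -/
theorem mem_modifyAt {α : Type*} (f : α → α) : ∀ (i : ℕ) (l : List α) (b : α),
    b ∈ modifyAt f i l → b ∈ l ∨ ∃ a ∈ l, b = f a
  | _, [], b, h => by simp at h
  | 0, a :: l, b, h => by
    simp only [modifyAt_zero_cons, List.mem_cons] at h
    rcases h with rfl | h
    · exact Or.inr ⟨a, by simp, rfl⟩
    · exact Or.inl (List.mem_cons_of_mem a h)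
  | i + 1, a :: l, b, h => by
    simp only [modifyAt_succ_cons, List.mem_cons] at h
    rcases h with rfl | h
    · exact Or.inl (by simp)
    · rcases mem_modifyAt f i l b h with h' | ⟨a', ha', rfl⟩
      · exact Or.inl (List.mem_cons_of_mem a h')
      · exact Or.inr ⟨a', List.mem_cons_of_mem a ha', rfl⟩

/-- A monomial of display (2.9): words `δs` (factors `Â_δ/Â`), `β` (the factor `Ê_β/(ÂF̂)`), `γs`
(factors `F̂_γ/F̂`). [cite: LiuSlade2024, §2.2.1 (display (2.9))] -/
structure Mono (d : ℕ) where
  /-- the words `δ_n` of the `Â_{δ_n}/Â` factors -/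
  δs : List (List (Fin d))
  /-- the word `α₂` of the `Ê_{α₂}/(ÂF̂)` factor -/
  β : List (Fin d)
  /-- the words `γ_m` of the `F̂_{γ_m}/F̂` factors -/
  γs : List (List (Fin d))

/-- Formal `ℤ`-linear combinations of monomials. [cite: LiuSlade2024, §2.2.1 ("f̂_α is given by a linear combination of terms of the form (2.9)")] -/
abbrev FSum (d : ℕ) := List (ℤ × Mono d)

variable (P Q R : List (Fin d) → (𝕋 d) → ℂ)

/-- The product of the factors of one type over a list of words. [folklore] -/
def prodW (X : List (Fin d) → (𝕋 d) → ℂ) (ws : List (List (Fin d))) (t : 𝕋 d) : ℂ :=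
  (ws.map fun w => X w t).prod

/-- Evaluation of a monomial. [cite: LiuSlade2024, §2.2.1 (display (2.9))] -/
def evalM (m : Mono d) (t : 𝕋 d) : ℂ := prodW P m.δs t * Q m.β t * prodW R m.γs t

/-- Evaluation of a formal sum. [folklore] -/
def evalF (L : FSum d) (t : 𝕋 d) : ℂ := (L.map fun zm => (zm.1 : ℂ) * evalM P Q R zm.2 t).sum

/-- The formal derivative `∂ⱼ` of a monomial (product and quotient rules):
`Σ_n m[δ_n += j] + m[β += j] + Σ_m m[γ_m += j] - (1 + #δs) m[δs += (j)] - (1 + #γs) m[γs += (j)]`.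
[cite: LiuSlade2024, §2.2.1 (derivation of display (2.9))] -/
def Dm (j : Fin d) (m : Mono d) : FSum d :=
  ((List.range m.δs.length).map fun i => ((1 : ℤ), ({ m with δs := modifyAt (fun w => j :: w) i m.δs } : Mono d)))
  ++ [((1 : ℤ), ({ m with β := j :: m.β } : Mono d))]
  ++ ((List.range m.γs.length).map fun i => ((1 : ℤ), ({ m with γs := modifyAt (fun w => j :: w) i m.γs } : Mono d)))
  ++ [(-((m.δs.length : ℤ) + 1), ({ m with δs := [j] :: m.δs } : Mono d)),
      (-((m.γs.length : ℤ) + 1), ({ m with γs := m.γs ++ [[j]] } : Mono d))]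

/-- The formal derivative of a formal sum. [folklore] -/
def DF (j : Fin d) (L : FSum d) : FSum d :=
  L.flatMap fun zm => (Dm j zm.2).map fun zm' => (zm.1 * zm'.1, zm'.2)

/-- The empty product of factors is `1`. [folklore] -/
@[simp] theorem prodW_nil (X : List (Fin d) → (𝕋 d) → ℂ) (t : 𝕋 d) : prodW X [] t = 1 := by simp [prodW]

/-- `∏_{w :: ws} X_w = X_w ∏_{ws} X_w`. [folklore] -/
@[simp] theorem prodW_cons (X : List (Fin d) → (𝕋 d) → ℂ) (w : List (Fin d)) (ws : List (List (Fin d))) (t : 𝕋 d) :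
    prodW X (w :: ws) t = X w t * prodW X ws t := by simp [prodW]

/-- Products of factors are multiplicative under concatenation. [folklore] -/
theorem prodW_append (X : List (Fin d) → (𝕋 d) → ℂ) (ws ws' : List (List (Fin d))) (t : 𝕋 d) :
    prodW X (ws ++ ws') t = prodW X ws t * prodW X ws' t := by simp [prodW]

/-- The empty formal sum evaluates to `0`. [folklore] -/
@[simp] theorem evalF_nil (t : 𝕋 d) : evalF P Q R [] t = 0 := by simp [evalF]

/-- Evaluation of a formal sum, head and tail. [folklore] -/
@[simp] theorem evalF_cons (zm : ℤ × Mono d) (L : FSum d) (t : 𝕋 d) :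
    evalF P Q R (zm :: L) t = (zm.1 : ℂ) * evalM P Q R zm.2 t + evalF P Q R L t := by simp [evalF]

/-- Evaluation is additive under concatenation of formal sums. [folklore] -/
theorem evalF_append (L L' : FSum d) (t : 𝕋 d) :
    evalF P Q R (L ++ L') t = evalF P Q R L t + evalF P Q R L' t := by simp [evalF]

/-- Evaluation of a one-term formal sum. [folklore] -/
theorem evalF_singleton (z : ℤ) (m : Mono d) (t : 𝕋 d) : evalF P Q R [(z, m)] t = (z : ℂ) * evalM P Q R m t := by
  simp [evalF]

/-- Evaluation of a formal sum with unit coefficients indexed by `range n`. [folklore] -/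
theorem evalF_map_range (n : ℕ) (g : ℕ → Mono d) (t : 𝕋 d) :
    evalF P Q R ((List.range n).map fun i => ((1 : ℤ), g i)) t = ∑ i ∈ Finset.range n, evalM P Q R (g i) t := by
  induction n with
  | zero => simp
  | succ n ih => rw [List.range_succ, List.map_append, evalF_append, ih, Finset.sum_range_succ]; simp [evalF]

/-- Scaling all coefficients by `z` scales the evaluation by `z`. [folklore] -/
theorem evalF_map_mul (z : ℤ) (L : FSum d) (t : 𝕋 d) :
    evalF P Q R (L.map fun zm' => (z * zm'.1, zm'.2)) t = (z : ℂ) * evalF P Q R L t := by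
  induction L with
  | nil => simp
  | cons zm L ih => rw [List.map_cons, evalF_cons, evalF_cons, ih]; push_cast; ring

/-- Evaluation of the formal derivative of a formal sum, term by term. [folklore] -/
theorem evalF_DF (j : Fin d) (L : FSum d) (t : 𝕋 d) :
    evalF P Q R (DF j L) t = (L.map fun zm => (zm.1 : ℂ) * evalF P Q R (Dm j zm.2) t).sum := by
  induction L with
  | nil => simp [DF]
  | cons zm L ih =>
    rw [DF, List.flatMap_cons, evalF_append, ← DF, ih, evalF_map_mul, List.map_cons, List.sum_cons]

/-! #### Classical differential calculus of the evaluations (smooth families) -/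

/-- Constant multiples: `∂ⱼ (c f) = c ∂ⱼ f`. [folklore] -/
theorem partialDeriv_const_mul {f : (𝕋 d) → ℂ} (hf : Torus.IsSmooth f) (c : ℂ) (j : Fin d) (t : 𝕋 d) :
    Torus.partialDeriv j (fun s => c * f s) t = c * Torus.partialDeriv j f t := by
  have h := ((hf.hasDerivAt_line_zero j t).const_mul c).deriv
  exact h

/-- Sums: `∂ⱼ (f + g) = ∂ⱼ f + ∂ⱼ g`. [folklore] -/
theorem partialDeriv_add' {f g : (𝕋 d) → ℂ} (hf : Torus.IsSmooth f) (hg : Torus.IsSmooth g) (j : Fin d) (t : 𝕋 d) :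
    Torus.partialDeriv j (fun s => f s + g s) t = Torus.partialDeriv j f t + Torus.partialDeriv j g t := by
  have h := ((hf.hasDerivAt_line_zero j t).add (hg.hasDerivAt_line_zero j t)).deriv
  exact h

variable {P Q R}

/-- Products of smooth factors are smooth. [folklore] -/
theorem isSmooth_prodW {X : List (Fin d) → (𝕋 d) → ℂ} (hX : ∀ w, Torus.IsSmooth (X w)) :
    ∀ ws : List (List (Fin d)), Torus.IsSmooth (prodW X ws)
  | [] => by
    have e : prodW X [] = fun _ : 𝕋 d => (1 : ℂ) := by funext s; simp
    rw [e]; exact isSmooth_const _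
  | w :: ws => by
    have e : prodW X (w :: ws) = fun s => X w s * prodW X ws s := by funext s; simp
    rw [e]; exact isSmooth_mul (hX w) (isSmooth_prodW hX ws)

/-- **Leibniz along the words of one factor type**:
`∂ⱼ Π_n X_{w_n} = Σ_n Π[w_n ↦ j w_n] - #ws · X_j · Π_n X_{w_n}`. [cite: LiuSlade2024, §2.2.1 (product rule)] -/
theorem partialDeriv_prodW {X : List (Fin d) → (𝕋 d) → ℂ} (hX : ∀ w, Torus.IsSmooth (X w)) {j : Fin d}
    (hdX : ∀ w t, Torus.partialDeriv j (X w) t = X (j :: w) t - X [j] t * X w t) :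
    ∀ (ws : List (List (Fin d))) (t : 𝕋 d), Torus.partialDeriv j (prodW X ws) t =
      (∑ i ∈ Finset.range ws.length, prodW X (modifyAt (fun w => j :: w) i ws) t) -
        ws.length * X [j] t * prodW X ws t
  | [], t => by
    simp only [List.length_nil, Finset.range_zero, Finset.sum_empty, Nat.cast_zero, zero_mul, sub_zero]
    have : prodW X [] = fun _ : 𝕋 d => (1 : ℂ) := by funext s; simp
    rw [this]
    exact deriv_const (0 : ℝ) (1 : ℂ)
  | w :: ws, t => by
    have e : prodW X (w :: ws) = fun s => X w s * prodW X ws s := by funext s; simp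
    rw [e, partialDeriv_mul (hX w) (isSmooth_prodW hX ws), hdX, partialDeriv_prodW hX hdX ws t,
      List.length_cons, Finset.sum_range_succ']
    simp only [modifyAt_zero_cons, modifyAt_succ_cons, prodW_cons]
    rw [← Finset.mul_sum]
    push_cast
    ring

/-- Monomials in smooth factors are smooth. [folklore] -/
theorem isSmooth_evalM (hP : ∀ w, Torus.IsSmooth (P w)) (hQ : ∀ w, Torus.IsSmooth (Q w))
    (hR : ∀ w, Torus.IsSmooth (R w)) (m : Mono d) : Torus.IsSmooth (evalM P Q R m) := by
  have e : evalM P Q R m = fun s => (prodW P m.δs s * Q m.β s) * prodW R m.γs s := by funext s; simp [evalM]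
  rw [e]
  exact isSmooth_mul (isSmooth_mul (isSmooth_prodW hP m.δs) (hQ m.β)) (isSmooth_prodW hR m.γs)

/-- **`∂ⱼ` of a monomial is the evaluation of its formal derivative.** [cite: LiuSlade2024, §2.2.1 (product and quotient rules give (2.9))] -/
theorem partialDeriv_evalM (hP : ∀ w, Torus.IsSmooth (P w)) (hQ : ∀ w, Torus.IsSmooth (Q w))
    (hR : ∀ w, Torus.IsSmooth (R w)) {j : Fin d}
    (hdP : ∀ w t, Torus.partialDeriv j (P w) t = P (j :: w) t - P [j] t * P w t)
    (hdQ : ∀ w t, Torus.partialDeriv j (Q w) t = Q (j :: w) t - P [j] t * Q w t - R [j] t * Q w t)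
    (hdR : ∀ w t, Torus.partialDeriv j (R w) t = R (j :: w) t - R [j] t * R w t)
    (m : Mono d) (t : 𝕋 d) :
    Torus.partialDeriv j (evalM P Q R m) t = evalF P Q R (Dm j m) t := by
  have e : evalM P Q R m = fun s => (prodW P m.δs s * Q m.β s) * prodW R m.γs s := by funext s; simp [evalM]
  rw [e, partialDeriv_mul (isSmooth_mul (isSmooth_prodW hP m.δs) (hQ m.β)) (isSmooth_prodW hR m.γs),
    partialDeriv_mul (isSmooth_prodW hP m.δs) (hQ m.β), partialDeriv_prodW hP hdP, hdQ,
    partialDeriv_prodW hR hdR]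
  -- the formal side
  rw [Dm, evalF_append, evalF_append, evalF_append, evalF_map_range, evalF_singleton, evalF_map_range,
    evalF_cons, evalF_singleton]
  simp only [evalM, prodW_cons, prodW_append, prodW_nil, mul_one]
  have h1 : (∑ i ∈ Finset.range m.δs.length, prodW P (modifyAt (fun w => j :: w) i m.δs) t) * Q m.β t * prodW R m.γs t =
      ∑ i ∈ Finset.range m.δs.length, prodW P (modifyAt (fun w => j :: w) i m.δs) t * Q m.β t * prodW R m.γs t := by
    rw [Finset.sum_mul, Finset.sum_mul]
  have h2 : prodW P m.δs t * Q m.β t * (∑ i ∈ Finset.range m.γs.length, prodW R (modifyAt (fun w => j :: w) i m.γs) t) =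
      ∑ i ∈ Finset.range m.γs.length, prodW P m.δs t * Q m.β t * prodW R (modifyAt (fun w => j :: w) i m.γs) t := by
    rw [Finset.mul_sum]
  rw [← h1, ← h2]
  push_cast
  ring

/-- Formal sums of monomials in smooth factors evaluate to smooth functions. [folklore] -/
theorem isSmooth_evalF (hP : ∀ w, Torus.IsSmooth (P w)) (hQ : ∀ w, Torus.IsSmooth (Q w))
    (hR : ∀ w, Torus.IsSmooth (R w)) : ∀ L : FSum d, Torus.IsSmooth (evalF P Q R L)
  | [] => by
    have e : evalF P Q R [] = fun _ : 𝕋 d => (0 : ℂ) := by funext s; simp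
    rw [e]; exact isSmooth_const _
  | zm :: L => by
    have h : Torus.IsSmooth (fun t => (zm.1 : ℂ) * evalM P Q R zm.2 t + evalF P Q R L t) :=
      (isSmooth_mul (isSmooth_const _) (isSmooth_evalM hP hQ hR zm.2)).add (isSmooth_evalF hP hQ hR L)
    have e : evalF P Q R (zm :: L) = fun t => (zm.1 : ℂ) * evalM P Q R zm.2 t + evalF P Q R L t := by
      funext t; simp
    rwa [e]

/-- **`∂ⱼ` of a formal sum is the evaluation of its formal derivative.** [cite: LiuSlade2024, §2.2.1] -/
theorem partialDeriv_evalF (hP : ∀ w, Torus.IsSmooth (P w)) (hQ : ∀ w, Torus.IsSmooth (Q w))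
    (hR : ∀ w, Torus.IsSmooth (R w)) {j : Fin d}
    (hdP : ∀ w t, Torus.partialDeriv j (P w) t = P (j :: w) t - P [j] t * P w t)
    (hdQ : ∀ w t, Torus.partialDeriv j (Q w) t = Q (j :: w) t - P [j] t * Q w t - R [j] t * Q w t)
    (hdR : ∀ w t, Torus.partialDeriv j (R w) t = R (j :: w) t - R [j] t * R w t) :
    ∀ (L : FSum d) (t : 𝕋 d), Torus.partialDeriv j (evalF P Q R L) t = evalF P Q R (DF j L) t
  | [], t => by
    rw [evalF_DF]
    simp only [List.map_nil, List.sum_nil]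
    have : evalF P Q R [] = fun _ : 𝕋 d => (0 : ℂ) := by funext s; simp
    rw [this]
    exact deriv_const (0 : ℝ) (0 : ℂ)
  | zm :: L, t => by
    have e : evalF P Q R (zm :: L) = fun s => (zm.1 : ℂ) * evalM P Q R zm.2 s + evalF P Q R L s := by
      funext s; simp
    rw [e, partialDeriv_add' (isSmooth_mul (isSmooth_const _) (isSmooth_evalM hP hQ hR zm.2)) (isSmooth_evalF hP hQ hR L),
      partialDeriv_const_mul (isSmooth_evalM hP hQ hR zm.2), partialDeriv_evalM hP hQ hR hdP hdQ hdR,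
      partialDeriv_evalF hP hQ hR hdP hdQ hdR L t, evalF_DF, evalF_DF, List.map_cons, List.sum_cons]

end MonomialCalculus

/-! ### Truncation `F_N = F·1_{box 2^N}` and the level-`N` constants -/

section LevelN

variable {K₁ K₂ ρ : ℝ} {F : Site d → ℝ}

/-- The truncation `F_N = F · 1_{‖x‖∞ ≤ 2^N}`. [folklore] -/
def truncF (F : Site d → ℝ) (N : ℕ) (x : Site d) : ℝ := if x ∈ box d (2 ^ N) then F x else 0

/-- `F_N = F` on the box `{‖x‖_∞ ≤ 2^N}`. [folklore] -/
theorem truncF_of_mem {N : ℕ} {x : Site d} (hx : x ∈ box d (2 ^ N)) : truncF F N x = F x := if_pos hx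

/-- `F_N = 0` off the box `{‖x‖_∞ ≤ 2^N}`. [folklore] -/
theorem truncF_of_not_mem {N : ℕ} {x : Site d} (hx : x ∉ box d (2 ^ N)) : truncF F N x = 0 := if_neg hx

/-- `|F_N| ≤ |F|`. [folklore] -/
theorem abs_truncF_le (N : ℕ) (x : Site d) : |truncF F N x| ≤ |F x| := by
  unfold truncF; split_ifs <;> simp

/-- `F_N` inherits the decay bound of `F`. [folklore] -/
theorem abs_truncF_le_of_decay {K s : ℝ} (hF : ∀ x, |F x| ≤ K / jnorm x ^ s) (N : ℕ) (x : Site d) :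
    |truncF F N x| ≤ K / jnorm x ^ s :=
  (abs_truncF_le N x).trans (hF x)

/-- The truncation is `ℤ^d`-symmetric (boxes are invariant under signed permutations). [folklore] -/
theorem isZdSymmetric_truncF (hFs : IsZdSymmetric F) (N : ℕ) : IsZdSymmetric (truncF F N) := by
  intro σ' ε x
  unfold truncF
  rw [if_congr (Literature.Probability.Percolation.signedPerm_mem_box_iff σ' ε) (hFs σ' ε x) rfl]

/-- `F_N` is (absolutely) summable. [folklore] -/
theorem summable_abs_truncF (N : ℕ) : Summable fun x => |truncF F N x| :=
  summable_of_ne_finset_zero (s := box d (2 ^ N)) fun x hx => by rw [truncF_of_not_mem hx, abs_zero]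

/-- `g F_N` is summable for every `g` (finite support). [folklore] -/
theorem summable_mul_truncF (g : Site d → ℝ) (N : ℕ) : Summable fun x => g x * truncF F N x :=
  summable_of_ne_finset_zero (s := box d (2 ^ N)) fun x hx => by rw [truncF_of_not_mem hx, mul_zero]

/-- `Σ F_N = Σ_{box} F`. [folklore] -/
theorem tsum_truncF (N : ℕ) : ∑' x, truncF F N x = ∑ x ∈ box d (2 ^ N), F x := by
  rw [tsum_eq_sum (s := box d (2 ^ N)) (fun x hx => truncF_of_not_mem hx)]
  exact Finset.sum_congr rfl fun x hx => truncF_of_mem hx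

/-- `Σ g F_N = Σ_{box} g F`. [folklore] -/
theorem tsum_mul_truncF (g : Site d → ℝ) (N : ℕ) : ∑' x, g x * truncF F N x = ∑ x ∈ box d (2 ^ N), g x * F x := by
  rw [tsum_eq_sum (s := box d (2 ^ N)) (fun x hx => by rw [truncF_of_not_mem hx, mul_zero])]
  exact Finset.sum_congr rfl fun x hx => by rw [truncF_of_mem hx]

/-- The coefficient families of the truncation are the truncated coefficient families. [folklore] -/
theorem coefW_truncF (N : ℕ) (w : List (Fin d)) (x : Site d) :
    coefW (truncF F N) w x = if x ∈ box d (2 ^ N) then coefW F w x else 0 := by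
  unfold coefW truncF; split_ifs <;> simp

/-- The dyadic boxes exhaust `ℤ^d`. [folklore] -/
theorem tendsto_box_pow_atTop : Tendsto (fun N : ℕ => box d (2 ^ N)) atTop atTop :=
  tendsto_box_atTop.comp (tendsto_pow_atTop_atTop_of_one_lt one_lt_two)

/-- Box sums of a summable family converge to its sum along the dyadic boxes. [folklore] -/
theorem tendsto_sum_box_pow {g : Site d → ℝ} (hg : Summable g) :
    Tendsto (fun N : ℕ => ∑ x ∈ box d (2 ^ N), g x) atTop (𝓝 (∑' x, g x)) :=
  hg.hasSum.comp tendsto_box_pow_atTop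

/-- The transform of a family supported in a finite set is the trigonometric polynomial over it. [folklore] -/
theorem dFT_eq_trigPoly_of_support {c : Site d → ℂ} {S : Finset (Site d)} (hc : ∀ x ∉ S, c x = 0) :
    dFT c = trigPoly S c := by
  funext t
  have hs : Summable fun x => ‖c x‖ := summable_of_ne_finset_zero (s := S) fun x hx => by rw [hc x hx, norm_zero]
  rw [dFT_eq_tsum hs, tsum_eq_sum (s := S) (fun x hx => by rw [hc x hx, mul_zero]), trigPoly_apply]
  simp [smul_eq_mul]

/-- The transforms of the truncation are the dyadic partial sums of the transforms of `F`. [folklore] -/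
theorem dFT_coefW_truncF (N : ℕ) (w : List (Fin d)) : dFT (coefW (truncF F N) w) = dyadicSum (coefW F w) N := by
  rw [dFT_eq_trigPoly_of_support (S := box d (2 ^ N)) (fun x hx => by rw [coefW_truncF, if_neg hx]), dyadicSum]
  exact trigPoly_congr fun x hx => by rw [coefW_truncF, if_pos hx]

/-- The tail `Σ_{x ∉ box 2^N} |F(x)|`. [folklore] -/
def tailF (F : Site d → ℝ) (N : ℕ) : ℝ := ∑' x : {x // x ∉ box d (2 ^ N)}, |F x|

/-- `tail_N ≥ 0`. [folklore] -/
theorem tailF_nonneg (N : ℕ) : 0 ≤ tailF F N := tsum_nonneg fun _ => abs_nonneg _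

/-- `tail_N = Σ_{x ∉ box 2^N} |F(x)| → 0` for summable `F`. [folklore] -/
theorem tendsto_tailF : Tendsto (tailF F) atTop (𝓝 0) :=
  (tendsto_tsum_compl_atTop_zero fun x => |F x|).comp tendsto_box_pow_atTop

/-- `|F̂_N(t) - F̂(t)| ≤ tail_N` (uniformly in `t`). [folklore] -/
theorem norm_dyadicSum_sub_latticeFourier_le (hF : Summable fun x => |F x|) (N : ℕ) (t : 𝕋 d) :
    ‖dyadicSum (coefW F []) N t - latticeFourier F t‖ ≤ tailF F N := by
  have hs : Summable fun x => ‖coefW F [] x‖ := by simpa [coefW_nil] using hF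
  rw [← dFT_coefW_nil hF, norm_sub_rev]
  refine (norm_dFT_sub_dyadicSum_le hs t N).trans (le_of_eq (tsum_congr fun x => ?_))
  simp [coefW_nil]

/-- The constants of the truncations converge: `Σ F_N → Σ F`, `F''_N → F''`. [folklore] -/
theorem tendsto_tsum_truncF (hF : Summable fun x => |F x|) :
    Tendsto (fun N => ∑' x, truncF F N x) atTop (𝓝 (∑' x, F x)) := by
  simp_rw [tsum_truncF]
  exact tendsto_sum_box_pow hF.of_abs

/-- `F_N'' → F''` (dominated convergence of `Σ|x|²F_N`). [folklore] -/
theorem tendsto_ls24Fpp_truncF (h2 : Summable fun x => euclidNorm x ^ 2 * |F x|) :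
    Tendsto (fun N => ls24Fpp (truncF F N)) atTop (𝓝 (ls24Fpp F)) := by
  have hs : Summable fun x => euclidNorm x ^ 2 * F x :=
    Summable.of_norm_bounded h2 fun x => by rw [Real.norm_eq_abs, abs_mul, abs_of_nonneg (sq_nonneg _)]
  simp_rw [ls24Fpp, tsum_mul_truncF]
  exact (tendsto_sum_box_pow hs).neg

/-- `λ_N → λ` for the constant `λ = 1/(Σ F + F'')` of (1.12). [cite: LiuSlade2024, (1.12)] -/
theorem tendsto_ls24Lambda_truncF (hF : Summable fun x => |F x|) (h2 : Summable fun x => euclidNorm x ^ 2 * |F x|)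
    (hne : (∑' x, F x) + ls24Fpp F ≠ 0) :
    Tendsto (fun N => ls24Lambda (truncF F N)) atTop (𝓝 (ls24Lambda F)) := by
  simp_rw [ls24Lambda]
  exact ((tendsto_tsum_truncF hF).add (tendsto_ls24Fpp_truncF h2)).inv₀ hne

/-- `μ_N → μ` for the constant `μ = 1 - λ Σ F` of (1.12). [cite: LiuSlade2024, (1.12)] -/
theorem tendsto_ls24Mu_truncF (hF : Summable fun x => |F x|) (h2 : Summable fun x => euclidNorm x ^ 2 * |F x|)
    (hne : (∑' x, F x) + ls24Fpp F ≠ 0) :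
    Tendsto (fun N => ls24Mu (truncF F N)) atTop (𝓝 (ls24Mu F)) := by
  simp_rw [ls24Mu]
  exact tendsto_const_nhds.sub ((tendsto_ls24Lambda_truncF hF h2 hne).mul (tendsto_tsum_truncF hF))

/-- Second moments of the truncation are dominated by those of `F`. [folklore] -/
theorem tsum_sq_mul_abs_truncF_le (h2 : Summable fun x => euclidNorm x ^ 2 * |F x|) (N : ℕ) :
    ∑' x, euclidNorm x ^ 2 * |truncF F N x| ≤ ∑' x, euclidNorm x ^ 2 * |F x| :=
  Summable.tsum_le_tsum (fun x => mul_le_mul_of_nonneg_left (abs_truncF_le N x) (sq_nonneg _))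
    (summable_of_ne_finset_zero (s := box d (2 ^ N)) fun x hx => by rw [truncF_of_not_mem hx, abs_zero, mul_zero]) h2

end LevelN

/-! ### The factor families: limit objects and their level-`N` smooth approximants

Limit atoms: `Â_w = 𝓕[(2πix)^w A_μ]` (exact trigonometric polynomials), `F̂_w` (the `L^q` limits
`dFT (coefW F w)`), `Ê_w = Â_w - λF̂_w`; factors `P_w = Â_w/Â`, `R_w = F̂_w/F̂`,
`Q_w = Ê_w/(ÂF̂)`. Level `N`: the same objects built from the truncation `F_N` (constants
`λ_N, μ_N`, transforms = dyadic partial sums), with the denominators shifted by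
`ε_N = 2(tail_N + |μ_N - μ|) + 1/(N+1) > 0`, which keeps them nonvanishing and dominated by the
limit denominators. -/

section Families

variable {K₁ K₂ ρ : ℝ}

/-- `Â_w` for `A = A_μ`, `μ = ls24Mu F`. [cite: LiuSlade2024, §2.2.1 (Â_δ)] -/
def AhatL (F : Site d → ℝ) (w : List (Fin d)) : (𝕋 d) → ℂ := dFT (coefW (lsA d (ls24Mu F)) w)

/-- `F̂_w = 𝓕[(2πix)^w F]` (an `L^q` limit). [cite: LiuSlade2024, §2.2.1 (F̂_γ) and Lemma A.4] -/
def FhatL (F : Site d → ℝ) (w : List (Fin d)) : (𝕋 d) → ℂ := dFT (coefW F w)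

/-- `Ê_w = Â_w - λ F̂_w`. [cite: LiuSlade2024, §2.2.1 (Ê_{α₂}, E = A - λF)] -/
def EhatL (F : Site d → ℝ) (w : List (Fin d)) (t : 𝕋 d) : ℂ := AhatL F w t - (ls24Lambda F : ℂ) * FhatL F w t

/-- The factor `Â_δ/Â`. [cite: LiuSlade2024, §2.2.1 (display (2.9))] -/
def facPL (F : Site d → ℝ) (w : List (Fin d)) (t : 𝕋 d) : ℂ := AhatL F w t * (AhatL F [] t)⁻¹

/-- The factor `F̂_γ/F̂`. [cite: LiuSlade2024, §2.2.1 (display (2.9))] -/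
def facRL (F : Site d → ℝ) (w : List (Fin d)) (t : 𝕋 d) : ℂ := FhatL F w t * (FhatL F [] t)⁻¹

/-- The factor `Ê_β/(ÂF̂)`. [cite: LiuSlade2024, §2.2.1 (display (2.9))] -/
def facQL (F : Site d → ℝ) (w : List (Fin d)) (t : 𝕋 d) : ℂ :=
  EhatL F w t * ((AhatL F [] t)⁻¹ * (FhatL F [] t)⁻¹)

/-- The regularisation `ε_N = 2(tail_N + |μ_N - μ|) + 1/(N+1)`. [folklore] -/
def epsN (F : Site d → ℝ) (N : ℕ) : ℝ := 2 * (tailF F N + |ls24Mu (truncF F N) - ls24Mu F|) + 1 / ((N : ℝ) + 1)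

/-- Level-`N` `Â_w` (constant `μ_N = ls24Mu F_N`). [folklore] -/
def AhatN (F : Site d → ℝ) (N : ℕ) (w : List (Fin d)) : (𝕋 d) → ℂ := dFT (coefW (lsA d (ls24Mu (truncF F N))) w)

/-- Level-`N` `F̂_w`: the dyadic partial sum. [folklore] -/
def FhatN (F : Site d → ℝ) (N : ℕ) (w : List (Fin d)) : (𝕋 d) → ℂ := dyadicSum (coefW F w) N

/-- Level-`N` `Ê_w = Â_{N,w} - λ_N F̂_{N,w}`. [folklore] -/
def EhatN (F : Site d → ℝ) (N : ℕ) (w : List (Fin d)) (t : 𝕋 d) : ℂ :=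
  AhatN F N w t - (ls24Lambda (truncF F N) : ℂ) * FhatN F N w t

/-- The regularised denominator `1/(Â_N + ε_N)`. [folklore] -/
def gA (F : Site d → ℝ) (N : ℕ) (t : 𝕋 d) : ℂ := (AhatN F N [] t + (epsN F N : ℂ))⁻¹

/-- The regularised denominator `1/(F̂_N + ε_N)`. [folklore] -/
def gF (F : Site d → ℝ) (N : ℕ) (t : 𝕋 d) : ℂ := (FhatN F N [] t + (epsN F N : ℂ))⁻¹

/-- Level-`N` factor `Â_δ/Â`. [folklore] -/
def facPN (F : Site d → ℝ) (N : ℕ) (w : List (Fin d)) (t : 𝕋 d) : ℂ := AhatN F N w t * gA F N t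

/-- Level-`N` factor `F̂_γ/F̂`. [folklore] -/
def facRN (F : Site d → ℝ) (N : ℕ) (w : List (Fin d)) (t : 𝕋 d) : ℂ := FhatN F N w t * gF F N t

/-- Level-`N` factor `Ê_β/(ÂF̂)`. [folklore] -/
def facQN (F : Site d → ℝ) (N : ℕ) (w : List (Fin d)) (t : 𝕋 d) : ℂ := EhatN F N w t * (gA F N t * gF F N t)

variable {F : Site d → ℝ}

/-! #### `Â_w` as an exact trigonometric polynomial, linear in `μ` -/

/-- `A_μ` lives in the box `{‖x‖∞ ≤ 1}`. [folklore] -/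
theorem lsA_eq_zero_of_not_mem_box (μ : ℝ) {x : Site d} (hx : x ∉ box d 1) : lsA d μ x = 0 := by
  have hx0 : x ≠ 0 := fun h => hx (h ▸ zero_mem_box d 1)
  have hnb : x ∉ (zdGraph d).neighborFinset 0 := by
    intro hmem
    apply hx
    obtain ⟨i, h | h⟩ := (zdGraph_adj_iff 0 x).1 ((SimpleGraph.mem_neighborFinset _ _ _).1 hmem)
    · rw [zero_add] at h; subst h
      rw [mem_box_iff_abs]; intro k
      by_cases hk : k = i
      · subst hk; simp
      · simp [Pi.single_eq_of_ne hk]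
    · have hx' : x = -Pi.single i 1 := eq_neg_of_add_eq_zero_left h.symm
      subst hx'
      rw [mem_box_iff_abs]; intro k
      by_cases hk : k = i
      · subst hk; simp
      · simp [Pi.single_eq_of_ne hk]
  rw [lsA, delta0_of_ne_zero hx0, srwStep_of_not_mem hnb]; ring

/-- The coefficient families of `A_μ` vanish off the unit box. [folklore] -/
theorem coefW_lsA_eq_zero (μ : ℝ) (w : List (Fin d)) {x : Site d} (hx : x ∉ box d 1) : coefW (lsA d μ) w x = 0 := by
  rw [coefW, lsA_eq_zero_of_not_mem_box μ hx]; simp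

/-- `Â_{μ,w}` is the trigonometric polynomial over the unit box. [folklore] -/
theorem dFT_coefW_lsA_eq_trigPoly (μ : ℝ) (w : List (Fin d)) :
    dFT (coefW (lsA d μ) w) = trigPoly (box d 1) (coefW (lsA d μ) w) :=
  dFT_eq_trigPoly_of_support fun _ hx => coefW_lsA_eq_zero μ w hx

/-- Linearity in `μ`: `Â_{μ,w} = δ̂₀_w - μ D̂_w`. [cite: LiuSlade2024, §2.1 (Â = 1 - μD̂)] -/
theorem dFT_coefW_lsA_apply (μ : ℝ) (w : List (Fin d)) (t : 𝕋 d) :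
    dFT (coefW (lsA d μ) w) t =
      trigPoly (box d 1) (coefW delta0 w) t - (μ : ℂ) * trigPoly (box d 1) (coefW (srwStep d) w) t := by
  rw [dFT_coefW_lsA_eq_trigPoly, trigPoly_apply, trigPoly_apply, trigPoly_apply, Finset.mul_sum, ← Finset.sum_sub_distrib]
  refine Finset.sum_congr rfl fun x _ => ?_
  simp only [smul_eq_mul, coefW, lsA]
  push_cast
  ring

/-- `Â_w = (δ)^_w - μ (D_nn)^_w` as trigonometric polynomials on the unit box. [cite: LiuSlade2024, §2.2.2 ("`Â = 1 - μD̂`, so `Â` is infinitely classically differentiable")] -/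
theorem AhatL_apply (F : Site d → ℝ) (w : List (Fin d)) (t : 𝕋 d) :
    AhatL F w t = trigPoly (box d 1) (coefW delta0 w) t - (ls24Mu F : ℂ) * trigPoly (box d 1) (coefW (srwStep d) w) t :=
  dFT_coefW_lsA_apply _ w t

/-- Level `N`: `Â_{N,w} = (δ)^_w - μ_N (D_nn)^_w`. [cite: LiuSlade2024, §2.2.2 ("`Â = 1 - μD̂`")] -/
theorem AhatN_apply (F : Site d → ℝ) (N : ℕ) (w : List (Fin d)) (t : 𝕋 d) :
    AhatN F N w t = trigPoly (box d 1) (coefW delta0 w) t -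
      (ls24Mu (truncF F N) : ℂ) * trigPoly (box d 1) (coefW (srwStep d) w) t :=
  dFT_coefW_lsA_apply _ w t

/-- `Â_{[]} = Â_μ = (A_μ)^`. [cite: LiuSlade2024, (1.26)] -/
theorem AhatL_nil (F : Site d → ℝ) : AhatL F [] = latticeFourier (lsA d (ls24Mu F)) := by
  funext t
  exact dFT_coefW_nil (summable_abs_of_decay (abs_lsA_le _ ((d : ℝ) + 1)) (by linarith)) t

/-- Level `N`: `Â_{N,[]} = (A_{μ_N})^`. [cite: LiuSlade2024, (1.26)] -/
theorem AhatN_nil (F : Site d → ℝ) (N : ℕ) : AhatN F N [] = latticeFourier (lsA d (ls24Mu (truncF F N))) := by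
  funext t
  exact dFT_coefW_nil (summable_abs_of_decay (abs_lsA_le _ ((d : ℝ) + 1)) (by linarith)) t

/-- `F̂_{[]} = F̂` (the dyadic limit of a summable series is its sum). [folklore] -/
theorem FhatL_nil (hF : Summable fun x => |F x|) : FhatL F [] = latticeFourier F := by
  funext t; exact dFT_coefW_nil hF t

/-! #### Smoothness and the classical derivative rules at level `N` -/

/-- `Â_{N,w}` is smooth (a trigonometric polynomial). [folklore] -/
theorem isSmooth_AhatN (F : Site d → ℝ) (N : ℕ) (w : List (Fin d)) : Torus.IsSmooth (AhatN F N w) := by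
  rw [AhatN, dFT_coefW_lsA_eq_trigPoly]; exact isSmooth_trigPoly _ _

/-- `Â_w` is smooth (a trigonometric polynomial). [cite: LiuSlade2024, §2.2.2 ("`Â` is infinitely classically differentiable")] -/
theorem isSmooth_AhatL (F : Site d → ℝ) (w : List (Fin d)) : Torus.IsSmooth (AhatL F w) := by
  rw [AhatL, dFT_coefW_lsA_eq_trigPoly]; exact isSmooth_trigPoly _ _

/-- `F̂_{N,w}` is smooth (a trigonometric polynomial). [folklore] -/
theorem isSmooth_FhatN (F : Site d → ℝ) (N : ℕ) (w : List (Fin d)) : Torus.IsSmooth (FhatN F N w) :=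
  isSmooth_trigPoly _ _

/-- `∂ⱼ Â_{N,w} = Â_{N, j :: w}`. [cite: LiuSlade2024, Appendix A, Lemma A.4 (i)] -/
theorem partialDeriv_AhatN (F : Site d → ℝ) (N : ℕ) (w : List (Fin d)) (j : Fin d) (t : 𝕋 d) :
    Torus.partialDeriv j (AhatN F N w) t = AhatN F N (j :: w) t := by
  rw [AhatN, AhatN, dFT_coefW_lsA_eq_trigPoly, dFT_coefW_lsA_eq_trigPoly, partialDeriv_trigPoly, coefW_cons]
  rfl

/-- `∂ⱼ F̂_{N,w} = F̂_{N, j :: w}`. [cite: LiuSlade2024, Appendix A, Lemma A.4 (i)] -/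
theorem partialDeriv_FhatN (F : Site d → ℝ) (N : ℕ) (w : List (Fin d)) (j : Fin d) (t : 𝕋 d) :
    Torus.partialDeriv j (FhatN F N w) t = FhatN F N (j :: w) t := by
  rw [FhatN, FhatN, partialDeriv_dyadicSum, coefW_cons]

/-- `Ê_{N,w} = Â_{N,w} - λ_N F̂_{N,w}` is smooth. [folklore] -/
theorem isSmooth_EhatN (F : Site d → ℝ) (N : ℕ) (w : List (Fin d)) : Torus.IsSmooth (EhatN F N w) :=
  (isSmooth_AhatN F N w).sub (isSmooth_mul (isSmooth_const _) (isSmooth_FhatN F N w))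

/-- `∂ⱼ Ê_{N,w} = Ê_{N, j :: w}`. [cite: LiuSlade2024, Appendix A, Lemma A.4 (i)] -/
theorem partialDeriv_EhatN (F : Site d → ℝ) (N : ℕ) (w : List (Fin d)) (j : Fin d) (t : 𝕋 d) :
    Torus.partialDeriv j (EhatN F N w) t = EhatN F N (j :: w) t := by
  have e : EhatN F N w = fun s => AhatN F N w s + (-(ls24Lambda (truncF F N) : ℂ)) * FhatN F N w s := by
    funext s; rw [EhatN]; ring
  rw [e, partialDeriv_add' (isSmooth_AhatN F N w) (isSmooth_mul (isSmooth_const _) (isSmooth_FhatN F N w)),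
    partialDeriv_const_mul (isSmooth_FhatN F N w), partialDeriv_AhatN, partialDeriv_FhatN, EhatN]
  ring

/-- Real parts of the level-`N` denominators are positive: `Re(Â_N + ε_N) > 0`, given
`Re Â_μ ≥ 0` (i.e. `0 ≤ μ ≤ 1`). [folklore] -/
theorem re_AhatN_add_epsN_pos (hd : 1 ≤ d) (N : ℕ) (t : 𝕋 d) :
    (latticeFourier (lsA d (ls24Mu F)) t).re + |ls24Mu (truncF F N) - ls24Mu F| + 1 / ((N : ℝ) + 1) ≤
      (AhatN F N [] t + (epsN F N : ℂ)).re := by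
  rw [AhatN_nil, Complex.add_re, Complex.ofReal_re, epsN, latticeFourier_lsA, latticeFourier_lsA]
  simp only [Complex.sub_re, Complex.one_re, Complex.re_ofReal_mul]
  have hD : |(latticeFourier (srwStep d) t).re| ≤ 1 := by
    refine (Complex.abs_re_le_norm _).trans ((norm_latticeFourier_le summable_abs_srwStep t).trans ?_)
    rw [tsum_congr fun x => abs_of_nonneg (srwStep_nonneg d x), tsum_srwStep hd]
  have htail := tailF_nonneg (F := F) N
  have h1 : |(ls24Mu (truncF F N) - ls24Mu F) * (latticeFourier (srwStep d) t).re| ≤ |ls24Mu (truncF F N) - ls24Mu F| := by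
    rw [abs_mul]; exact mul_le_of_le_one_right (abs_nonneg _) hD
  have h2 := le_abs_self ((ls24Mu (truncF F N) - ls24Mu F) * (latticeFourier (srwStep d) t).re)
  nlinarith [h1, h2, abs_nonneg (ls24Mu (truncF F N) - ls24Mu F)]

/-- The shifted level-`N` denominator dominates the limit one: `Re(F̂_N + ε_N) ≥ Re F̂ + tail_N + 2|μ_N - μ| + 1/(N+1)` (since `|F̂_N - F̂| ≤ tail_N`). [folklore] -/
theorem re_FhatN_add_epsN_ge (hF : Summable fun x => |F x|) (N : ℕ) (t : 𝕋 d) :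
    (latticeFourier F t).re + tailF F N + 2 * |ls24Mu (truncF F N) - ls24Mu F| + 1 / ((N : ℝ) + 1) ≤
      (FhatN F N [] t + (epsN F N : ℂ)).re := by
  rw [Complex.add_re, Complex.ofReal_re, epsN, FhatN]
  have h := norm_dyadicSum_sub_latticeFourier_le hF N t
  have h1 : |(dyadicSum (coefW F []) N t).re - (latticeFourier F t).re| ≤ tailF F N := by
    rw [← Complex.sub_re]; exact (Complex.abs_re_le_norm _).trans h
  have h2 := (abs_le.1 h1).1
  linarith

/-- The level-`N` denominators do not vanish (`K₂ ≥ 0` infrared bound and `0 ≤ μ ≤ 1`). [folklore] -/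
theorem AhatN_add_epsN_ne_zero (hd : 1 ≤ d) (hμ0 : 0 ≤ ls24Mu F) (hμ1 : ls24Mu F ≤ 1) (N : ℕ) (t : 𝕋 d) :
    AhatN F N [] t + (epsN F N : ℂ) ≠ 0 := by
  intro h0
  have h := re_AhatN_add_epsN_pos (F := F) hd N t
  rw [h0, Complex.zero_re] at h
  have hA : 0 ≤ (latticeFourier (lsA d (ls24Mu F)) t).re :=
    le_trans (by have := tnorm_nonneg t; positivity) (re_latticeFourier_lsA_ge hd hμ0 hμ1 t)
  have : (0 : ℝ) < 1 / ((N : ℝ) + 1) := by positivity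
  linarith [abs_nonneg (ls24Mu (truncF F N) - ls24Mu F)]

/-- `F̂_N + ε_N ≠ 0` under Assumption 1.1 (`Re F̂ ≥ 0` by (1.10) and `F̂(0) ≥ 0`). [cite: LiuSlade2024, (1.10)] -/
theorem FhatN_add_epsN_ne_zero (hF : LS24Assumption d K₁ K₂ ρ F) (hρ : 0 < ρ) (hK₂ : 0 ≤ K₂) (N : ℕ) (t : 𝕋 d) :
    FhatN F N [] t + (epsN F N : ℂ) ≠ 0 := by
  intro h0
  have h := re_FhatN_add_epsN_ge (LS24Assumption.summable_abs hF hρ) N t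
  rw [h0, Complex.zero_re] at h
  have hre : 0 ≤ (latticeFourier F t).re := le_trans (by have := tnorm_nonneg t; positivity) (re_latticeFourier_ge hF t)
  have : (0 : ℝ) < 1 / ((N : ℝ) + 1) := by positivity
  linarith [abs_nonneg (ls24Mu (truncF F N) - ls24Mu F), tailF_nonneg (F := F) N]

/-- `g_A = 1/(Â_N + ε_N)` is smooth. [folklore] -/
theorem isSmooth_gA (hd : 1 ≤ d) (hμ0 : 0 ≤ ls24Mu F) (hμ1 : ls24Mu F ≤ 1) (N : ℕ) : Torus.IsSmooth (gA F N) :=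
  isSmooth_inv ((isSmooth_AhatN F N []).add (isSmooth_const _)) (AhatN_add_epsN_ne_zero hd hμ0 hμ1 N)

/-- `g_F = 1/(F̂_N + ε_N)` is smooth. [folklore] -/
theorem isSmooth_gF (hF : LS24Assumption d K₁ K₂ ρ F) (hρ : 0 < ρ) (hK₂ : 0 ≤ K₂) (N : ℕ) : Torus.IsSmooth (gF F N) :=
  isSmooth_inv ((isSmooth_FhatN F N []).add (isSmooth_const _)) (FhatN_add_epsN_ne_zero hF hρ hK₂ N)

/-- `∂ⱼ g_A = -Â_{N,j} g_A²` (classical quotient rule). [cite: LiuSlade2024, Appendix A, Lemma A.3 (the formula `-u_i/u²`, here classically)] -/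
theorem partialDeriv_gA (hd : 1 ≤ d) (hμ0 : 0 ≤ ls24Mu F) (hμ1 : ls24Mu F ≤ 1) (N : ℕ) (j : Fin d) (t : 𝕋 d) :
    Torus.partialDeriv j (gA F N) t = -(AhatN F N [j] t) * (gA F N t) ^ 2 := by
  have hs : Torus.IsSmooth (fun s => AhatN F N [] s + (epsN F N : ℂ)) := (isSmooth_AhatN F N []).add (isSmooth_const _)
  have hne := AhatN_add_epsN_ne_zero hd hμ0 hμ1 N
  rw [show gA F N = fun s => (AhatN F N [] s + (epsN F N : ℂ))⁻¹ from rfl, partialDeriv_inv hs hne,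
    partialDeriv_add' (isSmooth_AhatN F N []) (isSmooth_const _), partialDeriv_AhatN]
  have h0 : Torus.partialDeriv j (fun _ : 𝕋 d => (epsN F N : ℂ)) t = 0 := deriv_const (0 : ℝ) _
  rw [h0, add_zero]
  field_simp

/-- `∂ⱼ g_F = -F̂_{N,j} g_F²` (classical quotient rule). [cite: LiuSlade2024, Appendix A, Lemma A.3 (the formula `-u_i/u²`, here classically)] -/
theorem partialDeriv_gF (hF : LS24Assumption d K₁ K₂ ρ F) (hρ : 0 < ρ) (hK₂ : 0 ≤ K₂) (N : ℕ) (j : Fin d) (t : 𝕋 d) :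
    Torus.partialDeriv j (gF F N) t = -(FhatN F N [j] t) * (gF F N t) ^ 2 := by
  have hs : Torus.IsSmooth (fun s => FhatN F N [] s + (epsN F N : ℂ)) := (isSmooth_FhatN F N []).add (isSmooth_const _)
  have hne := FhatN_add_epsN_ne_zero hF hρ hK₂ N
  rw [show gF F N = fun s => (FhatN F N [] s + (epsN F N : ℂ))⁻¹ from rfl, partialDeriv_inv hs hne,
    partialDeriv_add' (isSmooth_FhatN F N []) (isSmooth_const _), partialDeriv_FhatN]
  have h0 : Torus.partialDeriv j (fun _ : 𝕋 d => (epsN F N : ℂ)) t = 0 := deriv_const (0 : ℝ) _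
  rw [h0, add_zero]
  field_simp

/-- **The derivative rules of the three level-`N` factor families** (product and quotient rules).
[cite: LiuSlade2024, §2.2.1 (derivation of display (2.9))] -/
theorem factor_rules (hd : 1 ≤ d) (hF : LS24Assumption d K₁ K₂ ρ F) (hρ : 0 < ρ) (hK₂ : 0 ≤ K₂)
    (hμ0 : 0 ≤ ls24Mu F) (hμ1 : ls24Mu F ≤ 1) (N : ℕ) (j : Fin d) :
    (∀ w, Torus.IsSmooth (facPN F N w)) ∧ (∀ w, Torus.IsSmooth (facQN F N w)) ∧ (∀ w, Torus.IsSmooth (facRN F N w)) ∧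
    (∀ w t, Torus.partialDeriv j (facPN F N w) t = facPN F N (j :: w) t - facPN F N [j] t * facPN F N w t) ∧
    (∀ w t, Torus.partialDeriv j (facQN F N w) t =
      facQN F N (j :: w) t - facPN F N [j] t * facQN F N w t - facRN F N [j] t * facQN F N w t) ∧
    (∀ w t, Torus.partialDeriv j (facRN F N w) t = facRN F N (j :: w) t - facRN F N [j] t * facRN F N w t) := by
  have hgA := isSmooth_gA hd hμ0 hμ1 N (F := F)
  have hgF := isSmooth_gF hF hρ hK₂ N
  have hP : ∀ w, Torus.IsSmooth (facPN F N w) := fun w => isSmooth_mul (isSmooth_AhatN F N w) hgA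
  have hR : ∀ w, Torus.IsSmooth (facRN F N w) := fun w => isSmooth_mul (isSmooth_FhatN F N w) hgF
  have hQ : ∀ w, Torus.IsSmooth (facQN F N w) := fun w => isSmooth_mul (isSmooth_EhatN F N w) (isSmooth_mul hgA hgF)
  refine ⟨hP, hQ, hR, fun w t => ?_, fun w t => ?_, fun w t => ?_⟩
  · rw [show facPN F N w = fun s => AhatN F N w s * gA F N s from rfl, partialDeriv_mul (isSmooth_AhatN F N w) hgA,
      partialDeriv_AhatN, partialDeriv_gA hd hμ0 hμ1]
    simp only [facPN]; ring
  · rw [show facQN F N w = fun s => EhatN F N w s * (gA F N s * gF F N s) from rfl,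
      partialDeriv_mul (isSmooth_EhatN F N w) (isSmooth_mul hgA hgF), partialDeriv_mul hgA hgF,
      partialDeriv_EhatN, partialDeriv_gA hd hμ0 hμ1, partialDeriv_gF hF hρ hK₂]
    simp only [facQN, facPN, facRN]; ring
  · rw [show facRN F N w = fun s => FhatN F N w s * gF F N s from rfl, partialDeriv_mul (isSmooth_FhatN F N w) hgF,
      partialDeriv_FhatN, partialDeriv_gF hF hρ hK₂]
    simp only [facRN]; ring

end Families

/-! ### The factor families: bounds and convergence -/

section FamiliesLimits

variable {K₁ K₂ ρ : ℝ} {F : Site d → ℝ}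

/-- `|1/z| ≤ 1/Re z` for `Re z > 0`. [folklore] -/
theorem norm_inv_le_of_re_pos {z : ℂ} (hz : 0 < z.re) : ‖z⁻¹‖ ≤ 1 / z.re := by
  rw [norm_inv, one_div]
  exact inv_anti₀ hz (Complex.re_le_norm z)

/-- `ϱ^{-2} = (ϱ²)⁻¹` for `ϱ > 0`. [folklore] -/
theorem tnorm_rpow_neg_two {t : 𝕋 d} (ht : 0 < tnorm t) : tnorm t ^ (-(2 : ℝ)) = (tnorm t ^ 2)⁻¹ := by
  rw [Real.rpow_neg ht.le, Real.rpow_two]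

/-- `|1/Â(t)| ≤ (d/8μ) ϱ(t)^{-2}`. [cite: LiuSlade2024, §2.2.2 (infrared bound (1.11) for Â)] -/
theorem norm_inv_AhatL_le (hd : 1 ≤ d) (hμ0 : 0 < ls24Mu F) (hμ1 : ls24Mu F ≤ 1) {t : 𝕋 d} (ht : 0 < tnorm t) :
    ‖(AhatL F [] t)⁻¹‖ ≤ d / (8 * ls24Mu F) * tnorm t ^ (-(2 : ℝ)) := by
  have hd0 : (0 : ℝ) < d := by exact_mod_cast hd
  have hre := re_latticeFourier_lsA_ge hd hμ0.le hμ1 t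
  have hpos : 0 < 8 * ls24Mu F / d * tnorm t ^ 2 := by positivity
  rw [AhatL_nil, tnorm_rpow_neg_two ht]
  refine (norm_inv_le_of_re_pos (hpos.trans_le hre)).trans ?_
  rw [div_le_iff₀ (hpos.trans_le hre)]
  calc (1 : ℝ) = d / (8 * ls24Mu F) * (tnorm t ^ 2)⁻¹ * (8 * ls24Mu F / d * tnorm t ^ 2) := by field_simp
    _ ≤ d / (8 * ls24Mu F) * (tnorm t ^ 2)⁻¹ * (latticeFourier (lsA d (ls24Mu F)) t).re := by gcongr

/-- `|1/F̂(t)| ≤ K₂⁻¹ ϱ(t)^{-2}`. [cite: LiuSlade2024, §2.2.2 (infrared bound for F̂)] -/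
theorem norm_inv_FhatL_le (hF : LS24Assumption d K₁ K₂ ρ F) (hρ : 0 < ρ) (hK₂ : 0 < K₂) {t : 𝕋 d} (ht : 0 < tnorm t) :
    ‖(FhatL F [] t)⁻¹‖ ≤ 1 / K₂ * tnorm t ^ (-(2 : ℝ)) := by
  have hre := re_latticeFourier_ge hF t
  have hpos : 0 < K₂ * tnorm t ^ 2 := by positivity
  rw [FhatL_nil (LS24Assumption.summable_abs hF hρ), tnorm_rpow_neg_two ht]
  refine (norm_inv_le_of_re_pos (hpos.trans_le hre)).trans ?_
  rw [div_le_iff₀ (hpos.trans_le hre)]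
  calc (1 : ℝ) = 1 / K₂ * (tnorm t ^ 2)⁻¹ * (K₂ * tnorm t ^ 2) := by field_simp
    _ ≤ 1 / K₂ * (tnorm t ^ 2)⁻¹ * (latticeFourier F t).re := by gcongr

/-- `|g_A^N(t)| ≤ (d/8μ) ϱ(t)^{-2}` for all `N` (the regularised denominator is dominated by the limit
one). [folklore] -/
theorem norm_gA_le (hd : 1 ≤ d) (hμ0 : 0 < ls24Mu F) (hμ1 : ls24Mu F ≤ 1) (N : ℕ) {t : 𝕋 d} (ht : 0 < tnorm t) :
    ‖gA F N t‖ ≤ d / (8 * ls24Mu F) * tnorm t ^ (-(2 : ℝ)) := by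
  have hd0 : (0 : ℝ) < d := by exact_mod_cast hd
  have hre := re_latticeFourier_lsA_ge hd hμ0.le hμ1 t
  have hpos : 0 < 8 * ls24Mu F / d * tnorm t ^ 2 := by positivity
  have h1 := re_AhatN_add_epsN_pos (F := F) hd N t
  have hlow : 8 * ls24Mu F / d * tnorm t ^ 2 ≤ (AhatN F N [] t + (epsN F N : ℂ)).re := by
    have : (0 : ℝ) ≤ 1 / ((N : ℝ) + 1) := by positivity
    linarith [abs_nonneg (ls24Mu (truncF F N) - ls24Mu F)]
  rw [gA, tnorm_rpow_neg_two ht]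
  refine (norm_inv_le_of_re_pos (hpos.trans_le hlow)).trans ?_
  rw [div_le_iff₀ (hpos.trans_le hlow)]
  calc (1 : ℝ) = d / (8 * ls24Mu F) * (tnorm t ^ 2)⁻¹ * (8 * ls24Mu F / d * tnorm t ^ 2) := by field_simp
    _ ≤ d / (8 * ls24Mu F) * (tnorm t ^ 2)⁻¹ * (AhatN F N [] t + (epsN F N : ℂ)).re := by gcongr

/-- `|g_F^N(t)| ≤ K₂⁻¹ ϱ(t)^{-2}` for all `N`. [folklore] -/
theorem norm_gF_le (hF : LS24Assumption d K₁ K₂ ρ F) (hρ : 0 < ρ) (hK₂ : 0 < K₂) (N : ℕ) {t : 𝕋 d} (ht : 0 < tnorm t) :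
    ‖gF F N t‖ ≤ 1 / K₂ * tnorm t ^ (-(2 : ℝ)) := by
  have hre := re_latticeFourier_ge hF t
  have hpos : 0 < K₂ * tnorm t ^ 2 := by positivity
  have h1 := re_FhatN_add_epsN_ge (LS24Assumption.summable_abs hF hρ) N t
  have hlow : K₂ * tnorm t ^ 2 ≤ (FhatN F N [] t + (epsN F N : ℂ)).re := by
    have : (0 : ℝ) ≤ 1 / ((N : ℝ) + 1) := by positivity
    linarith [abs_nonneg (ls24Mu (truncF F N) - ls24Mu F), tailF_nonneg (F := F) N]
  rw [gF, tnorm_rpow_neg_two ht]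
  refine (norm_inv_le_of_re_pos (hpos.trans_le hlow)).trans ?_
  rw [div_le_iff₀ (hpos.trans_le hlow)]
  calc (1 : ℝ) = 1 / K₂ * (tnorm t ^ 2)⁻¹ * (K₂ * tnorm t ^ 2) := by field_simp
    _ ≤ 1 / K₂ * (tnorm t ^ 2)⁻¹ * (FhatN F N [] t + (epsN F N : ℂ)).re := by gcongr

/-! #### Convergence of the level-`N` objects -/

/-- `ε_N → 0`. [folklore] -/
theorem tendsto_epsN (hF : Summable fun x => |F x|) (h2 : Summable fun x => euclidNorm x ^ 2 * |F x|)
    (hne : (∑' x, F x) + ls24Fpp F ≠ 0) : Tendsto (epsN F) atTop (𝓝 0) := by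
  have h1 : Tendsto (fun N => |ls24Mu (truncF F N) - ls24Mu F|) atTop (𝓝 0) := by
    have h := (tendsto_ls24Mu_truncF hF h2 hne).sub_const (ls24Mu F)
    rw [sub_self] at h
    simpa using h.abs
  have h3 : Tendsto (fun N : ℕ => 1 / ((N : ℝ) + 1)) atTop (𝓝 0) := tendsto_one_div_add_atTop_nhds_zero_nat
  have h := ((tendsto_tailF (F := F)).add h1).const_mul 2 |>.add h3
  simp only [add_zero, mul_zero] at h
  exact h

/-- `Â_{N,w} → Â_w` pointwise (`μ_N → μ`). [folklore] -/
theorem tendsto_AhatN (hF : Summable fun x => |F x|) (h2 : Summable fun x => euclidNorm x ^ 2 * |F x|)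
    (hne : (∑' x, F x) + ls24Fpp F ≠ 0) (w : List (Fin d)) (t : 𝕋 d) :
    Tendsto (fun N => AhatN F N w t) atTop (𝓝 (AhatL F w t)) := by
  simp_rw [AhatN_apply, AhatL_apply]
  refine tendsto_const_nhds.sub (Tendsto.mul_const _ ?_)
  exact (Complex.continuous_ofReal.tendsto _).comp (tendsto_ls24Mu_truncF hF h2 hne)

/-- `F̂_N → F̂` pointwise for summable `F`. [folklore] -/
theorem tendsto_FhatN_nil (hF : Summable fun x => |F x|) (t : 𝕋 d) :
    Tendsto (fun N => FhatN F N [] t) atTop (𝓝 (FhatL F [] t)) := by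
  rw [FhatL_nil hF]
  refine tendsto_iff_norm_sub_tendsto_zero.2 (squeeze_zero (fun N => norm_nonneg _)
    (fun N => norm_dyadicSum_sub_latticeFourier_le hF N t) tendsto_tailF)

/-- `F̂_{N,w} → F̂_w` a.e. for `|w| < d/2 + 2 + ρ` (the dyadic `L²`-type limit). [cite: LiuSlade2024, Appendix A, Lemma A.4 (ii)] -/
theorem ae_tendsto_FhatN {K : ℝ} (hdec : ∀ x, |F x| ≤ K / jnorm x ^ ((d : ℝ) + 2 + ρ)) {w : List (Fin d)}
    (hw : (w.length : ℝ) < (d : ℝ) / 2 + 2 + ρ) :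
    ∀ᵐ t ∂volume, Tendsto (fun N => FhatN F N w t) atTop (𝓝 (FhatL F w t)) :=
  ae_tendsto_dyadicSum (norm_coefW_le hdec w) (by linarith)

/-- `g_A → 1/Â` off `t = 0`. [folklore] -/
theorem tendsto_gA (hd : 1 ≤ d) (hF : Summable fun x => |F x|) (h2 : Summable fun x => euclidNorm x ^ 2 * |F x|)
    (hne : (∑' x, F x) + ls24Fpp F ≠ 0) (hμ0 : 0 < ls24Mu F) (hμ1 : ls24Mu F ≤ 1) {t : 𝕋 d} (ht : 0 < tnorm t) :
    Tendsto (fun N => gA F N t) atTop (𝓝 ((AhatL F [] t)⁻¹)) := by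
  have hne' : AhatL F [] t ≠ 0 := by
    intro h0
    have hd0 : (0 : ℝ) < d := by exact_mod_cast hd
    have hre := re_latticeFourier_lsA_ge hd hμ0.le hμ1 t
    rw [← AhatL_nil, h0, Complex.zero_re] at hre
    have : 0 < 8 * ls24Mu F / d * tnorm t ^ 2 := by positivity
    linarith
  have h := (tendsto_AhatN hF h2 hne [] t).add ((Complex.continuous_ofReal.tendsto _).comp (tendsto_epsN hF h2 hne))
  rw [Complex.ofReal_zero, add_zero] at h
  exact h.inv₀ hne'

/-- `g_F → 1/F̂` off `t = 0`. [folklore] -/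
theorem tendsto_gF (hF : LS24Assumption d K₁ K₂ ρ F) (hρ : 0 < ρ) (hK₂ : 0 < K₂)
    (hne : (∑' x, F x) + ls24Fpp F ≠ 0) {t : 𝕋 d} (ht : 0 < tnorm t) :
    Tendsto (fun N => gF F N t) atTop (𝓝 ((FhatL F [] t)⁻¹)) := by
  have hsum := LS24Assumption.summable_abs hF hρ
  have hne' : FhatL F [] t ≠ 0 := by
    intro h0
    have hre := re_latticeFourier_ge hF t
    rw [← FhatL_nil hsum, h0, Complex.zero_re] at hre
    have : 0 < K₂ * tnorm t ^ 2 := by positivity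
    linarith
  have h := (tendsto_FhatN_nil hsum t).add
    ((Complex.continuous_ofReal.tendsto _).comp (tendsto_epsN hsum (LS24Assumption.summable_sq_mul_abs hF hρ) hne))
  rw [Complex.ofReal_zero, add_zero] at h
  exact h.inv₀ hne'

/-- Almost everywhere convergence of the three level-`N` factor families to the limit factors. [folklore] -/
theorem ae_tendsto_factors (hd : 1 ≤ d) (hF : LS24Assumption d K₁ K₂ ρ F) (hρ : 0 < ρ) (hK₂ : 0 < K₂)
    (hne : (∑' x, F x) + ls24Fpp F ≠ 0) (hμ0 : 0 < ls24Mu F) (hμ1 : ls24Mu F ≤ 1) {w : List (Fin d)}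
    (hw : (w.length : ℝ) < (d : ℝ) / 2 + 2 + ρ) :
    (∀ᵐ t ∂volume, Tendsto (fun N => facPN F N w t) atTop (𝓝 (facPL F w t))) ∧
    (∀ᵐ t ∂volume, Tendsto (fun N => facQN F N w t) atTop (𝓝 (facQL F w t))) ∧
    (∀ᵐ t ∂volume, Tendsto (fun N => facRN F N w t) atTop (𝓝 (facRL F w t))) := by
  have hsum := LS24Assumption.summable_abs hF hρ
  have h2 := LS24Assumption.summable_sq_mul_abs hF hρ
  have hlam : Tendsto (fun N => (ls24Lambda (truncF F N) : ℂ)) atTop (𝓝 (ls24Lambda F : ℂ)) :=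
    (Complex.continuous_ofReal.tendsto _).comp (tendsto_ls24Lambda_truncF hsum h2 hne)
  refine ⟨?_, ?_, ?_⟩
  · filter_upwards [ae_tnorm_pos hd] with t ht
    exact (tendsto_AhatN hsum h2 hne w t).mul (tendsto_gA hd hsum h2 hne hμ0 hμ1 ht)
  · filter_upwards [ae_tnorm_pos hd, ae_tendsto_FhatN hF.2.1 hw] with t ht hFt
    have hE : Tendsto (fun N => EhatN F N w t) atTop (𝓝 (EhatL F w t)) :=
      (tendsto_AhatN hsum h2 hne w t).sub (hlam.mul hFt)
    exact hE.mul ((tendsto_gA hd hsum h2 hne hμ0 hμ1 ht).mul (tendsto_gF hF hρ hK₂ hne ht))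
  · filter_upwards [ae_tnorm_pos hd, ae_tendsto_FhatN hF.2.1 hw] with t ht hFt
    exact hFt.mul (tendsto_gF hF hρ hK₂ hne ht)

/-! #### Eventual bounds on the level-`N` constants -/

/-- For large `N`: `|μ_N| ≤ 2`, `|λ_N| ≤ λ + 1` and `Σ F_N + F_N'' ≠ 0`. [folklore] -/
theorem eventually_levelN (hd : 1 ≤ d) (hF : LS24Assumption d K₁ K₂ ρ F) (hρ : 0 < ρ) (hK₂ : 0 < K₂) :
    ∀ᶠ N in atTop, |ls24Mu (truncF F N)| ≤ 2 ∧ |ls24Lambda (truncF F N)| ≤ ls24Lambda F + 1 ∧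
      (∑' x, truncF F N x) + ls24Fpp (truncF F N) ≠ 0 := by
  have hsum := LS24Assumption.summable_abs hF hρ
  have h2 := LS24Assumption.summable_sq_mul_abs hF hρ
  obtain ⟨hl0, -, h1⟩ := ls24Lambda_pos_and_le hd hF hρ hK₂
  obtain ⟨hμ0, hμ1⟩ := ls24Mu_pos_le_one hd hF hρ hK₂
  have hne : (∑' x, F x) + ls24Fpp F ≠ 0 := by
    intro h0; rw [h0, mul_zero] at h1; exact zero_ne_one h1
  have hpos : 0 < (∑' x, F x) + ls24Fpp F := by
    rcases (lt_or_gt_of_ne hne) with h | h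
    · exfalso
      have : ls24Lambda F * ((∑' x, F x) + ls24Fpp F) < 0 := mul_neg_of_pos_of_neg hl0 h
      linarith
    · exact h
  have e1 : ∀ᶠ N in atTop, |ls24Mu (truncF F N)| ≤ 2 := by
    have h := tendsto_ls24Mu_truncF hsum h2 hne
    have hlt : ls24Mu F < 2 := by linarith
    have hgt : -2 < ls24Mu F := by linarith
    filter_upwards [h.eventually (Ioo_mem_nhds hgt hlt)] with N hN
    exact abs_le.2 ⟨hN.1.le, hN.2.le⟩
  have e2 : ∀ᶠ N in atTop, |ls24Lambda (truncF F N)| ≤ ls24Lambda F + 1 := by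
    have h := tendsto_ls24Lambda_truncF hsum h2 hne
    filter_upwards [h.eventually (Ioo_mem_nhds (by linarith : -(ls24Lambda F + 1) < ls24Lambda F)
      (by linarith : ls24Lambda F < ls24Lambda F + 1))] with N hN
    exact abs_le.2 ⟨hN.1.le, hN.2.le⟩
  have e3 : ∀ᶠ N in atTop, (∑' x, truncF F N x) + ls24Fpp (truncF F N) ≠ 0 := by
    have h := (tendsto_tsum_truncF hsum).add (tendsto_ls24Fpp_truncF h2)
    filter_upwards [h.eventually (Ioi_mem_nhds hpos)] with N hN
    exact ne_of_gt hN
  filter_upwards [e1, e2, e3] with N h1 h2 h3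
  exact ⟨h1, h2, h3⟩

end FamiliesLimits

/-! ### Pointwise bounds on the atoms -/

section FactorBounds

variable {K₁ K₂ ρ : ℝ} {F : Site d → ℝ}

/-- `Σ_x |x|²|A_μ(x)| = |μ|` (`d ≥ 1`). [folklore] -/
theorem tsum_sq_mul_abs_lsA (hd : 1 ≤ d) (μ : ℝ) : ∑' x, euclidNorm x ^ 2 * |lsA d μ x| = |μ| := by
  have e : ∀ x : Site d, euclidNorm x ^ 2 * |lsA d μ x| = |μ| * (euclidNorm x ^ 2 * srwStep d x) := by
    intro x
    by_cases hx : x = 0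
    · subst hx; simp [euclidNorm]
    · rw [lsA, delta0_of_ne_zero hx, zero_sub, abs_neg, abs_mul, abs_of_nonneg (srwStep_nonneg d x)]; ring
  rw [tsum_congr e, tsum_mul_left, tsum_sq_mul_srwStep hd, mul_one]

/-- `|Â_{μ,j}(t)| ≤ 4π²|μ| ϱ(t)`. [cite: LiuSlade2024, §2.2.2 ("If |γ| = 1, by Taylor's theorem and symmetry, |Â_γ(k)| ≲ |k|")] -/
theorem norm_dFT_coefW_lsA_singleton_le (hd : 1 ≤ d) (μ : ℝ) (j : Fin d) (t : 𝕋 d) :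
    ‖dFT (coefW (lsA d μ) [j]) t‖ ≤ 4 * π ^ 2 * |μ| * tnorm t := by
  have hsum : Summable fun x => |lsA d μ x| := summable_abs_of_decay (abs_lsA_le μ ((d : ℝ) + 1)) (by linarith)
  have h2 : Summable fun x => euclidNorm x ^ 2 * |lsA d μ x| :=
    summable_sq_moment_of_decay (ρ := 1) (K := 1 + |μ|) (fun x => abs_lsA_le μ _ x) one_pos
  have h := norm_dFT_coefW_singleton_le (isZdSymmetric_lsA μ) hsum h2 j t
  rwa [tsum_sq_mul_abs_lsA hd] at h

/-- `|Â_{μ,w}(t)| ≤ (2π)^{|w|}(1 + |μ|) Z_{d+1}`. [cite: LiuSlade2024, §2.2.2 ("If |γ| ≥ 2, Taylor's theorem gives |Â_γ(k)| ≲ 1")] -/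
theorem norm_dFT_coefW_lsA_le (μ : ℝ) (w : List (Fin d)) (t : 𝕋 d) :
    ‖dFT (coefW (lsA d μ) w) t‖ ≤ (2 * π) ^ w.length * (1 + |μ|) * ∑' x : Site d, jnorm x ^ (-((d : ℝ) + 1)) :=
  (norm_dFT_le_tsum (summable_norm_coefW_lsA μ w) t).trans (tsum_norm_coefW_lsA_le μ w)

/-- `|F̂_j(t)| ≤ 4π² M₂(F) ϱ(t)` and the same for the truncations. [cite: LiuSlade2024, §2.2.2 (bound on F̂_γ/F̂ for |γ| = 1)] -/
theorem norm_FhatL_singleton_le (hFs : IsZdSymmetric F) (hsum : Summable fun x => |F x|)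
    (h2 : Summable fun x => euclidNorm x ^ 2 * |F x|) (j : Fin d) (t : 𝕋 d) :
    ‖FhatL F [j] t‖ ≤ 4 * π ^ 2 * (∑' x, euclidNorm x ^ 2 * |F x|) * tnorm t :=
  norm_dFT_coefW_singleton_le hFs hsum h2 j t

/-- `|F̂_{N,j}(t)| ≤ 4π² (Σ|x|²|F|) ϱ(t)` for symmetric `F` (Taylor and symmetry, uniformly in `N`). [cite: LiuSlade2024, §2.2.2 ("if `|γ| = 1` then symmetry and Taylor's theorem give `|F̂_γ(k)| ≲ K₁|k|`")] -/
theorem norm_FhatN_singleton_le (hFs : IsZdSymmetric F) (h2 : Summable fun x => euclidNorm x ^ 2 * |F x|)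
    (N : ℕ) (j : Fin d) (t : 𝕋 d) :
    ‖FhatN F N [j] t‖ ≤ 4 * π ^ 2 * (∑' x, euclidNorm x ^ 2 * |F x|) * tnorm t := by
  rw [FhatN, ← dFT_coefW_truncF]
  have h := norm_dFT_coefW_singleton_le (isZdSymmetric_truncF hFs N) (summable_abs_truncF N)
    (summable_of_ne_finset_zero (s := box d (2 ^ N)) fun x hx => by rw [truncF_of_not_mem hx, abs_zero, mul_zero]) j t
  exact h.trans (mul_le_mul_of_nonneg_right (mul_le_mul_of_nonneg_left (tsum_sq_mul_abs_truncF_le h2 N) (by positivity))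
    (tnorm_nonneg t))

/-- For `|w| < s - d` (summable coefficient families) `Ê_w = 𝓕[(2πix)^w E]`. [folklore] -/
theorem EhatL_eq_dFT_ls24E {K s : ℝ} (hdec : ∀ x, |F x| ≤ K / jnorm x ^ s) {w : List (Fin d)}
    (hw : (d : ℝ) < s - w.length) (t : 𝕋 d) : EhatL F w t = dFT (coefW (ls24E F) w) t := by
  have hA : Summable fun x => ‖coefW (lsA d (ls24Mu F)) w x‖ := summable_norm_coefW_lsA (ls24Mu F) w
  have hFw : Summable fun x => ‖coefW F w x‖ := summable_norm_coefW hdec w hw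
  have hE : Summable fun x => ‖coefW (ls24E F) w x‖ := summable_norm_coefW (abs_ls24E_le hdec) w hw
  have hA' : Summable fun x => mFourier x t * coefW (lsA d (ls24Mu F)) w x :=
    Summable.of_norm (hA.congr fun x => by rw [norm_mul, norm_mFourier_apply, one_mul])
  have hFw0 : Summable fun x => mFourier x t * coefW F w x :=
    Summable.of_norm (hFw.congr fun x => by rw [norm_mul, norm_mFourier_apply, one_mul])
  have hFw' : Summable fun x => (ls24Lambda F : ℂ) * (mFourier x t * coefW F w x) := hFw0.mul_left _
  have h1 : AhatL F w t = ∑' x, mFourier x t * coefW (lsA d (ls24Mu F)) w x := dFT_eq_tsum hA t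
  have h2 : FhatL F w t = ∑' x, mFourier x t * coefW F w x := dFT_eq_tsum hFw t
  have h3 : dFT (coefW (ls24E F) w) t = ∑' x, mFourier x t * coefW (ls24E F) w x := dFT_eq_tsum hE t
  rw [EhatL, h1, h2, h3, ← tsum_mul_left, ← Summable.tsum_sub hA' hFw']
  refine tsum_congr fun x => ?_
  simp only [coefW, ls24E]; push_cast; ring

/-- `E_N = ls24E F_N` lives in the box `2^N`. [folklore] -/
theorem ls24E_truncF_eq_zero {N : ℕ} {x : Site d} (hx : x ∉ box d (2 ^ N)) : ls24E (truncF F N) x = 0 := by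
  have hx1 : x ∉ box d 1 := fun h => hx (box_mono d (Nat.one_le_two_pow) h)
  rw [ls24E, lsA_eq_zero_of_not_mem_box _ hx1, truncF_of_not_mem hx]; ring

/-- At level `N`, `Ê_{N,w} = 𝓕[(2πix)^w E_N]` (finite sums, all `w`). [folklore] -/
theorem EhatN_eq_dFT_ls24E (N : ℕ) (w : List (Fin d)) (t : 𝕋 d) :
    EhatN F N w t = dFT (coefW (ls24E (truncF F N)) w) t := by
  have hsub : box d 1 ⊆ box d (2 ^ N) := box_mono d Nat.one_le_two_pow
  rw [dFT_eq_trigPoly_of_support (S := box d (2 ^ N)) (fun x hx => by rw [coefW, ls24E_truncF_eq_zero hx]; simp),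
    EhatN, AhatN, dFT_coefW_lsA_eq_trigPoly, FhatN, dyadicSum,
    ← trigPoly_subset hsub (fun x _ hx => coefW_lsA_eq_zero _ w hx), trigPoly_apply, trigPoly_apply, trigPoly_apply,
    Finset.mul_sum, ← Finset.sum_sub_distrib]
  refine Finset.sum_congr rfl fun x hx => ?_
  simp only [smul_eq_mul, coefW, ls24E, truncF_of_mem hx]
  push_cast; ring

/-- **Lemma 2.2 for `E = A_μ - λF`**: `|Ê_w(t)| ≤ 128π⁷ (1 + |μ| + |λ|K₁) Z_{d+ρ-σ} ϱ(t)^{2+σ-|w|}` whenever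
`F` is symmetric with `|F(x)| ≤ K₁⟦x⟧^{-(d+2+ρ)}` and `Σ F + F'' ≠ 0` (applies to `F` and to the truncations
`F_N`, eventually). [cite: LiuSlade2024, Lemma 2.2 with (2.4)] -/
theorem norm_dFT_coefW_ls24E_le (hd : 1 ≤ d) (hFs : IsZdSymmetric F) (hdec : ∀ x, |F x| ≤ K₁ / jnorm x ^ ((d : ℝ) + 2 + ρ))
    (hne : (∑' x, F x) + ls24Fpp F ≠ 0) {σ : ℝ} (hσ0 : 0 < σ) (hσρ : σ < ρ) (hσ2 : σ ≤ 2)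
    {w : List (Fin d)} (hw : (w.length : ℝ) < 2 + σ) (t : 𝕋 d) :
    ‖dFT (coefW (ls24E F) w) t‖ ≤ 128 * π ^ 7 * ((1 + |ls24Mu F| + |ls24Lambda F| * K₁) *
      ∑' x : Site d, jnorm x ^ (-((d : ℝ) + ρ - σ))) * tnorm t ^ (2 + σ - w.length) := by
  have hρ : 0 < ρ := hσ0.trans hσρ
  have hEdec := abs_ls24E_le hdec (F := F)
  have hsum : Summable fun x => |F x| := summable_abs_of_decay hdec (by linarith)
  have h2 : Summable fun x => euclidNorm x ^ 2 * |F x| := summable_sq_moment_of_decay hdec hρ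
  have h := lemma22 (isZdSymmetric_ls24E hFs) hEdec (tsum_ls24E hd hsum) (tsum_sq_mul_ls24E hd h2 hne) hσ0 hσρ hσ2 hw t
  refine h.trans (mul_le_mul_of_nonneg_right (mul_le_mul_of_nonneg_left (moment_le_of_decay hEdec hσ0 hσρ) (by positivity))
    (Real.rpow_nonneg (tnorm_nonneg t) _))

end FactorBounds

/-! ### The three factor packages (Lemma 2.5 with the convergence of the level-`N` approximants) -/

section Packages

variable {K₁ K₂ ρ : ℝ}

/-- `‖1‖_∞ = 1` (exponent `1/0 = ∞`). [folklore] -/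
theorem eLpNorm_one_pinv_zero : eLpNorm (fun _ : 𝕋 d => (1 : ℂ)) (pinv 0) volume = 1 := by
  rw [pinv, ENNReal.ofReal_zero, ENNReal.inv_zero, eLpNorm_exponent_top, eLpNormEssSup_const _ (NeZero.ne volume)]
  simp

/-- `ϱ · ϱ^{-2} = ϱ^{-1}` for `ϱ > 0`. [folklore] -/
theorem tnorm_mul_rpow_neg_two {t : 𝕋 d} (ht : 0 < tnorm t) : tnorm t * tnorm t ^ (-(2 : ℝ)) = tnorm t ^ (-(1 : ℝ)) := by
  rw [show (-(1 : ℝ)) = 1 + -(2 : ℝ) by norm_num, Real.rpow_add ht, Real.rpow_one]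

/-- `Â_w` is measurable. [folklore] -/
theorem measurable_AhatL (F : Site d → ℝ) (w : List (Fin d)) : Measurable (AhatL F w) :=
  (isSmooth_AhatL F w).continuous.measurable

/-- `F̂_w` is measurable. [folklore] -/
theorem measurable_FhatL (F : Site d → ℝ) (w : List (Fin d)) : Measurable (FhatL F w) :=
  (stronglyMeasurable_dFT _).measurable

/-- The uniform lower bound `μ ≥ μ₀ = (dK₂/2π²)/(K₁(Z₁+Z₂))` and the parameter facts, packaged. [folklore] -/
theorem params_of_assumption (hd : 1 ≤ d) (hK₁ : 0 < K₁) (hK₂ : 0 < K₂) (hρ : 0 < ρ) {F : Site d → ℝ}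
    (hF : LS24Assumption d K₁ K₂ ρ F) :
    0 < ls24Lambda F ∧ ls24Lambda F ≤ 2 * π ^ 2 / (d * K₂) ∧ 0 < ls24Mu F ∧ ls24Mu F ≤ 1 ∧
      (d * K₂ / (2 * π ^ 2)) / (K₁ * (∑' x : Site d, jnorm x ^ (-((d : ℝ) + 2 + ρ)) +
        ∑' x : Site d, jnorm x ^ (-((d : ℝ) + ρ)))) ≤ ls24Mu F ∧
      (∑' x, F x) + ls24Fpp F ≠ 0 := by
  obtain ⟨hl0, hl1, h1⟩ := ls24Lambda_pos_and_le hd hF hρ hK₂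
  obtain ⟨hμ0, hμ1⟩ := ls24Mu_pos_le_one hd hF hρ hK₂
  have hZ1 : 1 ≤ ∑' x : Site d, jnorm x ^ (-((d : ℝ) + 2 + ρ)) := one_le_tsum_jnorm_rpow_neg (by linarith)
  have hZ2 : 1 ≤ ∑' x : Site d, jnorm x ^ (-((d : ℝ) + ρ)) := one_le_tsum_jnorm_rpow_neg (by linarith)
  have hden : 0 < K₁ * (∑' x : Site d, jnorm x ^ (-((d : ℝ) + 2 + ρ)) + ∑' x : Site d, jnorm x ^ (-((d : ℝ) + ρ))) := by
    positivity
  refine ⟨hl0, hl1, hμ0, hμ1, ?_, ?_⟩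
  · rw [div_le_iff₀ hden]; exact ls24Mu_ge hd hF hρ hK₂
  · intro h0; rw [h0, mul_zero] at h1; exact zero_ne_one h1

/-- **Package for the factors `Â_δ/Â` (`|δ| = ℓ ≥ 1`, exponent `ℓ/d + τ`).**
[cite: LiuSlade2024, Lemma 2.5 (Â_γ/Â ∈ L^q for q⁻¹ > |γ|/d) and its proof (§2.2.2)] -/
theorem packP (hd : 3 ≤ d) (hK₁ : 0 < K₁) (hK₂ : 0 < K₂) (hρ : 0 < ρ) {τ : ℝ} (hτ : 0 < τ)
    (ℓ : ℕ) (hℓ : 1 ≤ ℓ) (hℓn : (ℓ : ℝ) < d / 2 + 2 + ρ) (hs1 : (ℓ : ℝ) / d + τ ≤ 1) :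
    ∃ B : ℝ, ∀ F : Site d → ℝ, LS24Assumption d K₁ K₂ ρ F → ∀ w : List (Fin d), w.length = ℓ →
      AEStronglyMeasurable (facPL F w) volume ∧ (∀ N, AEStronglyMeasurable (facPN F N w) volume) ∧
      eLpNorm (facPL F w) (pinv ((ℓ : ℝ) / d + τ)) volume ≤ ENNReal.ofReal B ∧
      Tendsto (fun N => eLpNorm (fun t => facPN F N w t - facPL F w t) (pinv ((ℓ : ℝ) / d + τ)) volume) atTop (𝓝 0) := by
  have hd1 : 1 ≤ d := by omega
  have hd0 : (0 : ℝ) < d := by exact_mod_cast (show 0 < d by omega)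
  set Z' : ℝ := ∑' x : Site d, jnorm x ^ (-((d : ℝ) + 1)) with hZ'
  set μ₀ : ℝ := (d * K₂ / (2 * π ^ 2)) / (K₁ * (∑' x : Site d, jnorm x ^ (-((d : ℝ) + 2 + ρ)) +
    ∑' x : Site d, jnorm x ^ (-((d : ℝ) + ρ)))) with hμ₀
  have hZ1 : 1 ≤ ∑' x : Site d, jnorm x ^ (-((d : ℝ) + 2 + ρ)) := one_le_tsum_jnorm_rpow_neg (by linarith)
  have hZ2 : 1 ≤ ∑' x : Site d, jnorm x ^ (-((d : ℝ) + ρ)) := one_le_tsum_jnorm_rpow_neg (by linarith)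
  have hZ'1 : 1 ≤ Z' := one_le_tsum_jnorm_rpow_neg (by linarith)
  have hμ₀pos : 0 < μ₀ := by positivity
  set a : ℝ := if ℓ = 1 then 1 else 2 with ha
  set C : ℝ := if ℓ = 1 then π ^ 2 * d / μ₀ else 3 * (2 * π) ^ ℓ * Z' * (d / (8 * μ₀)) with hC
  have hC0 : 0 ≤ C := by rw [hC]; split_ifs <;> positivity
  have ha0 : 0 ≤ a := by rw [ha]; split_ifs <;> norm_num
  set s₂ : ℝ := (ℓ : ℝ) / d + τ with hs₂
  have hs₂0 : 0 < s₂ := by positivity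
  have has : a < d * s₂ := by
    rw [hs₂, mul_add, mul_div_cancel₀ _ hd0.ne']
    have : a ≤ ℓ := by
      rw [ha]; split_ifs with h
      · rw [h]; norm_num
      · have : (2 : ℝ) ≤ ℓ := by exact_mod_cast (show 2 ≤ ℓ by omega)
        exact this
    nlinarith
  set W : ℝ≥0∞ := eLpNorm (fun t : 𝕋 d => ((tnorm t ^ (-a) : ℝ) : ℂ)) (pinv s₂) volume with hW
  refine ⟨C * W.toReal, fun F hF w hw => ?_⟩
  obtain ⟨hl0, hl1, hμ0, hμ1, hμge, hne⟩ := params_of_assumption hd1 hK₁ hK₂ hρ hF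
  have hμ₀μ : μ₀ ≤ ls24Mu F := hμge
  have hsum := LS24Assumption.summable_abs hF hρ
  have h2 := LS24Assumption.summable_sq_mul_abs hF hρ
  have hw' : (w.length : ℝ) < d / 2 + 2 + ρ := by rw [hw]; exact hℓn
  -- measurability
  have hmL : AEStronglyMeasurable (facPL F w) volume :=
    ((measurable_AhatL F w).mul (measurable_AhatL F []).inv).aestronglyMeasurable
  have hmN : ∀ N, AEStronglyMeasurable (facPN F N w) volume := fun N =>
    ((factor_rules hd1 hF hρ hK₂.le hμ0.le hμ1 N ⟨0, by omega⟩).1 w).continuous.aestronglyMeasurable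
  -- the key pointwise bounds
  have hinv : ∀ {t : 𝕋 d}, 0 < tnorm t → ‖(AhatL F [] t)⁻¹‖ ≤ d / (8 * μ₀) * tnorm t ^ (-(2 : ℝ)) := by
    intro t ht
    refine (norm_inv_AhatL_le hd1 hμ0 hμ1 ht).trans (mul_le_mul_of_nonneg_right ?_ (Real.rpow_nonneg (tnorm_nonneg t) _))
    exact div_le_div_of_nonneg_left hd0.le (by positivity) (by linarith)
  have hgAN : ∀ N {t : 𝕋 d}, 0 < tnorm t → ‖gA F N t‖ ≤ d / (8 * μ₀) * tnorm t ^ (-(2 : ℝ)) := by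
    intro N t ht
    refine (norm_gA_le hd1 hμ0 hμ1 N ht).trans (mul_le_mul_of_nonneg_right ?_ (Real.rpow_nonneg (tnorm_nonneg t) _))
    exact div_le_div_of_nonneg_left hd0.le (by positivity) (by linarith)
  have hbound : ∀ (μ' : ℝ) (X g : ℂ) {t : 𝕋 d}, 0 < tnorm t → |μ'| ≤ 2 →
      (w = w → ‖X‖ ≤ (if ℓ = 1 then 4 * π ^ 2 * |μ'| * tnorm t else (2 * π) ^ ℓ * (1 + |μ'|) * Z')) →
      ‖g‖ ≤ d / (8 * μ₀) * tnorm t ^ (-(2 : ℝ)) → ‖X * g‖ ≤ C * tnorm t ^ (-a) := by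
    intro μ' X g t ht hμ' hX hg
    have hX := hX rfl
    rw [norm_mul]
    by_cases h1 : ℓ = 1
    · rw [if_pos h1] at hX
      rw [hC, ha, if_pos h1, if_pos h1]
      calc ‖X‖ * ‖g‖ ≤ (4 * π ^ 2 * |μ'| * tnorm t) * (d / (8 * μ₀) * tnorm t ^ (-(2 : ℝ))) :=
            mul_le_mul hX hg (norm_nonneg _) (by positivity)
        _ = (π ^ 2 * d * |μ'| / (2 * μ₀)) * (tnorm t * tnorm t ^ (-(2 : ℝ))) := by ring
        _ ≤ (π ^ 2 * d / μ₀) * (tnorm t * tnorm t ^ (-(2 : ℝ))) := by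
            refine mul_le_mul_of_nonneg_right ?_ (by positivity)
            rw [div_le_div_iff₀ (by positivity) hμ₀pos]
            nlinarith [mul_le_mul_of_nonneg_left hμ' (by positivity : (0 : ℝ) ≤ π ^ 2 * d * μ₀)]
        _ = π ^ 2 * d / μ₀ * tnorm t ^ (-(1 : ℝ)) := by rw [tnorm_mul_rpow_neg_two ht]
    · rw [if_neg h1] at hX
      rw [hC, ha, if_neg h1, if_neg h1]
      calc ‖X‖ * ‖g‖ ≤ ((2 * π) ^ ℓ * (1 + |μ'|) * Z') * (d / (8 * μ₀) * tnorm t ^ (-(2 : ℝ))) :=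
            mul_le_mul hX hg (norm_nonneg _) (by positivity)
        _ ≤ ((2 * π) ^ ℓ * 3 * Z') * (d / (8 * μ₀) * tnorm t ^ (-(2 : ℝ))) := by
            gcongr; linarith
        _ = 3 * (2 * π) ^ ℓ * Z' * (d / (8 * μ₀)) * tnorm t ^ (-(2 : ℝ)) := by ring
  have hbdL : ∀ᵐ t ∂volume, ‖facPL F w t‖ ≤ C * tnorm t ^ (-a) := by
    filter_upwards [ae_tnorm_pos hd1] with t ht
    refine hbound (ls24Mu F) (AhatL F w t) _ ht (by rw [abs_of_pos hμ0]; linarith) (fun _ => ?_) (hinv ht)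
    split_ifs with h1
    · obtain ⟨j, rfl⟩ := List.length_eq_one_iff.1 (hw.trans h1)
      exact norm_dFT_coefW_lsA_singleton_le hd1 _ j t
    · rw [← hw]; exact norm_dFT_coefW_lsA_le _ w t
  have hbdN : ∀ᶠ N in atTop, ∀ᵐ t ∂volume, ‖facPN F N w t‖ ≤ C * tnorm t ^ (-a) := by
    filter_upwards [eventually_levelN hd1 hF hρ hK₂] with N hN
    filter_upwards [ae_tnorm_pos hd1] with t ht
    refine hbound (ls24Mu (truncF F N)) (AhatN F N w t) _ ht hN.1 (fun _ => ?_) (hgAN N ht)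
    split_ifs with h1
    · obtain ⟨j, rfl⟩ := List.length_eq_one_iff.1 (hw.trans h1)
      exact norm_dFT_coefW_lsA_singleton_le hd1 _ j t
    · rw [← hw]; exact norm_dFT_coefW_lsA_le _ w t
  -- the package with trivial numerator
  have hlim := (ae_tendsto_factors hd1 hF hρ hK₂ hne hμ0 hμ1 hw').1
  obtain ⟨hB, hWfin, hT⟩ := factor_package hd1 (num := fun _ => (1 : ℂ)) (numN := fun _ _ => (1 : ℂ))
    (wgt := facPL F w) (wgtN := fun N => facPN F N w) (s₁ := 0) (s₂ := s₂) (s := s₂) (a := a) (C := C)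
    le_rfl hs₂0 hs1 has (by simp) hC0 aestronglyMeasurable_const (fun _ => aestronglyMeasurable_const)
    (by rw [eLpNorm_one_pinv_zero]; exact ENNReal.one_lt_top)
    (by simp) hmL hmN hbdL hbdN hlim
  refine ⟨hmL, hmN, ?_, ?_⟩
  · have e : (fun t => (1 : ℂ) * facPL F w t) = facPL F w := by funext t; rw [one_mul]
    rw [e, eLpNorm_one_pinv_zero, one_mul] at hB
    refine hB.trans (le_of_eq ?_)
    rw [ENNReal.ofReal_mul hC0, ENNReal.ofReal_toReal hWfin.ne]
  · refine hT.congr fun N => ?_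
    simp only [one_mul]

/-- `Σ|x|²|F| ≤ K₁ Z_{d+ρ}` under the decay of Assumption 1.1. [folklore] -/
theorem tsum_sq_mul_abs_le_of_decay {K : ℝ} {F : Site d → ℝ} (hdec : ∀ x, |F x| ≤ K / jnorm x ^ ((d : ℝ) + 2 + ρ))
    (hρ : 0 < ρ) : ∑' x, euclidNorm x ^ 2 * |F x| ≤ K * ∑' x : Site d, jnorm x ^ (-((d : ℝ) + ρ)) := by
  have hK : 0 ≤ K := by
    have h := (abs_nonneg _).trans (hdec 0)
    simpa [jnorm, euclidNorm] using h
  rw [← tsum_mul_left]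
  refine Summable.tsum_le_tsum (fun x => ?_) (summable_sq_moment_of_decay hdec hρ)
    ((summable_jnorm_rpow_neg (by linarith)).mul_left K)
  have hj := jnorm_pos x
  calc euclidNorm x ^ 2 * |F x| ≤ jnorm x ^ 2 * (K / jnorm x ^ ((d : ℝ) + 2 + ρ)) :=
        mul_le_mul (pow_le_pow_left₀ (euclidNorm_nonneg x) (euclidNorm_le_jnorm x) 2) (hdec x) (abs_nonneg _)
          (by positivity)
    _ = K * jnorm x ^ (-((d : ℝ) + ρ)) := by
        rw [Real.rpow_neg hj.le, show (d : ℝ) + ρ = ((d : ℝ) + 2 + ρ) - 2 by ring, Real.rpow_sub hj, Real.rpow_two]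
        field_simp

/-- **Package for the factors `F̂_γ/F̂` (`|γ| = ℓ ≥ 1`, exponent `ℓ/d + τ`).**
[cite: LiuSlade2024, Lemma 2.5 (F̂_γ/F̂ ∈ L^q for q⁻¹ > |γ|/d) and its proof (§2.2.2, with Lemma 2.6)] -/
theorem packR (hd : 3 ≤ d) (hK₁ : 0 < K₁) (hK₂ : 0 < K₂) (hρ : 0 < ρ) {τ : ℝ} (hτ : 0 < τ)
    (ℓ : ℕ) (hℓ : 1 ≤ ℓ) (hℓn : (ℓ : ℝ) < d / 2 + 2 + ρ) (hs1 : (ℓ : ℝ) / d + τ ≤ 1)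
    (hhalf : max (((ℓ : ℝ) - 2 - ρ) / d) 0 + τ / 2 ≤ 1 / 2) :
    ∃ B : ℝ, ∀ F : Site d → ℝ, LS24Assumption d K₁ K₂ ρ F → ∀ w : List (Fin d), w.length = ℓ →
      AEStronglyMeasurable (facRL F w) volume ∧ (∀ N, AEStronglyMeasurable (facRN F N w) volume) ∧
      eLpNorm (facRL F w) (pinv ((ℓ : ℝ) / d + τ)) volume ≤ ENNReal.ofReal B ∧
      Tendsto (fun N => eLpNorm (fun t => facRN F N w t - facRL F w t) (pinv ((ℓ : ℝ) / d + τ)) volume) atTop (𝓝 0) := by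
  have hd1 : 1 ≤ d := by omega
  have hd0 : (0 : ℝ) < d := by exact_mod_cast (show 0 < d by omega)
  set Z₂ : ℝ := ∑' x : Site d, jnorm x ^ (-((d : ℝ) + ρ)) with hZ₂
  have hZ2 : 1 ≤ Z₂ := one_le_tsum_jnorm_rpow_neg (by linarith)
  set s : ℝ := (ℓ : ℝ) / d + τ with hs
  by_cases h1 : ℓ = 1
  · -- type A: pointwise `|F̂_j/F̂| ≤ (4π²K₁Z₂/K₂) ϱ^{-1}`
    subst h1
    set C : ℝ := 4 * π ^ 2 * (K₁ * Z₂) / K₂ with hC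
    have hC0 : 0 ≤ C := by positivity
    have hs0 : 0 < s := by positivity
    have has : (1 : ℝ) < d * s := by
      rw [hs, mul_add, Nat.cast_one, mul_div_cancel₀ _ hd0.ne']; nlinarith
    set W : ℝ≥0∞ := eLpNorm (fun t : 𝕋 d => ((tnorm t ^ (-(1 : ℝ)) : ℝ) : ℂ)) (pinv s) volume with hW
    refine ⟨C * W.toReal, fun F hF w hw => ?_⟩
    obtain ⟨j, rfl⟩ := List.length_eq_one_iff.1 hw
    obtain ⟨hl0, hl1, hμ0, hμ1, -, hne⟩ := params_of_assumption hd1 hK₁ hK₂ hρ hF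
    have hsum := LS24Assumption.summable_abs hF hρ
    have h2 := LS24Assumption.summable_sq_mul_abs hF hρ
    have hM2 : ∑' x, euclidNorm x ^ 2 * |F x| ≤ K₁ * Z₂ := tsum_sq_mul_abs_le_of_decay hF.2.1 hρ
    have hmL : AEStronglyMeasurable (facRL F [j]) volume :=
      ((measurable_FhatL F [j]).mul (measurable_FhatL F []).inv).aestronglyMeasurable
    have hmN : ∀ N, AEStronglyMeasurable (facRN F N [j]) volume := fun N =>
      ((factor_rules hd1 hF hρ hK₂.le hμ0.le hμ1 N ⟨0, by omega⟩).2.2.1 [j]).continuous.aestronglyMeasurable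
    have hbound : ∀ (X g : ℂ) {t : 𝕋 d}, 0 < tnorm t →
        ‖X‖ ≤ 4 * π ^ 2 * (∑' x, euclidNorm x ^ 2 * |F x|) * tnorm t → ‖g‖ ≤ 1 / K₂ * tnorm t ^ (-(2 : ℝ)) →
        ‖X * g‖ ≤ C * tnorm t ^ (-(1 : ℝ)) := by
      intro X g t ht hX hg
      rw [norm_mul]
      calc ‖X‖ * ‖g‖ ≤ (4 * π ^ 2 * (K₁ * Z₂) * tnorm t) * (1 / K₂ * tnorm t ^ (-(2 : ℝ))) :=
            mul_le_mul (hX.trans (by gcongr)) hg (norm_nonneg _) (by positivity)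
        _ = C * (tnorm t * tnorm t ^ (-(2 : ℝ))) := by rw [hC]; ring
        _ = C * tnorm t ^ (-(1 : ℝ)) := by rw [tnorm_mul_rpow_neg_two ht]
    have hbdL : ∀ᵐ t ∂volume, ‖facRL F [j] t‖ ≤ C * tnorm t ^ (-(1 : ℝ)) := by
      filter_upwards [ae_tnorm_pos hd1] with t ht
      exact hbound _ _ ht (norm_FhatL_singleton_le hF.1 hsum h2 j t) (norm_inv_FhatL_le hF hρ hK₂ ht)
    have hbdN : ∀ᶠ N in atTop, ∀ᵐ t ∂volume, ‖facRN F N [j] t‖ ≤ C * tnorm t ^ (-(1 : ℝ)) := by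
      refine Eventually.of_forall fun N => ?_
      filter_upwards [ae_tnorm_pos hd1] with t ht
      exact hbound _ _ ht (norm_FhatN_singleton_le hF.1 h2 N j t) (norm_gF_le hF hρ hK₂ N ht)
    have hlim := (ae_tendsto_factors hd1 hF hρ hK₂ hne hμ0 hμ1 (w := [j]) (by simpa using hℓn)).2.2
    obtain ⟨hB, hWfin, hT⟩ := factor_package hd1 (num := fun _ => (1 : ℂ)) (numN := fun _ _ => (1 : ℂ))
      (wgt := facRL F [j]) (wgtN := fun N => facRN F N [j]) (s₁ := 0) (s₂ := s) (s := s) (a := 1) (C := C)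
      le_rfl hs0 hs1 has (by simp) hC0 aestronglyMeasurable_const (fun _ => aestronglyMeasurable_const)
      (by rw [eLpNorm_one_pinv_zero]; exact ENNReal.one_lt_top) (by simp) hmL hmN hbdL hbdN hlim
    refine ⟨hmL, hmN, ?_, ?_⟩
    · have e : (fun t => (1 : ℂ) * facRL F [j] t) = facRL F [j] := by funext t; rw [one_mul]
      rw [e, eLpNorm_one_pinv_zero, one_mul] at hB
      refine hB.trans (le_of_eq ?_)
      rw [ENNReal.ofReal_mul hC0, ENNReal.ofReal_toReal hWfin.ne]
    · exact hT.congr fun N => by simp only [one_mul]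
  · -- type B: numerator `F̂_γ ∈ L^{1/s₁}`, weight `1/F̂`
    have hℓ2 : 2 ≤ ℓ := by omega
    have hℓ2' : (2 : ℝ) ≤ ℓ := by exact_mod_cast hℓ2
    set s₁ : ℝ := max (((ℓ : ℝ) - 2 - ρ) / d) 0 + τ / 2 with hs₁
    set s₂ : ℝ := 2 / d + τ / 2 with hs₂
    have hs₁0 : 0 < s₁ := by have := le_max_right (((ℓ : ℝ) - 2 - ρ) / d) 0; rw [hs₁]; linarith
    have hs₂0 : 0 < s₂ := by positivity
    have hs12 : s₁ + s₂ ≤ s := by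
      rw [hs₁, hs₂, hs]
      have hm : max (((ℓ : ℝ) - 2 - ρ) / d) 0 ≤ ((ℓ : ℝ) - 2) / d := by
        refine max_le ?_ ?_
        · exact div_le_div_of_nonneg_right (by linarith) hd0.le
        · exact div_nonneg (by linarith) hd0.le
      have : ((ℓ : ℝ) - 2) / d + 2 / d = ℓ / d := by field_simp; ring
      linarith
    have hs₂1 : s₂ ≤ 1 := by linarith
    have has : (2 : ℝ) < d * s₂ := by rw [hs₂, mul_add, mul_div_cancel₀ _ hd0.ne']; nlinarith
    -- the numerator exponent `q = 1/s₁ ≥ 2` and its dyadic data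
    set q : ℝ := 1 / s₁ with hq
    have hq2 : 2 ≤ q := by
      rw [hq, le_div_iff₀ hs₁0]; linarith
    have hpq : pinv s₁ = ENNReal.ofReal q := by rw [pinv, hq, one_div, ENNReal.ofReal_inv_of_pos hs₁0]
    set b : ℝ := (d : ℝ) + 2 + ρ - ℓ with hb
    have hbhalf : (d : ℝ) / 2 < b := by rw [hb]; linarith
    have hθ : 0 < d / q - (d - b) := by
      rw [hq, div_div_eq_mul_div, div_one, hb, hs₁]
      have : ((ℓ : ℝ) - 2 - ρ) ≤ d * max (((ℓ : ℝ) - 2 - ρ) / d) 0 := by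
        have h := le_max_left (((ℓ : ℝ) - 2 - ρ) / d) 0
        have := mul_le_mul_of_nonneg_left h hd0.le
        rwa [mul_div_cancel₀ _ hd0.ne'] at this
      nlinarith
    set Kc : ℝ := (2 * π) ^ ℓ * K₁ with hKc
    set Bnum : ℝ := 3 ^ d * Kc + 8 ^ d * Kc / (1 - (2 : ℝ) ^ (-(d / q - (d - b)))) with hBnum
    have hBnum0 : 0 ≤ Bnum := by
      have hr : (2 : ℝ) ^ (-(d / q - (d - b))) < 1 := Real.rpow_lt_one_of_one_lt_of_neg (by norm_num) (by linarith)
      rw [hBnum]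
      exact add_nonneg (by positivity) (div_nonneg (by positivity) (by linarith))
    set W : ℝ≥0∞ := eLpNorm (fun t : 𝕋 d => ((tnorm t ^ (-(2 : ℝ)) : ℝ) : ℂ)) (pinv s₂) volume with hW
    refine ⟨Bnum * (1 / K₂ * W.toReal), fun F hF w hw => ?_⟩
    obtain ⟨hl0, hl1, hμ0, hμ1, -, hne⟩ := params_of_assumption hd1 hK₁ hK₂ hρ hF
    have hsum := LS24Assumption.summable_abs hF hρ
    have hw' : (w.length : ℝ) < d / 2 + 2 + ρ := by rw [hw]; exact hℓn
    have hdecw : ∀ x, ‖coefW F w x‖ ≤ Kc / jnorm x ^ b := by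
      intro x; have h := norm_coefW_le hF.2.1 w x; rw [hw] at h; rw [hKc, hb]; exact h
    have hmL : AEStronglyMeasurable (facRL F w) volume :=
      ((measurable_FhatL F w).mul (measurable_FhatL F []).inv).aestronglyMeasurable
    have hmN : ∀ N, AEStronglyMeasurable (facRN F N w) volume := fun N =>
      ((factor_rules hd1 hF hρ hK₂.le hμ0.le hμ1 N ⟨0, by omega⟩).2.2.1 w).continuous.aestronglyMeasurable
    -- numerator facts
    have hnum_le : eLpNorm (FhatL F w) (pinv s₁) volume ≤ ENNReal.ofReal Bnum := by
      rw [hpq]; exact eLpNorm_dFT_le hdecw hbhalf hq2 hθ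
    have hnum_lim : Tendsto (fun N => eLpNorm (FhatN F N w - FhatL F w) (pinv s₁) volume) atTop (𝓝 0) := by
      have h := tendsto_eLpNorm_dFT_sub_dyadicSum hdecw hbhalf hq2 hθ
      rw [hpq]
      refine h.congr fun N => ?_
      rw [← eLpNorm_neg, neg_sub]; rfl
    -- weight facts
    have hwgt : AEStronglyMeasurable (fun t => (FhatL F [] t)⁻¹) volume := (measurable_FhatL F []).inv.aestronglyMeasurable
    have hwgtN : ∀ N, AEStronglyMeasurable (gF F N) volume := fun N =>
      (isSmooth_gF hF hρ hK₂.le N).continuous.aestronglyMeasurable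
    have hbdL : ∀ᵐ t ∂volume, ‖(FhatL F [] t)⁻¹‖ ≤ 1 / K₂ * tnorm t ^ (-(2 : ℝ)) := by
      filter_upwards [ae_tnorm_pos hd1] with t ht using norm_inv_FhatL_le hF hρ hK₂ ht
    have hbdN : ∀ᶠ N in atTop, ∀ᵐ t ∂volume, ‖gF F N t‖ ≤ 1 / K₂ * tnorm t ^ (-(2 : ℝ)) :=
      Eventually.of_forall fun N => by
        filter_upwards [ae_tnorm_pos hd1] with t ht using norm_gF_le hF hρ hK₂ N ht
    have hglim : ∀ᵐ t ∂volume, Tendsto (fun N => gF F N t) atTop (𝓝 ((FhatL F [] t)⁻¹)) := by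
      filter_upwards [ae_tnorm_pos hd1] with t ht using tendsto_gF hF hρ hK₂ hne ht
    obtain ⟨hB, hWfin, hT⟩ := factor_package hd1 (num := FhatL F w) (numN := fun N => FhatN F N w)
      (wgt := fun t => (FhatL F [] t)⁻¹) (wgtN := fun N => gF F N) (s₁ := s₁) (s₂ := s₂) (s := s) (a := 2)
      (C := 1 / K₂) hs₁0.le hs₂0 hs₂1 has hs12 (by positivity) (measurable_FhatL F w).aestronglyMeasurable
      (fun N => (isSmooth_FhatN F N w).continuous.aestronglyMeasurable) (hnum_le.trans_lt ENNReal.ofReal_lt_top)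
      hnum_lim hwgt hwgtN hbdL hbdN hglim
    refine ⟨hmL, hmN, ?_, ?_⟩
    · refine hB.trans ?_
      calc eLpNorm (FhatL F w) (pinv s₁) volume * (ENNReal.ofReal (1 / K₂) * W)
          ≤ ENNReal.ofReal Bnum * (ENNReal.ofReal (1 / K₂) * W) := by gcongr
        _ = ENNReal.ofReal (Bnum * (1 / K₂ * W.toReal)) := by
            rw [ENNReal.ofReal_mul hBnum0, ENNReal.ofReal_mul (by positivity), ENNReal.ofReal_toReal hWfin.ne]
    · exact hT

/-- **Package for the factor `Ê_β/(ÂF̂)`, case `|β| < 2 + σ`** (pointwise, through Lemma 2.2; exponent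
`(2 - σ + ℓ)/d + τ`). [cite: LiuSlade2024, Lemma 2.5 (Ê_γ/(ÂF̂) ∈ L^q, q⁻¹ > (2-σ+|γ|)/d) and its proof, case |γ| < 2 + σ] -/
theorem packQA (hd : 3 ≤ d) (hK₁ : 0 < K₁) (hK₂ : 0 < K₂) (hρ : 0 < ρ) {σ τ : ℝ} (hσ0 : 0 < σ) (hσρ : σ < ρ)
    (hσ2 : σ ≤ 2) (hτ : 0 < τ) (ℓ : ℕ) (hℓσ : (ℓ : ℝ) < 2 + σ) (hℓn : (ℓ : ℝ) < d / 2 + 2 + ρ)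
    (hs1 : (2 - σ + ℓ) / d + τ ≤ 1) :
    ∃ B : ℝ, ∀ F : Site d → ℝ, LS24Assumption d K₁ K₂ ρ F → ∀ w : List (Fin d), w.length = ℓ →
      AEStronglyMeasurable (facQL F w) volume ∧ (∀ N, AEStronglyMeasurable (facQN F N w) volume) ∧
      eLpNorm (facQL F w) (pinv ((2 - σ + ℓ) / d + τ)) volume ≤ ENNReal.ofReal B ∧
      Tendsto (fun N => eLpNorm (fun t => facQN F N w t - facQL F w t) (pinv ((2 - σ + ℓ) / d + τ)) volume)
        atTop (𝓝 0) := by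
  have hd1 : 1 ≤ d := by omega
  have hd0 : (0 : ℝ) < d := by exact_mod_cast (show 0 < d by omega)
  set Z₃ : ℝ := ∑' x : Site d, jnorm x ^ (-((d : ℝ) + ρ - σ)) with hZ₃
  have hZ3 : 1 ≤ Z₃ := one_le_tsum_jnorm_rpow_neg (by linarith)
  set μ₀ : ℝ := (d * K₂ / (2 * π ^ 2)) / (K₁ * (∑' x : Site d, jnorm x ^ (-((d : ℝ) + 2 + ρ)) +
    ∑' x : Site d, jnorm x ^ (-((d : ℝ) + ρ)))) with hμ₀
  have hZ1 : 1 ≤ ∑' x : Site d, jnorm x ^ (-((d : ℝ) + 2 + ρ)) := one_le_tsum_jnorm_rpow_neg (by linarith)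
  have hZ2 : 1 ≤ ∑' x : Site d, jnorm x ^ (-((d : ℝ) + ρ)) := one_le_tsum_jnorm_rpow_neg (by linarith)
  have hμ₀pos : 0 < μ₀ := by positivity
  set lamMax : ℝ := 2 * π ^ 2 / (d * K₂) with hlamMax
  set KE : ℝ := 3 + (lamMax + 1) * K₁ with hKE
  have hKE0 : 0 ≤ KE := by positivity
  set C : ℝ := 128 * π ^ 7 * (KE * Z₃) * (d / (8 * μ₀)) * (1 / K₂) with hC
  have hC0 : 0 ≤ C := by positivity
  set a : ℝ := 2 - σ + ℓ with ha
  have ha0 : 0 ≤ a := by rw [ha]; have : (0 : ℝ) ≤ ℓ := Nat.cast_nonneg ℓ; linarith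
  set s : ℝ := (2 - σ + ℓ) / d + τ with hs
  have hs0 : 0 < s := by rw [hs]; positivity
  have has : a < d * s := by rw [hs, ha, mul_add, mul_div_cancel₀ _ hd0.ne']; nlinarith
  set W : ℝ≥0∞ := eLpNorm (fun t : 𝕋 d => ((tnorm t ^ (-a) : ℝ) : ℂ)) (pinv s) volume with hW
  refine ⟨C * W.toReal, fun F hF w hw => ?_⟩
  obtain ⟨hl0, hl1, hμ0, hμ1, hμge, hne⟩ := params_of_assumption hd1 hK₁ hK₂ hρ hF
  have hμ₀μ : μ₀ ≤ ls24Mu F := hμge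
  have hsum := LS24Assumption.summable_abs hF hρ
  have hw' : (w.length : ℝ) < d / 2 + 2 + ρ := by rw [hw]; exact hℓn
  have hwρ : (d : ℝ) < ((d : ℝ) + 2 + ρ) - w.length := by rw [hw]; linarith
  have hwσ : (w.length : ℝ) < 2 + σ := by rw [hw]; exact hℓσ
  -- measurability
  have hmL : AEStronglyMeasurable (facQL F w) volume := by
    have hE : Measurable (EhatL F w) := (measurable_AhatL F w).sub (measurable_const.mul (measurable_FhatL F w))
    exact (hE.mul ((measurable_AhatL F []).inv.mul (measurable_FhatL F []).inv)).aestronglyMeasurable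
  have hmN : ∀ N, AEStronglyMeasurable (facQN F N w) volume := fun N =>
    ((factor_rules hd1 hF hρ hK₂.le hμ0.le hμ1 N ⟨0, by omega⟩).2.1 w).continuous.aestronglyMeasurable
  -- weights
  have hinvA : ∀ {t : 𝕋 d}, 0 < tnorm t → ‖(AhatL F [] t)⁻¹‖ ≤ d / (8 * μ₀) * tnorm t ^ (-(2 : ℝ)) := by
    intro t ht
    refine (norm_inv_AhatL_le hd1 hμ0 hμ1 ht).trans (mul_le_mul_of_nonneg_right ?_ (Real.rpow_nonneg (tnorm_nonneg t) _))
    exact div_le_div_of_nonneg_left hd0.le (by positivity) (by linarith)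
  have hgAN : ∀ N {t : 𝕋 d}, 0 < tnorm t → ‖gA F N t‖ ≤ d / (8 * μ₀) * tnorm t ^ (-(2 : ℝ)) := by
    intro N t ht
    refine (norm_gA_le hd1 hμ0 hμ1 N ht).trans (mul_le_mul_of_nonneg_right ?_ (Real.rpow_nonneg (tnorm_nonneg t) _))
    exact div_le_div_of_nonneg_left hd0.le (by positivity) (by linarith)
  -- the pointwise combination
  have hbound : ∀ (X g₁ g₂ : ℂ) {t : 𝕋 d}, 0 < tnorm t →
      ‖X‖ ≤ 128 * π ^ 7 * (KE * Z₃) * tnorm t ^ (2 + σ - w.length) →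
      ‖g₁‖ ≤ d / (8 * μ₀) * tnorm t ^ (-(2 : ℝ)) → ‖g₂‖ ≤ 1 / K₂ * tnorm t ^ (-(2 : ℝ)) →
      ‖X * (g₁ * g₂)‖ ≤ C * tnorm t ^ (-a) := by
    intro X g₁ g₂ t ht hX h1 h2
    rw [norm_mul, norm_mul]
    have hpow : tnorm t ^ (2 + σ - w.length) * (tnorm t ^ (-(2 : ℝ)) * tnorm t ^ (-(2 : ℝ))) = tnorm t ^ (-a) := by
      rw [← Real.rpow_add ht, ← Real.rpow_add ht, hw, ha]; ring_nf
    calc ‖X‖ * (‖g₁‖ * ‖g₂‖) ≤ (128 * π ^ 7 * (KE * Z₃) * tnorm t ^ (2 + σ - w.length)) *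
          ((d / (8 * μ₀) * tnorm t ^ (-(2 : ℝ))) * (1 / K₂ * tnorm t ^ (-(2 : ℝ)))) :=
          mul_le_mul hX (mul_le_mul h1 h2 (norm_nonneg _) (by positivity)) (by positivity) (by positivity)
      _ = C * (tnorm t ^ (2 + σ - w.length) * (tnorm t ^ (-(2 : ℝ)) * tnorm t ^ (-(2 : ℝ)))) := by rw [hC]; ring
      _ = C * tnorm t ^ (-a) := by rw [hpow]
  have hKEbd : ∀ {μ' l' : ℝ}, |μ'| ≤ 2 → |l'| ≤ ls24Lambda F + 1 → 1 + |μ'| + |l'| * K₁ ≤ KE := by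
    intro μ' l' hμ' hl'
    rw [hKE]
    have : |l'| * K₁ ≤ (lamMax + 1) * K₁ := mul_le_mul_of_nonneg_right (by linarith) hK₁.le
    linarith
  have hbdL : ∀ᵐ t ∂volume, ‖facQL F w t‖ ≤ C * tnorm t ^ (-a) := by
    filter_upwards [ae_tnorm_pos hd1] with t ht
    refine hbound _ _ _ ht ?_ (hinvA ht) (norm_inv_FhatL_le hF hρ hK₂ ht)
    rw [EhatL_eq_dFT_ls24E hF.2.1 hwρ t]
    refine (norm_dFT_coefW_ls24E_le hd1 hF.1 hF.2.1 hne hσ0 hσρ hσ2 hwσ t).trans ?_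
    refine mul_le_mul_of_nonneg_right (mul_le_mul_of_nonneg_left (mul_le_mul_of_nonneg_right
      (hKEbd (by rw [abs_of_pos hμ0]; linarith) (by rw [abs_of_pos hl0]; linarith)) (by positivity)) (by positivity))
      (Real.rpow_nonneg (tnorm_nonneg t) _)
  have hbdN : ∀ᶠ N in atTop, ∀ᵐ t ∂volume, ‖facQN F N w t‖ ≤ C * tnorm t ^ (-a) := by
    filter_upwards [eventually_levelN hd1 hF hρ hK₂] with N hN
    filter_upwards [ae_tnorm_pos hd1] with t ht
    refine hbound _ _ _ ht ?_ (hgAN N ht) (norm_gF_le hF hρ hK₂ N ht)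
    rw [EhatN_eq_dFT_ls24E N w t]
    refine (norm_dFT_coefW_ls24E_le hd1 (isZdSymmetric_truncF hF.1 N) (abs_truncF_le_of_decay hF.2.1 N) hN.2.2
      hσ0 hσρ hσ2 hwσ t).trans ?_
    refine mul_le_mul_of_nonneg_right (mul_le_mul_of_nonneg_left (mul_le_mul_of_nonneg_right
      (hKEbd hN.1 hN.2.1) (by positivity)) (by positivity)) (Real.rpow_nonneg (tnorm_nonneg t) _)
  have hlim := (ae_tendsto_factors hd1 hF hρ hK₂ hne hμ0 hμ1 hw').2.1
  obtain ⟨hB, hWfin, hT⟩ := factor_package hd1 (num := fun _ => (1 : ℂ)) (numN := fun _ _ => (1 : ℂ))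
    (wgt := facQL F w) (wgtN := fun N => facQN F N w) (s₁ := 0) (s₂ := s) (s := s) (a := a) (C := C)
    le_rfl hs0 hs1 has (by simp) hC0 aestronglyMeasurable_const (fun _ => aestronglyMeasurable_const)
    (by rw [eLpNorm_one_pinv_zero]; exact ENNReal.one_lt_top) (by simp) hmL hmN hbdL hbdN hlim
  refine ⟨hmL, hmN, ?_, ?_⟩
  · have e : (fun t => (1 : ℂ) * facQL F w t) = facQL F w := by funext t; rw [one_mul]
    rw [e, eLpNorm_one_pinv_zero, one_mul] at hB
    refine hB.trans (le_of_eq ?_)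
    rw [ENNReal.ofReal_mul hC0, ENNReal.ofReal_toReal hWfin.ne]
  · exact hT.congr fun N => by simp only [one_mul]

/-- Sup bound on `Â_{N,w} - Â_w`: `|Â_{N,w}(t) - Â_w(t)| ≤ 3(2π)^ℓ Z_{d+1} |μ_N - μ|`. [folklore] -/
theorem norm_AhatN_sub_AhatL_le (F : Site d → ℝ) (N : ℕ) (w : List (Fin d)) (t : 𝕋 d) :
    ‖AhatN F N w t - AhatL F w t‖ ≤
      3 * (2 * π) ^ w.length * (∑' x : Site d, jnorm x ^ (-((d : ℝ) + 1))) * |ls24Mu (truncF F N) - ls24Mu F| := by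
  set T := trigPoly (box d 1) (coefW (srwStep d) w) t with hT
  have e : AhatN F N w t - AhatL F w t = ((ls24Mu F - ls24Mu (truncF F N) : ℝ) : ℂ) * T := by
    rw [AhatN_apply, AhatL_apply]; push_cast; ring
  have hTe : T = dFT (coefW (lsA d 0) w) t - dFT (coefW (lsA d 1) w) t := by
    rw [dFT_coefW_lsA_apply, dFT_coefW_lsA_apply]; push_cast; ring
  have hTn : ‖T‖ ≤ 3 * (2 * π) ^ w.length * ∑' x : Site d, jnorm x ^ (-((d : ℝ) + 1)) := by
    rw [hTe]
    refine (norm_sub_le _ _).trans ?_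
    have h0 := norm_dFT_coefW_lsA_le (0 : ℝ) w t (d := d)
    have h1 := norm_dFT_coefW_lsA_le (1 : ℝ) w t (d := d)
    simp only [abs_zero, add_zero, mul_one, abs_one] at h0 h1
    linarith
  rw [e, norm_mul, Complex.norm_real, Real.norm_eq_abs, abs_sub_comm]
  calc |ls24Mu (truncF F N) - ls24Mu F| * ‖T‖
      ≤ |ls24Mu (truncF F N) - ls24Mu F| * (3 * (2 * π) ^ w.length * ∑' x : Site d, jnorm x ^ (-((d : ℝ) + 1))) :=
        mul_le_mul_of_nonneg_left hTn (abs_nonneg _)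
    _ = _ := by ring

/-- **Package for the factor `Ê_β/(ÂF̂)`, case `|β| ≥ 2 + σ`** (numerator `Ê_β = Â_β - λF̂_β ∈ L^{1/s₁}`,
weight `1/(ÂF̂)`). [cite: LiuSlade2024, Lemma 2.5 and its proof, case 2 + σ ≤ |γ| < d/2 + 2 + ρ] -/
theorem packQB (hd : 3 ≤ d) (hK₁ : 0 < K₁) (hK₂ : 0 < K₂) (hρ : 0 < ρ) {σ τ : ℝ} (hσ0 : 0 < σ) (hσρ : σ < ρ)
    (hτ : 0 < τ) (ℓ : ℕ) (hℓσ : 2 + σ ≤ (ℓ : ℝ)) (hℓn : (ℓ : ℝ) < d / 2 + 2 + ρ)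
    (hs1 : (2 - σ + ℓ) / d + τ ≤ 1) (hhalf : max (((ℓ : ℝ) - 2 - ρ) / d) 0 + τ / 2 ≤ 1 / 2) :
    ∃ B : ℝ, ∀ F : Site d → ℝ, LS24Assumption d K₁ K₂ ρ F → ∀ w : List (Fin d), w.length = ℓ →
      AEStronglyMeasurable (facQL F w) volume ∧ (∀ N, AEStronglyMeasurable (facQN F N w) volume) ∧
      eLpNorm (facQL F w) (pinv ((2 - σ + ℓ) / d + τ)) volume ≤ ENNReal.ofReal B ∧
      Tendsto (fun N => eLpNorm (fun t => facQN F N w t - facQL F w t) (pinv ((2 - σ + ℓ) / d + τ)) volume)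
        atTop (𝓝 0) := by
  have hd1 : 1 ≤ d := by omega
  have hd0 : (0 : ℝ) < d := by exact_mod_cast (show 0 < d by omega)
  set Z' : ℝ := ∑' x : Site d, jnorm x ^ (-((d : ℝ) + 1)) with hZ'
  have hZ'1 : 1 ≤ Z' := one_le_tsum_jnorm_rpow_neg (by linarith)
  set μ₀ : ℝ := (d * K₂ / (2 * π ^ 2)) / (K₁ * (∑' x : Site d, jnorm x ^ (-((d : ℝ) + 2 + ρ)) +
    ∑' x : Site d, jnorm x ^ (-((d : ℝ) + ρ)))) with hμ₀
  have hZ1 : 1 ≤ ∑' x : Site d, jnorm x ^ (-((d : ℝ) + 2 + ρ)) := one_le_tsum_jnorm_rpow_neg (by linarith)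
  have hZ2 : 1 ≤ ∑' x : Site d, jnorm x ^ (-((d : ℝ) + ρ)) := one_le_tsum_jnorm_rpow_neg (by linarith)
  have hμ₀pos : 0 < μ₀ := by positivity
  set lamMax : ℝ := 2 * π ^ 2 / (d * K₂) with hlamMax
  have hlamMax0 : 0 ≤ lamMax := by positivity
  -- exponents
  set s : ℝ := (2 - σ + ℓ) / d + τ with hs
  set s₁ : ℝ := max (((ℓ : ℝ) - 2 - ρ) / d) 0 + τ / 2 with hs₁
  set s₂ : ℝ := 4 / d + τ / 2 with hs₂
  have hs₁0 : 0 < s₁ := by have := le_max_right (((ℓ : ℝ) - 2 - ρ) / d) 0; rw [hs₁]; linarith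
  have hs₂0 : 0 < s₂ := by positivity
  have hs12 : s₁ + s₂ ≤ s := by
    rw [hs₁, hs₂, hs]
    have hm : max (((ℓ : ℝ) - 2 - ρ) / d) 0 ≤ ((ℓ : ℝ) - 2 - σ) / d := by
      refine max_le ?_ ?_
      · exact div_le_div_of_nonneg_right (by linarith) hd0.le
      · exact div_nonneg (by linarith) hd0.le
    have : ((ℓ : ℝ) - 2 - σ) / d + 4 / d = (2 - σ + ℓ) / d := by field_simp; ring
    linarith
  have hs₂1 : s₂ ≤ 1 := by linarith
  have hs₁1 : s₁ ≤ 1 := by linarith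
  have has : (4 : ℝ) < d * s₂ := by rw [hs₂, mul_add, mul_div_cancel₀ _ hd0.ne']; nlinarith
  -- numerator dyadic data
  set q : ℝ := 1 / s₁ with hq
  have hq2 : 2 ≤ q := by rw [hq, le_div_iff₀ hs₁0]; linarith
  have hpq : pinv s₁ = ENNReal.ofReal q := by rw [pinv, hq, one_div, ENNReal.ofReal_inv_of_pos hs₁0]
  have hp1 : 1 ≤ pinv s₁ := one_le_pinv hs₁1
  set b : ℝ := (d : ℝ) + 2 + ρ - ℓ with hb
  have hbhalf : (d : ℝ) / 2 < b := by rw [hb]; linarith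
  have hθ : 0 < d / q - (d - b) := by
    rw [hq, div_div_eq_mul_div, div_one, hb, hs₁]
    have : ((ℓ : ℝ) - 2 - ρ) ≤ d * max (((ℓ : ℝ) - 2 - ρ) / d) 0 := by
      have h := le_max_left (((ℓ : ℝ) - 2 - ρ) / d) 0
      have := mul_le_mul_of_nonneg_left h hd0.le
      rwa [mul_div_cancel₀ _ hd0.ne'] at this
    nlinarith
  set Kc : ℝ := (2 * π) ^ ℓ * K₁ with hKc
  set Bnum : ℝ := 3 ^ d * Kc + 8 ^ d * Kc / (1 - (2 : ℝ) ^ (-(d / q - (d - b)))) with hBnum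
  have hBnum0 : 0 ≤ Bnum := by
    have hr : (2 : ℝ) ^ (-(d / q - (d - b))) < 1 := Real.rpow_lt_one_of_one_lt_of_neg (by norm_num) (by linarith)
    rw [hBnum]
    exact add_nonneg (by positivity) (div_nonneg (by positivity) (by linarith))
  set B₁ : ℝ := 2 * (2 * π) ^ ℓ * Z' + lamMax * Bnum with hB₁
  have hB₁0 : 0 ≤ B₁ := by positivity
  set C : ℝ := d / (8 * μ₀) * (1 / K₂) with hC
  have hC0 : 0 ≤ C := by positivity
  set W : ℝ≥0∞ := eLpNorm (fun t : 𝕋 d => ((tnorm t ^ (-(4 : ℝ)) : ℝ) : ℂ)) (pinv s₂) volume with hW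
  refine ⟨B₁ * (C * W.toReal), fun F hF w hw => ?_⟩
  obtain ⟨hl0, hl1, hμ0, hμ1, hμge, hne⟩ := params_of_assumption hd1 hK₁ hK₂ hρ hF
  have hμ₀μ : μ₀ ≤ ls24Mu F := hμge
  have hsum := LS24Assumption.summable_abs hF hρ
  have h2 := LS24Assumption.summable_sq_mul_abs hF hρ
  have hw' : (w.length : ℝ) < d / 2 + 2 + ρ := by rw [hw]; exact hℓn
  have hdecw : ∀ x, ‖coefW F w x‖ ≤ Kc / jnorm x ^ b := by
    intro x; have h := norm_coefW_le hF.2.1 w x; rw [hw] at h; rw [hKc, hb]; exact h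
  -- measurability
  have hEm : Measurable (EhatL F w) := (measurable_AhatL F w).sub (measurable_const.mul (measurable_FhatL F w))
  have hmL : AEStronglyMeasurable (facQL F w) volume :=
    (hEm.mul ((measurable_AhatL F []).inv.mul (measurable_FhatL F []).inv)).aestronglyMeasurable
  have hmN : ∀ N, AEStronglyMeasurable (facQN F N w) volume := fun N =>
    ((factor_rules hd1 hF hρ hK₂.le hμ0.le hμ1 N ⟨0, by omega⟩).2.1 w).continuous.aestronglyMeasurable
  -- numerator: bound
  have hFw_le : eLpNorm (FhatL F w) (pinv s₁) volume ≤ ENNReal.ofReal Bnum := by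
    rw [hpq]; exact eLpNorm_dFT_le hdecw hbhalf hq2 hθ
  have hA_le : ∀ (g : (𝕋 d) → ℂ) (M : ℝ), AEStronglyMeasurable g volume → (∀ t, ‖g t‖ ≤ M) →
      eLpNorm g (pinv s₁) volume ≤ ENNReal.ofReal M := by
    intro g M hg hM
    refine (eLpNorm_le_of_ae_bound (ae_of_all _ hM)).trans ?_
    rw [measure_univ, ENNReal.one_rpow, one_mul]
  have hnum_le : eLpNorm (EhatL F w) (pinv s₁) volume ≤ ENNReal.ofReal B₁ := by
    have e : EhatL F w = AhatL F w - (ls24Lambda F : ℂ) • FhatL F w := by funext t; simp [EhatL]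
    rw [e]
    refine (eLpNorm_sub_le (measurable_AhatL F w).aestronglyMeasurable
      ((measurable_FhatL F w).const_smul _).aestronglyMeasurable hp1).trans ?_
    rw [eLpNorm_const_smul, hB₁, ENNReal.ofReal_add (by positivity) (by positivity)]
    refine add_le_add (hA_le _ _ (measurable_AhatL F w).aestronglyMeasurable fun t => ?_) ?_
    · refine (norm_dFT_coefW_lsA_le _ w t).trans ?_
      rw [hw, abs_of_pos hμ0]
      have : (1 + ls24Mu F) ≤ 2 := by linarith
      calc (2 * π) ^ ℓ * (1 + ls24Mu F) * Z' ≤ (2 * π) ^ ℓ * 2 * Z' := by gcongr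
        _ = 2 * (2 * π) ^ ℓ * Z' := by ring
    · rw [← ofReal_norm, Complex.norm_real, Real.norm_of_nonneg hl0.le, ENNReal.ofReal_mul hlamMax0]
      exact mul_le_mul (ENNReal.ofReal_le_ofReal hl1) hFw_le bot_le bot_le
  -- numerator: convergence
  have hnum_lim : Tendsto (fun N => eLpNorm (EhatN F N w - EhatL F w) (pinv s₁) volume) atTop (𝓝 0) := by
    have hFlim : Tendsto (fun N => eLpNorm (FhatN F N w - FhatL F w) (pinv s₁) volume) atTop (𝓝 0) := by
      have h := tendsto_eLpNorm_dFT_sub_dyadicSum hdecw hbhalf hq2 hθ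
      rw [hpq]
      refine h.congr fun N => ?_
      rw [← eLpNorm_neg, neg_sub]; rfl
    -- the three error terms
    set e1 : ℕ → ℝ≥0∞ := fun N => ENNReal.ofReal (3 * (2 * π) ^ ℓ * Z' * |ls24Mu (truncF F N) - ls24Mu F|) with he1
    set e2 : ℕ → ℝ≥0∞ := fun N => ENNReal.ofReal (ls24Lambda F + 1) * eLpNorm (FhatN F N w - FhatL F w) (pinv s₁) volume
      with he2
    set e3 : ℕ → ℝ≥0∞ := fun N => ENNReal.ofReal |ls24Lambda (truncF F N) - ls24Lambda F| * ENNReal.ofReal Bnum with he3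
    have hle : ∀ᶠ N in atTop, eLpNorm (EhatN F N w - EhatL F w) (pinv s₁) volume ≤ e1 N + e2 N + e3 N := by
      filter_upwards [eventually_levelN hd1 hF hρ hK₂] with N hN
      have hsplit : EhatN F N w - EhatL F w =
          ((fun t => AhatN F N w t - AhatL F w t) - (ls24Lambda (truncF F N) : ℂ) • (FhatN F N w - FhatL F w)) -
            ((ls24Lambda (truncF F N) - ls24Lambda F : ℝ) : ℂ) • FhatL F w := by
        funext t; simp only [Pi.sub_apply, Pi.smul_apply, smul_eq_mul, EhatN, EhatL]; push_cast; ring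
      have hm1 : AEStronglyMeasurable (fun t => AhatN F N w t - AhatL F w t) volume :=
        ((isSmooth_AhatN F N w).continuous.measurable.sub (measurable_AhatL F w)).aestronglyMeasurable
      have hm2 : AEStronglyMeasurable ((ls24Lambda (truncF F N) : ℂ) • (FhatN F N w - FhatL F w)) volume :=
        (((isSmooth_FhatN F N w).continuous.measurable.sub (measurable_FhatL F w)).const_smul _).aestronglyMeasurable
      have hm3 : AEStronglyMeasurable (((ls24Lambda (truncF F N) - ls24Lambda F : ℝ) : ℂ) • FhatL F w) volume :=
        ((measurable_FhatL F w).const_smul _).aestronglyMeasurable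
      rw [hsplit]
      refine (eLpNorm_sub_le (hm1.sub hm2) hm3 hp1).trans (add_le_add ((eLpNorm_sub_le hm1 hm2 hp1).trans (add_le_add ?_ ?_)) ?_)
      · exact hA_le _ _ hm1 fun t => by rw [← hw]; exact norm_AhatN_sub_AhatL_le F N w t
      · rw [eLpNorm_const_smul, he2]
        refine mul_le_mul_of_nonneg_right ?_ bot_le
        rw [← ofReal_norm, Complex.norm_real, Real.norm_eq_abs]
        exact ENNReal.ofReal_le_ofReal hN.2.1
      · rw [eLpNorm_const_smul, he3, ← ofReal_norm, Complex.norm_real, Real.norm_eq_abs]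
        exact mul_le_mul_of_nonneg_left hFw_le bot_le
    have h1 : Tendsto e1 atTop (𝓝 0) := by
      rw [he1, ← ENNReal.ofReal_zero]
      refine ENNReal.tendsto_ofReal ?_
      have h := (tendsto_ls24Mu_truncF hsum h2 hne).sub_const (ls24Mu F)
      rw [sub_self] at h
      have h' := h.abs.const_mul (3 * (2 * π) ^ ℓ * Z')
      simpa using h'
    have h2' : Tendsto e2 atTop (𝓝 0) := by
      have h := ENNReal.Tendsto.const_mul hFlim (Or.inr ENNReal.ofReal_ne_top) (a := ENNReal.ofReal (ls24Lambda F + 1))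
      rwa [mul_zero] at h
    have h3 : Tendsto e3 atTop (𝓝 0) := by
      have h := (tendsto_ls24Lambda_truncF hsum h2 hne).sub_const (ls24Lambda F)
      rw [sub_self] at h
      have h' : Tendsto (fun N => ENNReal.ofReal |ls24Lambda (truncF F N) - ls24Lambda F|) atTop (𝓝 0) := by
        rw [← ENNReal.ofReal_zero]; exact ENNReal.tendsto_ofReal (by simpa using h.abs)
      have h'' := ENNReal.Tendsto.mul_const h' (Or.inr ENNReal.ofReal_ne_top) (b := ENNReal.ofReal Bnum)
      rwa [zero_mul] at h''
    have hsum0 : Tendsto (fun N => e1 N + e2 N + e3 N) atTop (𝓝 0) := by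
      have h := (h1.add h2').add h3; rwa [add_zero, add_zero] at h
    exact tendsto_of_tendsto_of_tendsto_of_le_of_le' tendsto_const_nhds hsum0 (Eventually.of_forall fun _ => bot_le) hle
  -- weights
  have hinvA : ∀ {t : 𝕋 d}, 0 < tnorm t → ‖(AhatL F [] t)⁻¹‖ ≤ d / (8 * μ₀) * tnorm t ^ (-(2 : ℝ)) := by
    intro t ht
    refine (norm_inv_AhatL_le hd1 hμ0 hμ1 ht).trans (mul_le_mul_of_nonneg_right ?_ (Real.rpow_nonneg (tnorm_nonneg t) _))
    exact div_le_div_of_nonneg_left hd0.le (by positivity) (by linarith)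
  have hgAN : ∀ N {t : 𝕋 d}, 0 < tnorm t → ‖gA F N t‖ ≤ d / (8 * μ₀) * tnorm t ^ (-(2 : ℝ)) := by
    intro N t ht
    refine (norm_gA_le hd1 hμ0 hμ1 N ht).trans (mul_le_mul_of_nonneg_right ?_ (Real.rpow_nonneg (tnorm_nonneg t) _))
    exact div_le_div_of_nonneg_left hd0.le (by positivity) (by linarith)
  have hwbound : ∀ (g₁ g₂ : ℂ) {t : 𝕋 d}, 0 < tnorm t → ‖g₁‖ ≤ d / (8 * μ₀) * tnorm t ^ (-(2 : ℝ)) →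
      ‖g₂‖ ≤ 1 / K₂ * tnorm t ^ (-(2 : ℝ)) → ‖g₁ * g₂‖ ≤ C * tnorm t ^ (-(4 : ℝ)) := by
    intro g₁ g₂ t ht h1 h2
    rw [norm_mul]
    have hpow : tnorm t ^ (-(2 : ℝ)) * tnorm t ^ (-(2 : ℝ)) = tnorm t ^ (-(4 : ℝ)) := by
      rw [← Real.rpow_add ht]; norm_num
    calc ‖g₁‖ * ‖g₂‖ ≤ (d / (8 * μ₀) * tnorm t ^ (-(2 : ℝ))) * (1 / K₂ * tnorm t ^ (-(2 : ℝ))) :=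
          mul_le_mul h1 h2 (norm_nonneg _) (by positivity)
      _ = C * (tnorm t ^ (-(2 : ℝ)) * tnorm t ^ (-(2 : ℝ))) := by rw [hC]; ring
      _ = C * tnorm t ^ (-(4 : ℝ)) := by rw [hpow]
  have hwgt : AEStronglyMeasurable (fun t => (AhatL F [] t)⁻¹ * (FhatL F [] t)⁻¹) volume :=
    ((measurable_AhatL F []).inv.mul (measurable_FhatL F []).inv).aestronglyMeasurable
  have hwgtN : ∀ N, AEStronglyMeasurable (fun t => gA F N t * gF F N t) volume := fun N =>
    ((isSmooth_gA hd1 hμ0.le hμ1 N).continuous.mul (isSmooth_gF hF hρ hK₂.le N).continuous).aestronglyMeasurable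
  have hbdL : ∀ᵐ t ∂volume, ‖(AhatL F [] t)⁻¹ * (FhatL F [] t)⁻¹‖ ≤ C * tnorm t ^ (-(4 : ℝ)) := by
    filter_upwards [ae_tnorm_pos hd1] with t ht using hwbound _ _ ht (hinvA ht) (norm_inv_FhatL_le hF hρ hK₂ ht)
  have hbdN : ∀ᶠ N in atTop, ∀ᵐ t ∂volume, ‖gA F N t * gF F N t‖ ≤ C * tnorm t ^ (-(4 : ℝ)) :=
    Eventually.of_forall fun N => by
      filter_upwards [ae_tnorm_pos hd1] with t ht using hwbound _ _ ht (hgAN N ht) (norm_gF_le hF hρ hK₂ N ht)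
  have hglim : ∀ᵐ t ∂volume, Tendsto (fun N => gA F N t * gF F N t) atTop (𝓝 ((AhatL F [] t)⁻¹ * (FhatL F [] t)⁻¹)) := by
    filter_upwards [ae_tnorm_pos hd1] with t ht
    exact (tendsto_gA hd1 hsum h2 hne hμ0 hμ1 ht).mul (tendsto_gF hF hρ hK₂ hne ht)
  obtain ⟨hB, hWfin, hT⟩ := factor_package hd1 (num := EhatL F w) (numN := fun N => EhatN F N w)
    (wgt := fun t => (AhatL F [] t)⁻¹ * (FhatL F [] t)⁻¹) (wgtN := fun N t => gA F N t * gF F N t)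
    (s₁ := s₁) (s₂ := s₂) (s := s) (a := 4) (C := C) hs₁0.le hs₂0 hs₂1 has hs12 hC0 hEm.aestronglyMeasurable
    (fun N => (isSmooth_EhatN F N w).continuous.aestronglyMeasurable) (hnum_le.trans_lt ENNReal.ofReal_lt_top)
    hnum_lim hwgt hwgtN hbdL hbdN hglim
  refine ⟨hmL, hmN, ?_, ?_⟩
  · refine hB.trans ?_
    calc eLpNorm (EhatL F w) (pinv s₁) volume * (ENNReal.ofReal C * W)
        ≤ ENNReal.ofReal B₁ * (ENNReal.ofReal C * W) := by gcongr
      _ = ENNReal.ofReal (B₁ * (C * W.toReal)) := by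
          rw [ENNReal.ofReal_mul hB₁0, ENNReal.ofReal_mul hC0, ENNReal.ofReal_toReal hWfin.ne]
  · exact hT

/-- **Package for the factor `Ê_β/(ÂF̂)`** (both regimes; exponent `(2 - σ + ℓ)/d + τ`).
[cite: LiuSlade2024, Lemma 2.5 (Ê_γ/(ÂF̂) ∈ L^q for q⁻¹ > (2 - σ + |γ|)/d)] -/
theorem packQ (hd : 3 ≤ d) (hK₁ : 0 < K₁) (hK₂ : 0 < K₂) (hρ : 0 < ρ) {σ τ : ℝ} (hσ0 : 0 < σ) (hσρ : σ < ρ)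
    (hσ2 : σ ≤ 2) (hτ : 0 < τ) (ℓ : ℕ) (hℓn : (ℓ : ℝ) < d / 2 + 2 + ρ)
    (hs1 : (2 - σ + ℓ) / d + τ ≤ 1) (hhalf : max (((ℓ : ℝ) - 2 - ρ) / d) 0 + τ / 2 ≤ 1 / 2) :
    ∃ B : ℝ, ∀ F : Site d → ℝ, LS24Assumption d K₁ K₂ ρ F → ∀ w : List (Fin d), w.length = ℓ →
      AEStronglyMeasurable (facQL F w) volume ∧ (∀ N, AEStronglyMeasurable (facQN F N w) volume) ∧
      eLpNorm (facQL F w) (pinv ((2 - σ + ℓ) / d + τ)) volume ≤ ENNReal.ofReal B ∧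
      Tendsto (fun N => eLpNorm (fun t => facQN F N w t - facQL F w t) (pinv ((2 - σ + ℓ) / d + τ)) volume)
        atTop (𝓝 0) := by
  by_cases h : (ℓ : ℝ) < 2 + σ
  · exact packQA hd hK₁ hK₂ hρ hσ0 hσρ hσ2 hτ ℓ h hℓn hs1
  · exact packQB hd hK₁ hK₂ hρ hσ0 hσρ hτ ℓ (not_lt.1 h) hℓn hs1 hhalf

end Packages

/-! ### Bookkeeping: shape and order of the monomials of `∇^α f̂`, coefficient mass -/

section Bookkeeping

/-- The order (total number of derivatives) of a monomial. [folklore] -/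
def Mono.order (m : Mono d) : ℕ := (m.δs.map List.length).sum + m.β.length + (m.γs.map List.length).sum

/-- Well-formedness at order `k`: exactly `k` derivatives, at most `k` factors of each outer type, all
outer words nonempty. [folklore] -/
structure Mono.WF (k : ℕ) (m : Mono d) : Prop where
  order_eq : m.order = k
  δs_le : m.δs.length ≤ k
  γs_le : m.γs.length ≤ k
  δs_ne : ∀ δ ∈ m.δs, δ ≠ []
  γs_ne : ∀ γ ∈ m.γs, γ ≠ []

/-- The starting monomial `Ê/(ÂF̂)`. [cite: LiuSlade2024, §2.2.1 (f̂ = ĈÊĜ)] -/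
def Mono.init (d : ℕ) : Mono d := ⟨[], [], []⟩

/-- The starting monomial `Ê/(ÂF̂)` is well formed of order `0`. [folklore] -/
theorem Mono.WF_init : (Mono.init d).WF 0 :=
  ⟨by simp [Mono.init, Mono.order], by simp [Mono.init], by simp [Mono.init], by simp [Mono.init], by simp [Mono.init]⟩

/-- Prepending a letter to one word raises the total word length by one. [folklore] -/
theorem sum_length_modifyAt_cons (j : Fin d) : ∀ (i : ℕ) (ws : List (List (Fin d))), i < ws.length →
    ((modifyAt (fun w => j :: w) i ws).map List.length).sum = (ws.map List.length).sum + 1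
  | _, [], h => by simp at h
  | 0, w :: ws, _ => by simp; omega
  | i + 1, w :: ws, h => by
    have h' : i < ws.length := by simpa using h
    simp [sum_length_modifyAt_cons j i ws h']; omega

/-- Prepending a letter to one word keeps all words nonempty. [folklore] -/
theorem ne_nil_of_mem_modifyAt_cons (j : Fin d) {i : ℕ} {ws : List (List (Fin d))} (h : ∀ w ∈ ws, w ≠ [])
    {w : List (Fin d)} (hw : w ∈ modifyAt (fun w => j :: w) i ws) : w ≠ [] := by
  rcases mem_modifyAt _ i ws w hw with h' | ⟨a, -, rfl⟩
  · exact h w h'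
  · exact List.cons_ne_nil j a

/-- `∂ⱼ` raises the order by one and preserves well-formedness. [folklore] -/
theorem Mono.WF_Dm {k : ℕ} {m : Mono d} (hm : m.WF k) (j : Fin d) : ∀ zm ∈ Dm j m, zm.2.WF (k + 1) := by
  obtain ⟨hord, hδ, hγ, hδne, hγne⟩ := hm
  intro zm hzm
  simp only [Dm, List.mem_append, List.mem_map, List.mem_range, List.mem_cons,
    List.not_mem_nil, or_false] at hzm
  have hδ1 : m.δs.length ≤ k + 1 := hδ.trans k.le_succ
  have hγ1 : m.γs.length ≤ k + 1 := hγ.trans k.le_succ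
  rcases hzm with ((⟨i, hi, rfl⟩ | rfl) | ⟨i, hi, rfl⟩) | rfl | rfl
  · refine ⟨?_, by simpa using hδ1, hγ1, fun δ hδ' => ne_nil_of_mem_modifyAt_cons j hδne hδ', hγne⟩
    simp only [Mono.order, sum_length_modifyAt_cons j i _ hi] at hord ⊢; omega
  · refine ⟨?_, hδ1, hγ1, hδne, hγne⟩
    simp only [Mono.order, List.length_cons] at hord ⊢; omega
  · refine ⟨?_, hδ1, by simpa using hγ1, hδne, fun γ hγ' => ne_nil_of_mem_modifyAt_cons j hγne hγ'⟩
    simp only [Mono.order, sum_length_modifyAt_cons j i _ hi] at hord ⊢; omega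
  · refine ⟨?_, by simp; omega, hγ1, ?_, hγne⟩
    · simp only [Mono.order, List.map_cons, List.sum_cons, List.length_singleton] at hord ⊢; omega
    · intro δ hδ'
      simp only [List.mem_cons] at hδ'
      rcases hδ' with rfl | h
      · exact List.cons_ne_nil j []
      · exact hδne δ h
  · refine ⟨?_, hδ1, by simp; omega, hδne, ?_⟩
    · simp only [Mono.order, List.map_append, List.sum_append, List.map_cons, List.map_nil, List.sum_cons,
        List.sum_nil, List.length_singleton] at hord ⊢; omega
    · intro γ hγ'
      simp only [List.mem_append, List.mem_singleton] at hγ'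
      rcases hγ' with h | rfl
      · exact hγne γ h
      · exact List.cons_ne_nil j []

/-- The formal derivative of a formal sum of well-formed monomials of order `k` consists of well-formed monomials of order `k + 1`. [cite: LiuSlade2024, §2.2.1 (display (2.9): the shape of the terms of `f̂_α`)] -/
theorem Mono.WF_DF {k : ℕ} {L : FSum d} (hL : ∀ zm ∈ L, zm.2.WF k) (j : Fin d) : ∀ zm ∈ DF j L, zm.2.WF (k + 1) := by
  intro zm hzm
  simp only [DF, List.mem_flatMap, List.mem_map] at hzm
  obtain ⟨zm₀, h₀, zm', h', rfl⟩ := hzm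
  exact Mono.WF_Dm (hL zm₀ h₀) j zm' h'

/-- The formal sum of `∇^α f̂`: apply `∂_{α₁}, …, ∂_{α_k}` in turn to `Ê/(ÂF̂)`. [cite: LiuSlade2024, §2.2.1] -/
def fDeriv (α : List (Fin d)) : FSum d := α.foldl (fun L j => DF j L) [((1 : ℤ), Mono.init d)]

/-- `∇^{[]} f̂` is the single monomial `Ê/(ÂF̂)`. [cite: LiuSlade2024, §2.2.1 (`f̂ = ĈÊĜ = Ê/(ÂF̂)`)] -/
theorem fDeriv_nil : fDeriv ([] : List (Fin d)) = [((1 : ℤ), Mono.init d)] := rfl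

/-- `∇^{l ++ [i]} = ∂ᵢ ∇^l` at the level of formal sums. [folklore] -/
theorem fDeriv_append_singleton (l : List (Fin d)) (i : Fin d) : fDeriv (l ++ [i]) = DF i (fDeriv l) := by
  simp [fDeriv, List.foldl_append]

/-- All monomials of `∇^α f̂` are well formed of order `|α|` (display (2.9): `Σ|δₙ| + |α₂| + Σ|γₘ| = |α|`, `i ≤ |α₁|`, `j ≤ |α₃|`). [cite: LiuSlade2024, §2.2.1 (display (2.9))] -/
theorem Mono.WF_fDeriv : ∀ (α : List (Fin d)), ∀ zm ∈ fDeriv α, zm.2.WF α.length := by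
  intro α
  induction α using List.reverseRecOn with
  | nil => intro zm hzm; rw [fDeriv_nil, List.mem_singleton] at hzm; subst hzm; exact Mono.WF_init
  | append_singleton l i ih =>
    rw [fDeriv_append_singleton, List.length_append, List.length_singleton]
    exact Mono.WF_DF ih i

/-- The coefficient mass `Σ |z|` of a formal sum. [folklore] -/
def mass (L : FSum d) : ℝ := (L.map fun zm => |(zm.1 : ℝ)|).sum

/-- The empty formal sum has mass `0`. [folklore] -/
@[simp] theorem mass_nil : mass ([] : FSum d) = 0 := by simp [mass]

/-- Mass of a formal sum, head and tail. [folklore] -/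
@[simp] theorem mass_cons (zm : ℤ × Mono d) (L : FSum d) : mass (zm :: L) = |(zm.1 : ℝ)| + mass L := by simp [mass]

/-- Mass is additive under concatenation. [folklore] -/
theorem mass_append (L L' : FSum d) : mass (L ++ L') = mass L + mass L' := by simp [mass]

/-- Mass is nonnegative. [folklore] -/
theorem mass_nonneg (L : FSum d) : 0 ≤ mass L :=
  List.sum_nonneg (by intro x hx; simp only [List.mem_map] at hx; obtain ⟨zm, -, rfl⟩ := hx; exact abs_nonneg _)

/-- A formal sum of `n` unit-coefficient terms has mass `n`. [folklore] -/
theorem mass_map_range_one (n : ℕ) (g : ℕ → Mono d) : mass ((List.range n).map fun i => ((1 : ℤ), g i)) = n := by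
  induction n with
  | zero => simp [mass]
  | succ n ih => rw [List.range_succ, List.map_append, mass_append, ih]; simp [mass]

/-- The formal derivative of a well-formed monomial of order `k` has mass `≤ 4k + 3`. [folklore] -/
theorem mass_Dm_le {k : ℕ} {m : Mono d} (hm : m.WF k) (j : Fin d) : mass (Dm j m) ≤ 4 * k + 3 := by
  obtain ⟨-, hδ, hγ, -, -⟩ := hm
  rw [Dm, mass_append, mass_append, mass_append, mass_map_range_one, mass_map_range_one, mass_cons, mass_nil, mass_cons,
    mass_cons, mass_nil]
  have h1 : |(((-((m.δs.length : ℤ) + 1)) : ℤ) : ℝ)| = m.δs.length + 1 := by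
    push_cast; rw [abs_neg]; exact abs_of_nonneg (by positivity)
  have h2 : |(((-((m.γs.length : ℤ) + 1)) : ℤ) : ℝ)| = m.γs.length + 1 := by
    push_cast; rw [abs_neg]; exact abs_of_nonneg (by positivity)
  simp only [h1, h2, Int.cast_one, abs_one]
  have hδ' : (m.δs.length : ℝ) ≤ k := by exact_mod_cast hδ
  have hγ' : (m.γs.length : ℝ) ≤ k := by exact_mod_cast hγ
  linarith

/-- Scaling coefficients by `z` scales the mass by `|z|`. [folklore] -/
theorem mass_map_mul (z : ℤ) (L : FSum d) : mass (L.map fun zm' => (z * zm'.1, zm'.2)) = |(z : ℝ)| * mass L := by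
  induction L with
  | nil => simp
  | cons zm L ih => rw [List.map_cons, mass_cons, mass_cons, ih]; push_cast; rw [abs_mul]; ring

/-- `mass (∂ⱼ L) ≤ (4k+3) mass L` for formal sums of well-formed monomials of order `k`. [folklore] -/
theorem mass_DF_le {k : ℕ} {L : FSum d} (hL : ∀ zm ∈ L, zm.2.WF k) (j : Fin d) : mass (DF j L) ≤ (4 * k + 3) * mass L := by
  induction L with
  | nil => simp [DF]
  | cons zm L ih =>
    have hzm : zm.2.WF k := hL zm (by simp)
    have hL' : ∀ zm' ∈ L, zm'.2.WF k := fun zm' h => hL zm' (List.mem_cons_of_mem _ h)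
    rw [DF, List.flatMap_cons, mass_append, ← DF, mass_map_mul, mass_cons, mul_add]
    refine add_le_add ?_ (ih hL')
    rw [mul_comm]
    exact mul_le_mul_of_nonneg_right (mass_Dm_le hzm j) (abs_nonneg _)

/-- `mass (∇^α f̂) ≤ (4n+3)^{|α|}` for `|α| ≤ n`. [folklore] -/
theorem mass_fDeriv_le (n : ℕ) : ∀ (α : List (Fin d)), α.length ≤ n → mass (fDeriv α) ≤ (4 * n + 3) ^ α.length := by
  intro α
  induction α using List.reverseRecOn with
  | nil => intro; simp [fDeriv_nil, mass]
  | append_singleton l i ih =>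
    intro hl
    rw [List.length_append, List.length_singleton] at hl ⊢
    rw [fDeriv_append_singleton, pow_succ]
    have h := mass_DF_le (Mono.WF_fDeriv l) i
    have ih' := ih (by omega)
    have hk : (4 * (l.length : ℝ) + 3) ≤ 4 * n + 3 := by
      have : (l.length : ℝ) ≤ n := by exact_mod_cast (show l.length ≤ n by omega)
      linarith
    calc mass (DF i (fDeriv l)) ≤ (4 * l.length + 3) * mass (fDeriv l) := h
      _ ≤ (4 * n + 3) * (4 * n + 3) ^ l.length :=
          mul_le_mul hk ih' (mass_nonneg _) (by positivity)
      _ = (4 * n + 3) ^ l.length * (4 * n + 3) := by ring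

/-- Word lengths inside a well-formed monomial. [folklore] -/
theorem Mono.WF.lengths {k : ℕ} {m : Mono d} (hm : m.WF k) :
    (∀ δ ∈ m.δs, 1 ≤ δ.length ∧ δ.length ≤ k) ∧ m.β.length ≤ k ∧ (∀ γ ∈ m.γs, 1 ≤ γ.length ∧ γ.length ≤ k) := by
  obtain ⟨hord, -, -, hδne, hγne⟩ := hm
  simp only [Mono.order] at hord
  refine ⟨fun δ hδ => ⟨?_, ?_⟩, by omega, fun γ hγ => ⟨?_, ?_⟩⟩
  · exact Nat.one_le_iff_ne_zero.2 fun h => hδne δ hδ (List.eq_nil_of_length_eq_zero h)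
  · have := List.le_sum_of_mem (List.mem_map_of_mem (f := List.length) hδ); omega
  · exact Nat.one_le_iff_ne_zero.2 fun h => hγne γ hγ (List.eq_nil_of_length_eq_zero h)
  · have := List.le_sum_of_mem (List.mem_map_of_mem (f := List.length) hγ); omega

/-- The Hölder exponent sum of a well-formed monomial is at most one:
`Σ_δ (|δ|/d + τ) + ((2 - σ + |β|)/d + τ) + Σ_γ (|γ|/d + τ) ≤ (k + 2 - σ)/d + (2k+1)τ`. [cite: LiuSlade2024, proof of Proposition 2.4 ((2.11): r⁻¹ = Σr_n⁻¹ + q⁻¹ + Σq_m⁻¹ > (|α| + 2 - σ)/d)] -/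
theorem Mono.WF.exponent_sum_le {k : ℕ} {m : Mono d} (hm : m.WF k) (hd : 0 < (d : ℝ)) {σ τ : ℝ} (hτ : 0 ≤ τ) :
    (m.δs.map fun δ => (δ.length : ℝ) / d + τ).sum + ((2 - σ + m.β.length) / d + τ) +
      (m.γs.map fun γ => (γ.length : ℝ) / d + τ).sum ≤ ((k : ℝ) + 2 - σ) / d + (2 * k + 1) * τ := by
  obtain ⟨hord, hδ, hγ, -, -⟩ := hm
  have e : ∀ ws : List (List (Fin d)), (ws.map fun w => (w.length : ℝ) / d + τ).sum =
      (((ws.map List.length).sum : ℕ) : ℝ) / d + ws.length * τ := by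
    intro ws
    induction ws with
    | nil => simp
    | cons w ws ih => simp only [List.map_cons, List.sum_cons, List.length_cons, ih]; push_cast; ring
  rw [e, e]
  have hord' : (((m.δs.map List.length).sum : ℕ) : ℝ) + m.β.length + (((m.γs.map List.length).sum : ℕ) : ℝ) = k := by
    simp only [Mono.order] at hord; exact_mod_cast hord
  have hδ' : (m.δs.length : ℝ) ≤ k := by exact_mod_cast hδ
  have hγ' : (m.γs.length : ℝ) ≤ k := by exact_mod_cast hγ
  have : (((m.δs.map List.length).sum : ℕ) : ℝ) / d + ((2 - σ + m.β.length) / d) +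
      (((m.γs.map List.length).sum : ℕ) : ℝ) / d = ((k : ℝ) + 2 - σ) / d := by
    rw [← hord']; field_simp; ring
  nlinarith

end Bookkeeping

/-! ### Assembly: Hölder over the factors of a monomial, linear combinations, weak derivatives -/

section Assembly

variable {P Q R : List (Fin d) → (𝕋 d) → ℂ} {PN QN RN : ℕ → List (Fin d) → (𝕋 d) → ℂ}

/-- **Hölder over the factors of a well-formed monomial** (proof of Proposition 2.4: "By Lemma 2.5 and
Hölder's inequality, the `L^r` norm of (2.9) is bounded by (2.10) … we can take `r = 1`"), together with
the `L¹` convergence of the level-`N` monomials. [cite: LiuSlade2024, proof of Proposition 2.4 ((2.10)–(2.12))] -/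
theorem mono_facts {sP sQ : ℕ → ℝ} {B : ℝ} (hB1 : 1 ≤ B) {k n : ℕ}
    (hsP0 : ∀ ℓ, 0 ≤ sP ℓ) (hsQ0 : ∀ ℓ, 0 ≤ sQ ℓ)
    (hP : ∀ w : List (Fin d), 1 ≤ w.length → w.length ≤ n →
      AEStronglyMeasurable (P w) volume ∧ (∀ N, AEStronglyMeasurable (PN N w) volume) ∧
        eLpNorm (P w) (pinv (sP w.length)) volume ≤ ENNReal.ofReal B ∧
        Tendsto (fun N => eLpNorm (fun t => PN N w t - P w t) (pinv (sP w.length)) volume) atTop (𝓝 0))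
    (hQ : ∀ w : List (Fin d), w.length ≤ n →
      AEStronglyMeasurable (Q w) volume ∧ (∀ N, AEStronglyMeasurable (QN N w) volume) ∧
        eLpNorm (Q w) (pinv (sQ w.length)) volume ≤ ENNReal.ofReal B ∧
        Tendsto (fun N => eLpNorm (fun t => QN N w t - Q w t) (pinv (sQ w.length)) volume) atTop (𝓝 0))
    (hR : ∀ w : List (Fin d), 1 ≤ w.length → w.length ≤ n →
      AEStronglyMeasurable (R w) volume ∧ (∀ N, AEStronglyMeasurable (RN N w) volume) ∧
        eLpNorm (R w) (pinv (sP w.length)) volume ≤ ENNReal.ofReal B ∧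
        Tendsto (fun N => eLpNorm (fun t => RN N w t - R w t) (pinv (sP w.length)) volume) atTop (𝓝 0))
    {m : Mono d} (hm : m.WF k) (hkn : k ≤ n)
    (hS : (m.δs.map fun δ => sP δ.length).sum + sQ m.β.length + (m.γs.map fun γ => sP γ.length).sum ≤ 1) :
    AEStronglyMeasurable (evalM P Q R m) volume ∧ (∀ N, AEStronglyMeasurable (evalM (PN N) (QN N) (RN N) m) volume) ∧
      eLpNorm (evalM P Q R m) 1 volume ≤ ENNReal.ofReal (B ^ (2 * k + 1)) ∧
      Tendsto (fun N => eLpNorm (fun t => evalM (PN N) (QN N) (RN N) m t - evalM P Q R m t) 1 volume) atTop (𝓝 0) := by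
  classical
  obtain ⟨hδl, hβl, hγl⟩ := hm.lengths
  -- the index type of the factors
  let ι := Fin m.δs.length ⊕ (Unit ⊕ Fin m.γs.length)
  let fac : ι → (𝕋 d) → ℂ :=
    Sum.elim (fun i => P (m.δs[i.1])) (Sum.elim (fun _ => Q m.β) (fun i => R (m.γs[i.1])))
  let facN : ι → ℕ → (𝕋 d) → ℂ :=
    Sum.elim (fun i N => PN N (m.δs[i.1])) (Sum.elim (fun _ N => QN N m.β) (fun i N => RN N (m.γs[i.1])))
  let sx : ι → ℝ :=
    Sum.elim (fun i => sP (m.δs[i.1]).length) (Sum.elim (fun _ => sQ m.β.length) (fun i => sP (m.γs[i.1]).length))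
  -- the packages at each index
  have hfac : ∀ i : ι, AEStronglyMeasurable (fac i) volume ∧ (∀ N, AEStronglyMeasurable (facN i N) volume) ∧
      eLpNorm (fac i) (pinv (sx i)) volume ≤ ENNReal.ofReal B ∧
      Tendsto (fun N => eLpNorm (fun t => facN i N t - fac i t) (pinv (sx i)) volume) atTop (𝓝 0) := by
    rintro (i | ⟨⟨⟩⟩ | i)
    · have hmem : m.δs[i.1] ∈ m.δs := List.getElem_mem _
      exact hP _ (hδl _ hmem).1 ((hδl _ hmem).2.trans hkn)
    · exact hQ _ (hβl.trans hkn)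
    · have hmem : m.γs[i.1] ∈ m.γs := List.getElem_mem _
      exact hR _ (hγl _ hmem).1 ((hγl _ hmem).2.trans hkn)
  have hsx0 : ∀ i : ι, 0 ≤ sx i := by rintro (i | ⟨⟨⟩⟩ | i) <;> simp [sx, hsP0, hsQ0]
  -- products
  have hprod : ∀ (X Y Z : List (Fin d) → (𝕋 d) → ℂ) (t : 𝕋 d),
      evalM X Y Z m t = ∏ i : ι, Sum.elim (fun i => X (m.δs[i.1]) t) (Sum.elim (fun _ => Y m.β t) (fun i => Z (m.γs[i.1]) t)) i := by
    intro X Y Z t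
    rw [Fintype.prod_sum_type, Fintype.prod_sum_type, evalM, prodW, prodW]
    simp only [Sum.elim_inl, Sum.elim_inr, Finset.univ_unique, Finset.prod_singleton]
    rw [Fin.prod_univ_fun_getElem m.δs (fun w => X w t), Fin.prod_univ_fun_getElem m.γs (fun w => Z w t)]
    ring
  have hprodL : ∀ t, evalM P Q R m t = ∏ i : ι, fac i t := fun t => by
    rw [hprod]; congr 1; funext i; rcases i with i | ⟨⟨⟩⟩ | i <;> rfl
  have hprodN : ∀ N t, evalM (PN N) (QN N) (RN N) m t = ∏ i : ι, facN i N t := fun N t => by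
    rw [hprod]; congr 1; funext i; rcases i with i | ⟨⟨⟩⟩ | i <;> rfl
  -- exponents
  set S : ℝ := (m.δs.map fun δ => sP δ.length).sum + sQ m.β.length + (m.γs.map fun γ => sP γ.length).sum with hSdef
  have hexp : ∑ i : ι, (pinv (sx i))⁻¹ = ENNReal.ofReal S := by
    have e1 : ∀ i : ι, (pinv (sx i))⁻¹ = ENNReal.ofReal (sx i) := fun i => inv_inv _
    simp only [e1]
    rw [← ENNReal.ofReal_sum_of_nonneg (fun i _ => hsx0 i)]
    congr 1
    rw [Fintype.sum_sum_type, Fintype.sum_sum_type]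
    simp only [sx, Sum.elim_inl, Sum.elim_inr, Finset.univ_unique, Finset.sum_singleton]
    rw [Fin.sum_univ_fun_getElem m.δs (fun w => sP w.length), Fin.sum_univ_fun_getElem m.γs (fun w => sP w.length),
      hSdef]
    ring
  have hexp' : (∑ i : ι, (pinv (sx i))⁻¹)⁻¹ = pinv S := by rw [hexp]
  have h1S : (1 : ℝ≥0∞) ≤ pinv S := one_le_pinv hS
  -- cardinality
  have hcard : Fintype.card ι ≤ 2 * k + 1 := by
    simp only [ι, Fintype.card_sum, Fintype.card_fin, Fintype.card_unique]
    have := hm.δs_le; have := hm.γs_le; omega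
  have hB0 : (1 : ℝ≥0∞) ≤ ENNReal.ofReal B := by rw [← ENNReal.ofReal_one]; exact ENNReal.ofReal_le_ofReal hB1
  -- measurability
  have hmL : AEStronglyMeasurable (evalM P Q R m) volume := by
    have h := Finset.aestronglyMeasurable_fun_prod (Finset.univ : Finset ι) (fun i _ => (hfac i).1)
    exact h.congr (ae_of_all _ fun t => (hprodL t).symm)
  have hmN : ∀ N, AEStronglyMeasurable (evalM (PN N) (QN N) (RN N) m) volume := fun N => by
    have h := Finset.aestronglyMeasurable_fun_prod (Finset.univ : Finset ι) (fun i _ => (hfac i).2.1 N)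
    exact h.congr (ae_of_all _ fun t => (hprodN N t).symm)
  refine ⟨hmL, hmN, ?_, ?_⟩
  · -- Hölder
    have hH := eLpNorm_finset_prod_le (Finset.univ : Finset ι) fac (fun i => pinv (sx i)) (fun i _ => (hfac i).1)
    rw [hexp'] at hH
    calc eLpNorm (evalM P Q R m) 1 volume ≤ eLpNorm (evalM P Q R m) (pinv S) volume :=
          eLpNorm_le_eLpNorm_of_exponent_le h1S hmL
      _ = eLpNorm (fun t => ∏ i : ι, fac i t) (pinv S) volume :=
          congr_arg (eLpNorm · (pinv S) volume) (funext hprodL)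
      _ ≤ ∏ i : ι, eLpNorm (fac i) (pinv (sx i)) volume := hH
      _ ≤ ∏ _i : ι, ENNReal.ofReal B := Finset.prod_le_prod' fun i _ => (hfac i).2.2.1
      _ = ENNReal.ofReal B ^ Fintype.card ι := by rw [Finset.prod_const, Finset.card_univ]
      _ ≤ ENNReal.ofReal B ^ (2 * k + 1) := pow_le_pow_right₀ hB0 hcard
      _ = ENNReal.ofReal (B ^ (2 * k + 1)) := by rw [ENNReal.ofReal_pow (by linarith)]
  · -- convergence
    have hT := tendsto_eLpNorm_finset_prod_sub (Finset.univ : Finset ι) (fun i N => facN i N) fac (fun i => pinv (sx i))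
      (fun i _ N => (hfac i).2.1 N) (fun i _ => (hfac i).1)
      (fun i _ => ((hfac i).2.2.1.trans_lt ENNReal.ofReal_lt_top).ne)
      (fun i _ => by simpa only [Pi.sub_def] using (hfac i).2.2.2)
    rw [hexp'] at hT
    refine tendsto_of_tendsto_of_tendsto_of_le_of_le tendsto_const_nhds hT (fun _ => bot_le) fun N => ?_
    have e : (fun t => evalM (PN N) (QN N) (RN N) m t - evalM P Q R m t) =
        fun t => ∏ i : ι, facN i N t - ∏ i : ι, fac i t := by
      funext t; rw [hprodL, hprodN]
    rw [e]
    exact eLpNorm_le_eLpNorm_of_exponent_le h1S (((hmN N).sub hmL).congr (ae_of_all _ fun t => by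
      simp only [Pi.sub_apply]; rw [hprodL, hprodN]))

/-- **Linear combinations**: `L¹` bound `mass(L) · B'` and `L¹` convergence for a formal sum whose
monomials obey the conclusions of `mono_facts`. [folklore] -/
theorem fsum_facts {B' : ℝ} (hB' : 0 ≤ B') : ∀ (L : FSum d),
    (∀ zm ∈ L, AEStronglyMeasurable (evalM P Q R zm.2) volume ∧
      (∀ N, AEStronglyMeasurable (evalM (PN N) (QN N) (RN N) zm.2) volume) ∧
      eLpNorm (evalM P Q R zm.2) 1 volume ≤ ENNReal.ofReal B' ∧
      Tendsto (fun N => eLpNorm (fun t => evalM (PN N) (QN N) (RN N) zm.2 t - evalM P Q R zm.2 t) 1 volume)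
        atTop (𝓝 0)) →
    AEStronglyMeasurable (evalF P Q R L) volume ∧ (∀ N, AEStronglyMeasurable (evalF (PN N) (QN N) (RN N) L) volume) ∧
      eLpNorm (evalF P Q R L) 1 volume ≤ ENNReal.ofReal (mass L * B') ∧
      Tendsto (fun N => eLpNorm (fun t => evalF (PN N) (QN N) (RN N) L t - evalF P Q R L t) 1 volume) atTop (𝓝 0)
  | [], _ => by
    have e0 : ∀ (X Y Z : List (Fin d) → (𝕋 d) → ℂ), evalF X Y Z [] = fun _ => 0 :=
      fun X Y Z => funext fun t => evalF_nil X Y Z t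
    refine ⟨?_, fun N => ?_, ?_, ?_⟩
    · rw [e0]; exact aestronglyMeasurable_const
    · rw [e0]; exact aestronglyMeasurable_const
    · rw [e0, eLpNorm_zero']; exact bot_le
    · simp only [evalF_nil, sub_zero, eLpNorm_zero']; exact tendsto_const_nhds
  | zm :: L, h => by
    obtain ⟨hm1, hm2, hm3, hm4⟩ := h zm (by simp)
    obtain ⟨ih1, ih2, ih3, ih4⟩ := fsum_facts hB' L fun zm' hzm' => h zm' (List.mem_cons_of_mem _ hzm')
    have e0 : ∀ (X Y Z : List (Fin d) → (𝕋 d) → ℂ), evalF X Y Z (zm :: L) =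
        (fun t => (zm.1 : ℂ) * evalM X Y Z zm.2 t) + evalF X Y Z L := by
      intro X Y Z; funext t; simp
    have hs1 : AEStronglyMeasurable (fun t => (zm.1 : ℂ) * evalM P Q R zm.2 t) volume := aestronglyMeasurable_const.mul hm1
    have hs2 : ∀ N, AEStronglyMeasurable (fun t => (zm.1 : ℂ) * evalM (PN N) (QN N) (RN N) zm.2 t) volume :=
      fun N => aestronglyMeasurable_const.mul (hm2 N)
    refine ⟨?_, fun N => ?_, ?_, ?_⟩
    · rw [e0]; exact hs1.add ih1
    · rw [e0]; exact (hs2 N).add (ih2 N)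
    · rw [e0, mass_cons, add_mul, ENNReal.ofReal_add (by positivity) (mul_nonneg (mass_nonneg L) hB')]
      refine (eLpNorm_add_le hs1 ih1 le_rfl).trans (add_le_add ?_ ih3)
      have e : (fun t => (zm.1 : ℂ) * evalM P Q R zm.2 t) = (zm.1 : ℂ) • evalM P Q R zm.2 := by funext t; simp
      rw [e, eLpNorm_const_smul, ← ofReal_norm, ENNReal.ofReal_mul (abs_nonneg _), Complex.norm_intCast]
      exact mul_le_mul_of_nonneg_left hm3 bot_le
    · have e : ∀ N, (fun t => evalF (PN N) (QN N) (RN N) (zm :: L) t - evalF P Q R (zm :: L) t) =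
          ((zm.1 : ℂ) • fun t => evalM (PN N) (QN N) (RN N) zm.2 t - evalM P Q R zm.2 t) +
            fun t => evalF (PN N) (QN N) (RN N) L t - evalF P Q R L t := by
        intro N; funext t; simp only [Pi.add_apply, Pi.smul_apply, smul_eq_mul, evalF_cons]; ring
      have hle : ∀ N, eLpNorm (fun t => evalF (PN N) (QN N) (RN N) (zm :: L) t - evalF P Q R (zm :: L) t) 1 volume ≤
          ‖(zm.1 : ℂ)‖ₑ * eLpNorm (fun t => evalM (PN N) (QN N) (RN N) zm.2 t - evalM P Q R zm.2 t) 1 volume +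
            eLpNorm (fun t => evalF (PN N) (QN N) (RN N) L t - evalF P Q R L t) 1 volume := by
        intro N
        rw [e N]
        refine (eLpNorm_add_le (((hm2 N).sub hm1).const_smul _) ((ih2 N).sub ih1) le_rfl).trans ?_
        rw [eLpNorm_const_smul]
        exact le_rfl
      have hlim : Tendsto (fun N => ‖(zm.1 : ℂ)‖ₑ * eLpNorm (fun t => evalM (PN N) (QN N) (RN N) zm.2 t - evalM P Q R zm.2 t) 1 volume +
          eLpNorm (fun t => evalF (PN N) (QN N) (RN N) L t - evalF P Q R L t) 1 volume) atTop (𝓝 0) := by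
        have h := (ENNReal.Tendsto.const_mul hm4 (Or.inr (enorm_ne_top (x := (zm.1 : ℂ))))).add ih4
        rwa [mul_zero, add_zero] at h
      exact tendsto_of_tendsto_of_tendsto_of_le_of_le tendsto_const_nhds hlim (fun _ => bot_le) hle

/-- **Weak derivatives of the limit.** At level `N` all factors are smooth, so `∂ⱼ` of the evaluated
formal sum `∇^l f̂_N` is the evaluation of its formal derivative (classically, hence weakly); weak
derivatives pass to the `L¹` limits `N → ∞`, word by word (`l ↦ l ++ [i]`).
[cite: LiuSlade2024, §2.2.1 and Appendix A (Lemmas A.2–A.3: the derivatives of `f̂` are computed by the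
usual product and quotient rules in the weak sense)] -/
theorem weakDeriv_facts
    (hsm : ∀ N, (∀ w, Torus.IsSmooth (PN N w)) ∧ (∀ w, Torus.IsSmooth (QN N w)) ∧ (∀ w, Torus.IsSmooth (RN N w)))
    (hrule : ∀ N (j : Fin d),
      (∀ w t, Torus.partialDeriv j (PN N w) t = PN N (j :: w) t - PN N [j] t * PN N w t) ∧
      (∀ w t, Torus.partialDeriv j (QN N w) t = QN N (j :: w) t - PN N [j] t * QN N w t - RN N [j] t * QN N w t) ∧
      (∀ w t, Torus.partialDeriv j (RN N w) t = RN N (j :: w) t - RN N [j] t * RN N w t))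
    {n : ℕ} (hint : ∀ α : List (Fin d), α.length ≤ n → Integrable (evalF P Q R (fDeriv α)))
    (hlim : ∀ α : List (Fin d), α.length ≤ n →
      Tendsto (fun N => eLpNorm (fun t => evalF (PN N) (QN N) (RN N) (fDeriv α) t - evalF P Q R (fDeriv α) t) 1 volume)
        atTop (𝓝 0)) :
    ∀ α : List (Fin d), α.length ≤ n → HasTorusWeakDeriv (evalF P Q R (fDeriv [])) α (evalF P Q R (fDeriv α)) := by
  intro α
  induction α using List.reverseRecOn with
  | nil => intro h0; exact hasTorusWeakDeriv_nil (hint [] h0)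
  | append_singleton l i ih =>
    intro hl
    have hl' : l.length ≤ n := by rw [List.length_append, List.length_singleton] at hl; omega
    have hsmN : ∀ N (L : FSum d), Torus.IsSmooth (evalF (PN N) (QN N) (RN N) L) :=
      fun N L => isSmooth_evalF (hsm N).1 (hsm N).2.1 (hsm N).2.2 L
    have hα := hint (l ++ [i]) hl
    have hαlim := hlim (l ++ [i]) hl
    rw [fDeriv_append_singleton] at hα hαlim ⊢
    refine HasTorusWeakDeriv.append_singleton (ih hl') ?_ hα
    refine hasWeakPartialDeriv_of_tendsto (us := fun N => evalF (PN N) (QN N) (RN N) (fDeriv l))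
      (as := fun N => evalF (PN N) (QN N) (RN N) (DF i (fDeriv l))) (Eventually.of_forall fun N => ?_)
      (fun N => (hsmN N _).continuous.integrable_unitAddTorus) (fun N => (hsmN N _).continuous.integrable_unitAddTorus)
      (hint l hl') hα ?_ ?_
    · have hs := hasWeakPartialDeriv_of_isSmooth (hsmN N (fDeriv l)) i
      have e : Torus.partialDeriv i (evalF (PN N) (QN N) (RN N) (fDeriv l)) = evalF (PN N) (QN N) (RN N) (DF i (fDeriv l)) :=
        funext fun t => partialDeriv_evalF (hsm N).1 (hsm N).2.1 (hsm N).2.2 (hrule N i).1 (hrule N i).2.1 (hrule N i).2.2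
          (fDeriv l) t
      rwa [e] at hs
    · simpa only [Pi.sub_def] using hlim l hl'
    · simpa only [Pi.sub_def] using hαlim

end Assembly

/-! ### Proposition 2.4 -/

section Main

/-- The a.e. identification of the starting formal sum with `f̂ = 1/F̂ - λ/Â`:
`Ê/(ÂF̂) = (Â - λF̂)/(ÂF̂) = 1/F̂ - λ/Â` off `k = 0`. [cite: LiuSlade2024, (1.28)–(1.30)] -/
theorem evalF_fDeriv_nil_ae {K₁ K₂ ρ : ℝ} (hd : 1 ≤ d) (hK₂ : 0 < K₂) (hρ : 0 < ρ) {F : Site d → ℝ}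
    (hF : LS24Assumption d K₁ K₂ ρ F) (hμ0 : 0 < ls24Mu F) (hμ1 : ls24Mu F ≤ 1) :
    evalF (facPL F) (facQL F) (facRL F) (fDeriv []) =ᵐ[volume] ls24fHat F := by
  have hd0 : (0 : ℝ) < d := by exact_mod_cast hd
  filter_upwards [ae_tnorm_pos hd] with t ht
  have ha : latticeFourier (lsA d (ls24Mu F)) t ≠ 0 := fun h0 => by
    have h1 := re_latticeFourier_lsA_ge hd hμ0.le hμ1 t
    rw [h0, Complex.zero_re] at h1
    have : 0 < 8 * ls24Mu F / d * tnorm t ^ 2 := by positivity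
    linarith
  have hf : latticeFourier F t ≠ 0 := fun h0 => by
    have h1 := re_latticeFourier_ge hF t
    rw [h0, Complex.zero_re] at h1
    have : 0 < K₂ * tnorm t ^ 2 := by positivity
    linarith
  rw [fDeriv_nil, evalF_cons, evalF_nil]
  simp only [evalM, Mono.init, prodW_nil, Int.cast_one, one_mul, mul_one, add_zero]
  rw [facQL, EhatL, AhatL_nil, FhatL_nil (LS24Assumption.summable_abs hF hρ), ls24fHat]
  field_simp

end Main

end LiuSlade2024Prop24

open LiuSlade2024Prop24 in
/-- **Liu–Slade 2024, Proposition 2.4** (with the `L¹` bounds of its proof, uniformly in `F`):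
under Assumption 1.1 (`LS24Assumption d K₁ K₂ ρ F`, `d > 2`, `ρ > (d-8)/2 ∨ 0`) the function
`f̂ = 1/F̂ - λ/Â_μ` is integrable and `n_d` times weakly differentiable on `𝕋^d`, all weak derivatives
`f̂_α` (`|α| ≤ n_d`) having `L¹` norms bounded by a constant depending only on `d, K₁, K₂, ρ`.
[cite: LiuSlade2024, Proposition 2.4 and its proof (§2.2.1–§2.2.2), Theorem 1.2 (uniformity clause)] -/
theorem LiuSlade2024_prop24_holds : LiuSlade2024_prop24 := by
  intro d hd K₁ K₂ ρ hK₁ hK₂ hρmax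
  have hd3 : 3 ≤ d := hd
  have hd1 : 1 ≤ d := by omega
  have hd0 : (0 : ℝ) < d := by exact_mod_cast (show 0 < d by omega)
  have hρ : 0 < ρ := lt_of_le_of_lt (le_max_right _ _) hρmax
  have hρd : ((d : ℝ) - 8) / 2 < ρ := lt_of_le_of_lt (le_max_left _ _) hρmax
  -- `n = n_d = d - 2 + s₀`
  set n : ℕ := lsND d ρ with hn
  obtain ⟨s₀, hs₀0, hs₀1, hs₀n, hs₀ρ, hnρ⟩ : ∃ s₀ : ℝ, 0 ≤ s₀ ∧ s₀ ≤ 1 ∧ (n : ℝ) = d - 2 + s₀ ∧ s₀ < min ρ 2 ∧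
      (n : ℝ) < d / 2 + 2 + ρ := by
    rw [hn, lsND]
    split_ifs with h
    · refine ⟨0, le_rfl, zero_le_one, ?_, lt_min hρ two_pos, ?_⟩
      · rw [Nat.cast_sub (by omega : 2 ≤ d)]; push_cast; ring
      · rw [Nat.cast_sub (by omega : 2 ≤ d)]; push_cast; linarith
    · push Not at h
      have h1 : 1 < ρ := by have := le_max_right (((d : ℝ) - 8) / 2) 0; linarith
      have h2 : ((d : ℝ) - 6) / 2 < ρ := by have := le_max_left (((d : ℝ) - 8) / 2) 0; linarith
      refine ⟨1, zero_le_one, le_rfl, ?_, lt_min h1 one_lt_two, ?_⟩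
      · rw [Nat.cast_sub (by omega : 1 ≤ d)]; push_cast; ring
      · rw [Nat.cast_sub (by omega : 1 ≤ d)]; push_cast; linarith
  -- exponents `σ`, `g = (σ - s₀)/d`, `τ`
  have hminρ : min ρ 2 ≤ ρ := min_le_left _ _
  have hmin2 : min ρ 2 ≤ 2 := min_le_right _ _
  have hmin0 : 0 < min ρ 2 := lt_min hρ two_pos
  set σ : ℝ := (s₀ + min ρ 2) / 2 with hσ
  have hσ0 : 0 < σ := by rw [hσ]; linarith
  have hσs : s₀ < σ := by rw [hσ]; linarith
  have hσρ : σ < ρ := by rw [hσ]; linarith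
  have hσ2 : σ ≤ 2 := by rw [hσ]; linarith
  have hσs1 : σ - s₀ ≤ 1 := by rw [hσ]; linarith
  set g : ℝ := (σ - s₀) / d with hg
  have hg0 : 0 < g := div_pos (by linarith) hd0
  have hgd : g ≤ 1 / d := div_le_div_of_nonneg_right hσs1 hd0.le
  set M : ℝ := max (((n : ℝ) - 2 - ρ) / d) 0 with hM
  have hM2 : M < 1 / 2 := by
    refine max_lt ?_ (by norm_num)
    rw [div_lt_iff₀ hd0]; linarith
  set τ : ℝ := min (g / (2 * n + 2)) ((1 - 2 * M) / 2) with hτ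
  have hτ0 : 0 < τ := lt_min (div_pos hg0 (by positivity)) (by linarith)
  have hτg : τ ≤ g / (2 * n + 2) := min_le_left _ _
  have hτg' : τ ≤ g := hτg.trans (div_le_self hg0.le (by linarith [(Nat.cast_nonneg n : (0 : ℝ) ≤ n)]))
  have hτd : τ ≤ 1 / d := hτg'.trans hgd
  have hτM : M + τ / 2 ≤ 1 / 2 := by have := min_le_right (g / (2 * n + 2)) ((1 - 2 * M) / 2); linarith
  -- per-`ℓ` hypotheses of the packages
  have hℓn : ∀ ℓ : ℕ, ℓ ≤ n → (ℓ : ℝ) < d / 2 + 2 + ρ := fun ℓ hℓ => by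
    have : (ℓ : ℝ) ≤ n := by exact_mod_cast hℓ
    linarith
  have hs1P : ∀ ℓ : ℕ, ℓ ≤ n → (ℓ : ℝ) / d + τ ≤ 1 := fun ℓ hℓ => by
    have h1 : (ℓ : ℝ) ≤ n := by exact_mod_cast hℓ
    have h2 : (ℓ : ℝ) / d ≤ 1 - 1 / d := by
      rw [div_le_iff₀ hd0, sub_mul, one_div, inv_mul_cancel₀ hd0.ne', one_mul]; linarith
    linarith
  have hhalf : ∀ ℓ : ℕ, ℓ ≤ n → max (((ℓ : ℝ) - 2 - ρ) / d) 0 + τ / 2 ≤ 1 / 2 := fun ℓ hℓ => by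
    have h1 : (ℓ : ℝ) ≤ n := by exact_mod_cast hℓ
    have : max (((ℓ : ℝ) - 2 - ρ) / d) 0 ≤ M := max_le_max (div_le_div_of_nonneg_right (by linarith) hd0.le) le_rfl
    linarith
  have hng : ((n : ℝ) + 2 - σ) / d = 1 - g := by
    rw [hg, hs₀n]; field_simp; ring
  have hs1Q : ∀ ℓ : ℕ, ℓ ≤ n → (2 - σ + ℓ) / d + τ ≤ 1 := fun ℓ hℓ => by
    have h1 : (ℓ : ℝ) ≤ n := by exact_mod_cast hℓ
    have : (2 - σ + ℓ) / d ≤ ((n : ℝ) + 2 - σ) / d := div_le_div_of_nonneg_right (by linarith) hd0.le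
    linarith
  have hexp1 : ∀ k : ℕ, k ≤ n → ((k : ℝ) + 2 - σ) / d + (2 * k + 1) * τ ≤ 1 := fun k hk => by
    have h0 : (k : ℝ) ≤ n := by exact_mod_cast hk
    have h1 : ((k : ℝ) + 2 - σ) / d ≤ ((n : ℝ) + 2 - σ) / d := div_le_div_of_nonneg_right (by linarith) hd0.le
    have h3 : (2 * (k : ℝ) + 1) * τ ≤ (2 * n + 1) * τ := mul_le_mul_of_nonneg_right (by linarith) hτ0.le
    have h4 : (2 * (n : ℝ) + 1) * τ ≤ (2 * n + 1) * (g / (2 * n + 2)) := mul_le_mul_of_nonneg_left hτg (by positivity)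
    have h5 : (2 * (n : ℝ) + 1) * (g / (2 * n + 2)) ≤ g := by
      rw [← mul_div_assoc, div_le_iff₀ (by positivity)]; nlinarith [hg0.le, (Nat.cast_nonneg n : (0 : ℝ) ≤ n)]
    linarith
  -- the packages, uniformly in `ℓ ≤ n`
  have hPk : ∀ ℓ : ℕ, ∃ B : ℝ, 1 ≤ ℓ → ℓ ≤ n → ∀ F : Site d → ℝ, LS24Assumption d K₁ K₂ ρ F →
      ∀ w : List (Fin d), w.length = ℓ →
        AEStronglyMeasurable (facPL F w) volume ∧ (∀ N, AEStronglyMeasurable (facPN F N w) volume) ∧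
        eLpNorm (facPL F w) (pinv ((ℓ : ℝ) / d + τ)) volume ≤ ENNReal.ofReal B ∧
        Tendsto (fun N => eLpNorm (fun t => facPN F N w t - facPL F w t) (pinv ((ℓ : ℝ) / d + τ)) volume) atTop (𝓝 0) := by
    intro ℓ
    by_cases h : 1 ≤ ℓ ∧ ℓ ≤ n
    · obtain ⟨B, hB⟩ := packP hd3 hK₁ hK₂ hρ hτ0 ℓ h.1 (hℓn ℓ h.2) (hs1P ℓ h.2)
      exact ⟨B, fun _ _ => hB⟩
    · exact ⟨0, fun h1 h2 => (h ⟨h1, h2⟩).elim⟩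
  have hRk : ∀ ℓ : ℕ, ∃ B : ℝ, 1 ≤ ℓ → ℓ ≤ n → ∀ F : Site d → ℝ, LS24Assumption d K₁ K₂ ρ F →
      ∀ w : List (Fin d), w.length = ℓ →
        AEStronglyMeasurable (facRL F w) volume ∧ (∀ N, AEStronglyMeasurable (facRN F N w) volume) ∧
        eLpNorm (facRL F w) (pinv ((ℓ : ℝ) / d + τ)) volume ≤ ENNReal.ofReal B ∧
        Tendsto (fun N => eLpNorm (fun t => facRN F N w t - facRL F w t) (pinv ((ℓ : ℝ) / d + τ)) volume) atTop (𝓝 0) := by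
    intro ℓ
    by_cases h : 1 ≤ ℓ ∧ ℓ ≤ n
    · obtain ⟨B, hB⟩ := packR hd3 hK₁ hK₂ hρ hτ0 ℓ h.1 (hℓn ℓ h.2) (hs1P ℓ h.2) (hhalf ℓ h.2)
      exact ⟨B, fun _ _ => hB⟩
    · exact ⟨0, fun h1 h2 => (h ⟨h1, h2⟩).elim⟩
  have hQk : ∀ ℓ : ℕ, ∃ B : ℝ, ℓ ≤ n → ∀ F : Site d → ℝ, LS24Assumption d K₁ K₂ ρ F →
      ∀ w : List (Fin d), w.length = ℓ →
        AEStronglyMeasurable (facQL F w) volume ∧ (∀ N, AEStronglyMeasurable (facQN F N w) volume) ∧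
        eLpNorm (facQL F w) (pinv ((2 - σ + ℓ) / d + τ)) volume ≤ ENNReal.ofReal B ∧
        Tendsto (fun N => eLpNorm (fun t => facQN F N w t - facQL F w t) (pinv ((2 - σ + ℓ) / d + τ)) volume)
          atTop (𝓝 0) := by
    intro ℓ
    by_cases h : ℓ ≤ n
    · obtain ⟨B, hB⟩ := packQ hd3 hK₁ hK₂ hρ hσ0 hσρ hσ2 hτ0 ℓ (hℓn ℓ h) (hs1Q ℓ h) (hhalf ℓ h)
      exact ⟨B, fun _ => hB⟩
    · exact ⟨0, fun h1 => (h h1).elim⟩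
  choose BP hBP using hPk
  choose BR hBR using hRk
  choose BQ hBQ using hQk
  -- one constant
  set Bmax : ℝ := 1 + ∑ ℓ ∈ Finset.range (n + 1), (|BP ℓ| + |BQ ℓ| + |BR ℓ|) with hBmax
  have hsum0 : 0 ≤ ∑ ℓ ∈ Finset.range (n + 1), (|BP ℓ| + |BQ ℓ| + |BR ℓ|) :=
    Finset.sum_nonneg fun ℓ _ => by positivity
  have hBmax1 : 1 ≤ Bmax := by rw [hBmax]; linarith
  have hBle : ∀ ℓ, ℓ ≤ n → BP ℓ ≤ Bmax ∧ BQ ℓ ≤ Bmax ∧ BR ℓ ≤ Bmax := fun ℓ hℓ => by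
    have h1 : |BP ℓ| + |BQ ℓ| + |BR ℓ| ≤ ∑ ℓ ∈ Finset.range (n + 1), (|BP ℓ| + |BQ ℓ| + |BR ℓ|) :=
      Finset.single_le_sum (f := fun ℓ => |BP ℓ| + |BQ ℓ| + |BR ℓ|) (fun ℓ _ => by positivity)
        (Finset.mem_range.2 (by omega))
    refine ⟨?_, ?_, ?_⟩ <;>
      linarith [le_abs_self (BP ℓ), le_abs_self (BQ ℓ), le_abs_self (BR ℓ), abs_nonneg (BP ℓ), abs_nonneg (BQ ℓ),
        abs_nonneg (BR ℓ)]
  set C : ℝ := (4 * n + 3) ^ n * Bmax ^ (2 * n + 1) with hC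
  have hC0 : 0 ≤ C := by positivity
  have hCle : ∀ k : ℕ, k ≤ n → ∀ x : ℝ, x ≤ (4 * n + 3) ^ k → x * Bmax ^ (2 * k + 1) ≤ C := fun k hk x hx => by
    have h1 : x ≤ (4 * (n : ℝ) + 3) ^ n := hx.trans (pow_le_pow_right₀ (by linarith [(Nat.cast_nonneg n : (0 : ℝ) ≤ n)]) hk)
    have h2 : Bmax ^ (2 * k + 1) ≤ Bmax ^ (2 * n + 1) := pow_le_pow_right₀ hBmax1 (by omega)
    calc x * Bmax ^ (2 * k + 1) ≤ (4 * (n : ℝ) + 3) ^ n * Bmax ^ (2 * n + 1) :=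
          mul_le_mul h1 h2 (by positivity) (by positivity)
      _ = C := by rw [hC]
  refine ⟨C, fun F hF => ?_⟩
  -- a fixed `F`
  obtain ⟨-, -, hμ0, hμ1, -, -⟩ := params_of_assumption hd1 hK₁ hK₂ hρ hF
  have hP : ∀ w : List (Fin d), 1 ≤ w.length → w.length ≤ n →
      AEStronglyMeasurable (facPL F w) volume ∧ (∀ N, AEStronglyMeasurable (facPN F N w) volume) ∧
        eLpNorm (facPL F w) (pinv ((w.length : ℝ) / d + τ)) volume ≤ ENNReal.ofReal Bmax ∧
        Tendsto (fun N => eLpNorm (fun t => facPN F N w t - facPL F w t) (pinv ((w.length : ℝ) / d + τ)) volume)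
          atTop (𝓝 0) := fun w h1 h2 => by
    obtain ⟨a, b, c, e⟩ := hBP w.length h1 h2 F hF w rfl
    exact ⟨a, b, c.trans (ENNReal.ofReal_le_ofReal (hBle _ h2).1), e⟩
  have hR : ∀ w : List (Fin d), 1 ≤ w.length → w.length ≤ n →
      AEStronglyMeasurable (facRL F w) volume ∧ (∀ N, AEStronglyMeasurable (facRN F N w) volume) ∧
        eLpNorm (facRL F w) (pinv ((w.length : ℝ) / d + τ)) volume ≤ ENNReal.ofReal Bmax ∧
        Tendsto (fun N => eLpNorm (fun t => facRN F N w t - facRL F w t) (pinv ((w.length : ℝ) / d + τ)) volume)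
          atTop (𝓝 0) := fun w h1 h2 => by
    obtain ⟨a, b, c, e⟩ := hBR w.length h1 h2 F hF w rfl
    exact ⟨a, b, c.trans (ENNReal.ofReal_le_ofReal (hBle _ h2).2.2), e⟩
  have hQ : ∀ w : List (Fin d), w.length ≤ n →
      AEStronglyMeasurable (facQL F w) volume ∧ (∀ N, AEStronglyMeasurable (facQN F N w) volume) ∧
        eLpNorm (facQL F w) (pinv ((2 - σ + w.length) / d + τ)) volume ≤ ENNReal.ofReal Bmax ∧
        Tendsto (fun N => eLpNorm (fun t => facQN F N w t - facQL F w t) (pinv ((2 - σ + w.length) / d + τ)) volume)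
          atTop (𝓝 0) := fun w h2 => by
    obtain ⟨a, b, c, e⟩ := hBQ w.length h2 F hF w rfl
    exact ⟨a, b, c.trans (ENNReal.ofReal_le_ofReal (hBle _ h2).2.1), e⟩
  -- monomials (Hölder) and formal sums
  have hmono : ∀ α : List (Fin d), α.length ≤ n → ∀ zm ∈ fDeriv α,
      AEStronglyMeasurable (evalM (facPL F) (facQL F) (facRL F) zm.2) volume ∧
      (∀ N, AEStronglyMeasurable (evalM (facPN F N) (facQN F N) (facRN F N) zm.2) volume) ∧
      eLpNorm (evalM (facPL F) (facQL F) (facRL F) zm.2) 1 volume ≤ ENNReal.ofReal (Bmax ^ (2 * α.length + 1)) ∧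
      Tendsto (fun N => eLpNorm (fun t => evalM (facPN F N) (facQN F N) (facRN F N) zm.2 t -
        evalM (facPL F) (facQL F) (facRL F) zm.2 t) 1 volume) atTop (𝓝 0) := fun α hα zm hzm =>
    mono_facts (PN := facPN F) (QN := facQN F) (RN := facRN F) (sP := fun ℓ => (ℓ : ℝ) / d + τ)
      (sQ := fun ℓ => (2 - σ + ℓ) / d + τ) hBmax1 (fun ℓ => by positivity)
      (fun ℓ => add_nonneg (div_nonneg (by linarith [(Nat.cast_nonneg ℓ : (0 : ℝ) ≤ ℓ)]) hd0.le) hτ0.le) hP hQ hR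
      (Mono.WF_fDeriv α zm hzm) hα
      (((Mono.WF_fDeriv α zm hzm).exponent_sum_le hd0 hτ0.le).trans (hexp1 α.length hα))
  have hfs : ∀ α : List (Fin d), α.length ≤ n →
      AEStronglyMeasurable (evalF (facPL F) (facQL F) (facRL F) (fDeriv α)) volume ∧
      (∀ N, AEStronglyMeasurable (evalF (facPN F N) (facQN F N) (facRN F N) (fDeriv α)) volume) ∧
      eLpNorm (evalF (facPL F) (facQL F) (facRL F) (fDeriv α)) 1 volume ≤
        ENNReal.ofReal (mass (fDeriv α) * Bmax ^ (2 * α.length + 1)) ∧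
      Tendsto (fun N => eLpNorm (fun t => evalF (facPN F N) (facQN F N) (facRN F N) (fDeriv α) t -
        evalF (facPL F) (facQL F) (facRL F) (fDeriv α) t) 1 volume) atTop (𝓝 0) := fun α hα =>
    fsum_facts (by positivity) (fDeriv α) (hmono α hα)
  have hint : ∀ α : List (Fin d), α.length ≤ n → Integrable (evalF (facPL F) (facQL F) (facRL F) (fDeriv α)) :=
    fun α hα => memLp_one_iff_integrable.1 ⟨(hfs α hα).1, (hfs α hα).2.2.1.trans_lt ENNReal.ofReal_lt_top⟩
  have hL1 : ∀ α : List (Fin d), α.length ≤ n → (∫ t, ‖evalF (facPL F) (facQL F) (facRL F) (fDeriv α) t‖) ≤ C :=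
    fun α hα => by
    rw [integral_norm_eq_lintegral_enorm (hfs α hα).1, ← eLpNorm_one_eq_lintegral_enorm]
    exact ENNReal.toReal_le_of_le_ofReal hC0 ((hfs α hα).2.2.1.trans (ENNReal.ofReal_le_ofReal
      (hCle α.length hα _ (mass_fDeriv_le n α hα))))
  -- weak derivatives
  have j₀ : Fin d := ⟨0, by omega⟩
  have hwd := weakDeriv_facts (P := facPL F) (Q := facQL F) (R := facRL F) (PN := facPN F) (QN := facQN F) (RN := facRN F)
    (fun N => by
      obtain ⟨h1, h2, h3, -⟩ := factor_rules hd1 hF hρ hK₂.le hμ0.le hμ1 N j₀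
      exact ⟨h1, h2, h3⟩)
    (fun N j => by
      obtain ⟨-, -, -, h4, h5, h6⟩ := factor_rules hd1 hF hρ hK₂.le hμ0.le hμ1 N j
      exact ⟨h4, h5, h6⟩)
    hint (fun α hα => (hfs α hα).2.2.2)
  -- identification with `f̂`
  have hid := evalF_fDeriv_nil_ae hd1 hK₂ hρ hF hμ0 hμ1
  have hn0 : ([] : List (Fin d)).length ≤ n := by simp
  refine ⟨(hint [] hn0).congr hid, ?_, fun α hα => ⟨evalF (facPL F) (facQL F) (facRL F) (fDeriv α),
    HasTorusWeakDeriv.congr_ae (hwd α hα) hid EventuallyEq.rfl, hL1 α hα⟩⟩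
  have e : (∫ t, ‖ls24fHat F t‖) = ∫ t, ‖evalF (facPL F) (facQL F) (facRL F) (fDeriv []) t‖ :=
    integral_congr_ae (by filter_upwards [hid] with t ht; rw [ht])
  rw [e]
  exact hL1 [] hn0

end Literature.Barriers.CriticalPhenomena.SpreadOutIsing

end
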